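import Literature.MathematicalPhysics.QuantumFieldTheory.Balaban1983to89.B9SectBCodedChainR1
import Literature.MathematicalPhysics.QuantumFieldTheory.Balaban1983to89.B9SectBCodedChainC37Y
import Literature.MathematicalPhysics.QuantumFieldTheory.Balaban1983to89.B9SectBCodedClassR
import Literature.MathematicalPhysics.QuantumFieldTheory.Balaban1983to89.B9Ineq347SiteReadingY
import Literature.MathematicalPhysics.QuantumFieldTheory.Balaban1983to89.B9SectBCodedChainGlob
import Literature.MathematicalPhysics.QuantumFieldTheory.Balaban1983to89.B9SectBCodedChainAn
import Literature.MathematicalPhysics.QuantumFieldTheory.Balaban1983to89.B9SectBL2ReadingsY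
import Literature.MathematicalPhysics.QuantumFieldTheory.Balaban1983to89.B9SectBL2StepAtLettersV2
import Literature.MathematicalPhysics.QuantumFieldTheory.Balaban1983to89.B9SectBL2DictionaryY
import Literature.MathematicalPhysics.QuantumFieldTheory.Balaban1983to89.B9Eq370LetterConversionL2
import Literature.MathematicalPhysics.QuantumFieldTheory.Balaban1983to89.B9SectBL2TransferConvY
import Literature.MathematicalPhysics.QuantumFieldTheory.Balaban1983to89.B9Eq38CrossLettersL2
import Literature.MathematicalPhysics.QuantumFieldTheory.Balaban1983to89.B9SectBL2TransferInY

/-!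
# `Balaban1983to89.B9SectBCodedChainR2` — CASCADE-R BUNDLE 2∕7 (director-ym №279 GO-R; №277 (3) `hunitA` cure): the class-parametric twins
# `B9SectBCodedChainC37YR`, `B9SectBCodedChainGlobR`, `B9SectBCodedChainAnR`, `B9SectBL2DictionaryYR`, `B9SectBL2TransferConvYR`, `B9SectBL2TransferInYR`

statement-level skeleton of published theorems with citation tags; proofs where landed; nothing here is a claim about the
Yang–Mills mass gap

WHY A BUNDLE.  The minimal R-sub-path of №279 (3) is a 47-module dependency chain; post-accept olean builds are the latency of record today, so the
chain is filed as 7 layered modules instead of 47.  This module is the VERBATIM concatenation, in dependency order, of the 6 generated twin files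
named above (each keeps its own namespace `…<Original>R`, its own honest twin header and a pointer to the original module documentation; consumers `open` the
namespaces exactly as they would the per-file twins).  Generated by dag-n06-c g16 (`mkbundle.py`, HOME `pub-ymgap-dag-n06-c/lean/g16/`).

HONEST SCOPE.  Re-typing bookkeeping; nothing of [B9] asserted beyond the originals; COUNT-NEUTRAL; N06 NOT discharged; nothing continuum ∕ OS ∕ mass gap ∕ Clay.
-/

/-!
# `Balaban1983to89.B9SectBCodedChainC37YR` — THE CLASS-PARAMETRIC TWIN of `B9SectBCodedChainC37Y` (CASCADE-R, director-ym №279 GO-R; №277 (3) `hunitA` cure; dag-n06-d SOCKET-(α) class question)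

statement-level skeleton of published theorems with citation tags; proofs where landed; nothing here is a claim about the
Yang–Mills mass gap

WHAT THIS FILE IS.  The original module `B9SectBCodedChainC37Y` types its objects over MODULE 3's member carrier `bg9Y 𝔸 G x` (MODULE 2's small-cube class (3.35)).  This file RE-DECLARES, with UNCHANGED NAMES inside the namespace `…B9SectBCodedChainC37YR`, exactly its 3 class-dependent declarations over the CLASS-PARAMETRIC carrier `B9SectBCodedClassR.bg9YC 𝔸 G P x` (`P : RegExtraY …` = the two cube conditions of (3.35)∕(3.36) as a parameter; `bg9Y 𝔸 G x = bg9YC 𝔸 G (extraY 𝔸 G) x` by `rfl`, so every declaration here specialises definitionally to its original; at the record's reading of PRINT's class, `P := extraYPb 𝔸 G`, the displayed laws `hreg335P` ((3.35) on plaquettes) and the class-keyed `hunitA` become theorems).  The text is the original's VERBATIM under the token surgery `bg9Y 𝔸 G ↦ bg9YC 𝔸 G P`, `NAME ↦ NAME P` for the class-dependent names (P the first explicit argument), and — №277 — the binder `hunitA` re-keyed from «all G-valued U» to «all (3.35)-regular U of the carrier» (`∀ j α₀ U, (bg9YC 𝔸 G P (f j)).Reg335 c35 α₀ U → IsUnit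 (deltaAY …)`).  Class-free declarations of the original are NOT copied: they are imported and used BY NAME (`open … hiding` the re-declared ones).  Generated by dag-n06-c g16's `gen.py` (HOME `pub-ymgap-dag-n06-c/lean/g16/`); the ORIGINAL MODULE DOCUMENTATION FOLLOWS VERBATIM and describes the mathematics.

HONEST SCOPE.  Re-typing bookkeeping; nothing of [B9] asserted beyond the original; COUNT-NEUTRAL; N06 NOT discharged; nothing continuum ∕ OS ∕ mass gap ∕ Clay.  Cell `pub-ymgap` (D-0062), Track A node N06 [B9], seat `pub-ymgap-dag-n06-c` g16, 2026-08-29.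
-/

/-! Module documentation: that of the original `Balaban1983to89.B9SectBCodedChainC37Y` applies verbatim to this twin (not repeated here). -/

namespace Literature.MathematicalPhysics.QuantumFieldTheory.Balaban1983to89.B9SectBCodedChainC37YR

open Literature.MathematicalPhysics.QuantumFieldTheory.Balaban1983to89.B9SectBCodedClassR (RegExtraY bg9YC)
open Literature.MathematicalPhysics.QuantumFieldTheory.Balaban1983to89.B9SectBCodedChainC37Y hiding hclass_C37Y_on sectBStepPrinted_on_of_KSC_C37Y sectBStepPrinted_cornerFree_of_KSC_C37Y

open Literature.MathematicalPhysics.QuantumFieldTheory.Balaban1983to89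
open Literature.MathematicalPhysics.QuantumFieldTheory.Balaban1983to89.B6KLevelCensusIndexV1 (KIdx kGeo)
open Literature.MathematicalPhysics.QuantumFieldTheory.Balaban1983to89.B6Ineq2142KLevelV1 (β)
open Literature.MathematicalPhysics.QuantumFieldTheory.Balaban1983to89.B9SectBCodedCarrier (CCfg Coding pullK pullS pullAn)
open Literature.MathematicalPhysics.QuantumFieldTheory.Balaban1983to89.B9Eq360DeltaPrimeAY (AfldY mulY)
open Literature.MathematicalPhysics.QuantumFieldTheory.Balaban1983to89.B9PinMembersKLevelV1 (MemberY geo9Y bg9Y)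
open Literature.MathematicalPhysics.QuantumFieldTheory.Balaban1983to89.B9SectBGpLettersY (GVal)
open Literature.MathematicalPhysics.QuantumFieldTheory.Balaban1983to89.B9SectBGpFrameCodedYR (codingYx)
open Literature.MathematicalPhysics.QuantumFieldTheory.Balaban1983to89.B9SectBGpFrameCodedY (CplxLettersY)
open Literature.MathematicalPhysics.QuantumFieldTheory.Balaban1983to89.B9SectBGpReadingsYR (KSC)
open Literature.MathematicalPhysics.QuantumFieldTheory.Balaban1983to89.B9SectBCodedClassYR (hclass_C37Y_at)
open Literature.MathematicalPhysics.QuantumFieldTheory.Balaban1983to89.B9SectBCodedClassY (C37Y cplxLettersY_of_C37Y)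
open Literature.MathematicalPhysics.QuantumFieldTheory.Balaban1983to89.B9SectBCodedChainOnSubfamilyR (sectBStepPrinted_on_of_KSC)
open Literature.MathematicalPhysics.QuantumFieldTheory.Balaban1983to89.Node00 (SiteY BlkY IBondY CfgY SiteParY parSymY kernelFamilyS GpY)

variable {d ℓ : ℕ} {hd : 1 ≤ d + 1} {hL : Odd (ℓ + 1) ∧ 1 < ℓ + 1} {b₀ b₁ : ℝ} {Mstar : ℕ}
variable {𝔸 : Type} [NormedRing 𝔸] (P : RegExtraY d ℓ hd hL b₀ b₁ Mstar 𝔸) [NormedAlgebra ℂ 𝔸] [CompleteSpace 𝔸] [NormOneClass 𝔸] [FiniteDimensional ℝ 𝔸]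
variable {J : Type} (f : J → MemberY d ℓ hd hL b₀ b₁ Mstar) [∀ x : MemberY d ℓ hd hL b₀ b₁ Mstar, Fintype (geo9Y x).Site]
  (G : Subgroup 𝔸ˣ) {ι : Type} [Fintype ι] (b : Module.Basis ι ℝ 𝔸)
  (ιB : ∀ j : J, BlkY (f j).toKIdx → IBondY (f j).toKIdx)
  (C38 : ∀ j : J, ℝ → CfgY 𝔸 (f j).toKIdx → AfldY 𝔸 (f j).toKIdx → Prop)

/-! ## §1 `hclass` for `C37Y` on a subfamily -/

omit [FiniteDimensional ℝ 𝔸] [Fintype ι] [∀ x : MemberY d ℓ hd hL b₀ b₁ Mstar, Fintype (geo9Y x).Site] in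
/-- ★ **`hclass` OF `sectBStepPrinted_of_coded` ON A SUBFAMILY, for the codings `codingYx G (f j) (C37Y …) (C38 j)`**: `r := L⁴`, `αcap := 1∕4`,
`Mc := 2(d+1)+1`, any `ac` — `B9SectBCodedClassY.hclass_C37Y_at` at the members `f j`. [cite: Balaban1985BackgroundPropagators, (3.37) p.396, (3.58) p.402, Thm 3.4 p.400] -/
theorem hclass_C37Y_on (hι : ∀ (j : J) (s : BlkY (f j).toKIdx), β (f j).toKIdx.hN (f j).toKIdx.D (f j).toKIdx.hk (ιB j s) = s)
    (hG1 : ∀ u : 𝔸ˣ, u ∈ G → ‖(u : 𝔸)‖ ≤ 1) (c35 ac : ℝ) :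
    ∀ (j : J) (α₀ α₁ : ℝ) (U U' : (bg9YC 𝔸 G P (f j)).Cfg), 2 * ((d : ℝ) + 1) + 1 ≤ (geo9Y (f j)).M → 0 < α₀ → (geo9Y (f j)).M * α₀ ≤ ac →
      (bg9YC 𝔸 G P (f j)).Reg335 c35 α₀ U → 0 < α₁ → α₁ ≤ 1 / 4 → (bg9YC 𝔸 G P (f j)).Cplx337 α₁ U U' →
      ∃ a : (codingYx P G (f j) (C37Y G (f j) (ιB j) (4 * ((d : ℝ) + 1) * Real.exp (3 * (((d : ℝ) + 1) / 2)))) (C38 j)).A,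
        (codingYx P G (f j) (C37Y G (f j) (ιB j) (4 * ((d : ℝ) + 1) * Real.exp (3 * (((d : ℝ) + 1) / 2)))) (C38 j)).decA a = U' ∧
        (codingYx P G (f j) (C37Y G (f j) (ιB j) (4 * ((d : ℝ) + 1) * Real.exp (3 * (((d : ℝ) + 1) / 2)))) (C38 j)).C37 ((((ℓ : ℝ) + 1) ^ 4) * α₁) U a := by
  intro j α₀ α₁ U U' hM _ _ hreg hα₁ hα₁4 h37
  exact hclass_C37Y_at P G (f j) (ιB j) (hι j) hG1 (by linarith) hreg hα₁ hα₁4 h37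

/-! ## §2 ★★★ The chain on a subfamily, class hypotheses discharged -/

/-- ★★★ **THE CODED-CARRIER CHAIN ON A SUBFAMILY WITH SECTIONS, CLASS HYPOTHESES DISCHARGED** (coded class `C37Y`, transporter `parSymY`, `Cq = 4(d+1)e^{3(d+1)/2}`,
`r = L⁴`, `αcap = 1∕4`, `Mc = 2(d+1)+1`): IF the Sect.-B step holds for the augmented coded readings `(KSC, pullK GA, pullS Cinv, IsAnK)` over the coded carriers
on `J`, and the analyticity predicates transport (`hAn`), THEN the Sect.-B step holds for the record's families — `G′` read by `kernelFamilyS (GpY parSymY) parSymY`,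
`GA`, `Cinv`, `IsAn` over `bg9Y` — on `J`. [cite: Balaban1985BackgroundPropagators, Thm 3.4 p.400, Sect. B pp.400–407, p.403 l.1–9, (3.35)–(3.37) p.396, (3.58) p.402, p.399 (the family); Balaban1984PropagatorsII, Lemma 2.1 p.234] -/
theorem sectBStepPrinted_on_of_KSC_C37Y (hι : ∀ (j : J) (s : BlkY (f j).toKIdx), β (f j).toKIdx.hN (f j).toKIdx.D (f j).toKIdx.hk (ιB j s) = s)
    (hG1 : ∀ u : 𝔸ˣ, u ∈ G → ‖(u : 𝔸)‖ ≤ 1) {M₂ : ℝ} (hM₂ : 0 ≤ M₂) (hrepr : ∀ (v : 𝔸) (j : ι), |b.repr v j| ≤ M₂ * ‖v‖) (c35 : ℝ) (dC : ℕ)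
    (GA : ∀ j : J, B9.KernelFamily (geo9Y (f j)) (bg9YC 𝔸 G P (f j))) (Cinv : ∀ j : J, B9.SiteKernel (geo9Y (f j)) (bg9YC 𝔸 G P (f j)))
    (hGA : ∀ (j : J) (U : (bg9YC 𝔸 G P (f j)).Cfg),
      (∀ lam β' ζ, 0 ≤ (GA j).h1 U lam β' ζ) ∧ (∀ lam y, 0 ≤ (GA j).e4 U lam y) ∧ (∀ lam β' ζ, 0 ≤ (GA j).h2 U lam β' ζ))
    (IsAnK : ∀ j : J,
      B9.KernelFamily (geo9Y (f j)) (codingYx P G (f j) (C37Y G (f j) (ιB j) (4 * ((d : ℝ) + 1) * Real.exp (3 * (((d : ℝ) + 1) / 2)))) (C38 j)).bg →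
        (codingYx P G (f j) (C37Y G (f j) (ιB j) (4 * ((d : ℝ) + 1) * Real.exp (3 * (((d : ℝ) + 1) / 2)))) (C38 j)).bg.Cfg → ℝ → Prop)
    (IsAn : ∀ j : J, B9.KernelFamily (geo9Y (f j)) (bg9YC 𝔸 G P (f j)) → (bg9YC 𝔸 G P (f j)).Cfg → ℝ → Prop) {ac : ℝ} (hac : 0 < ac)
    (hAn : ∀ (j : J) (c : (codingYx P G (f j) (C37Y G (f j) (ιB j) (4 * ((d : ℝ) + 1) * Real.exp (3 * (((d : ℝ) + 1) / 2)))) (C38 j)).bg.Cfg) (α : ℝ),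
      (IsAnK j (KSC P G (f j) (parSymY (f j).toKIdx) (C37Y G (f j) (ιB j) (4 * ((d : ℝ) + 1) * Real.exp (3 * (((d : ℝ) + 1) / 2)))) (C38 j)) c α →
        pullAn (codingYx P G (f j) (C37Y G (f j) (ιB j) (4 * ((d : ℝ) + 1) * Real.exp (3 * (((d : ℝ) + 1) / 2)))) (C38 j)) (((ℓ : ℝ) + 1) ^ 4) (IsAn j)
          (pullK (codingYx P G (f j) (C37Y G (f j) (ιB j) (4 * ((d : ℝ) + 1) * Real.exp (3 * (((d : ℝ) + 1) / 2)))) (C38 j))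
            (kernelFamilyS (f j).toKIdx (bg9YC 𝔸 G P (f j)) (fun U => U) (GpY (f j).toKIdx (parSymY (f j).toKIdx)) (parSymY (f j).toKIdx))) c α) ∧
      (IsAnK j (pullK (codingYx P G (f j) (C37Y G (f j) (ιB j) (4 * ((d : ℝ) + 1) * Real.exp (3 * (((d : ℝ) + 1) / 2)))) (C38 j)) (GA j)) c α →
        pullAn (codingYx P G (f j) (C37Y G (f j) (ιB j) (4 * ((d : ℝ) + 1) * Real.exp (3 * (((d : ℝ) + 1) / 2)))) (C38 j)) (((ℓ : ℝ) + 1) ^ 4) (IsAn j)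
          (pullK (codingYx P G (f j) (C37Y G (f j) (ιB j) (4 * ((d : ℝ) + 1) * Real.exp (3 * (((d : ℝ) + 1) / 2)))) (C38 j)) (GA j)) c α))
    (h : B9.SectBStepPrinted dC c35 (fun j => geo9Y (f j))
      (fun j => (codingYx P G (f j) (C37Y G (f j) (ιB j) (4 * ((d : ℝ) + 1) * Real.exp (3 * (((d : ℝ) + 1) / 2)))) (C38 j)).bg)
      (fun j => KSC P G (f j) (parSymY (f j).toKIdx) (C37Y G (f j) (ιB j) (4 * ((d : ℝ) + 1) * Real.exp (3 * (((d : ℝ) + 1) / 2)))) (C38 j))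
      (fun j => pullK (codingYx P G (f j) (C37Y G (f j) (ιB j) (4 * ((d : ℝ) + 1) * Real.exp (3 * (((d : ℝ) + 1) / 2)))) (C38 j)) (GA j))
      (fun j => pullS (codingYx P G (f j) (C37Y G (f j) (ιB j) (4 * ((d : ℝ) + 1) * Real.exp (3 * (((d : ℝ) + 1) / 2)))) (C38 j)) (Cinv j)) IsAnK) :
    B9.SectBStepPrinted dC c35 (fun j => geo9Y (f j)) (fun j => bg9YC 𝔸 G P (f j))
      (fun j => kernelFamilyS (f j).toKIdx (bg9YC 𝔸 G P (f j)) (fun U => U) (GpY (f j).toKIdx (parSymY (f j).toKIdx)) (parSymY (f j).toKIdx)) GA Cinv IsAn := by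
  have hL4 : (0 : ℝ) < ((ℓ : ℝ) + 1) ^ 4 := by positivity
  exact sectBStepPrinted_on_of_KSC P f G (fun j => parSymY (f j).toKIdx) b ιB
    (fun j => C37Y G (f j) (ιB j) (4 * ((d : ℝ) + 1) * Real.exp (3 * (((d : ℝ) + 1) / 2)))) C38 hG1 hM₂ hrepr hι
    (fun j => cplxLettersY_of_C37Y G (f j) (ιB j) _) c35 dC GA Cinv hGA IsAnK IsAn hL4 (by norm_num : (0 : ℝ) < 1 / 4) hac hAn
    (hclass_C37Y_on P f G ιB C38 hι hG1 c35 ac) h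

/-! ## §3 ★★★ The chain on a corner-free subfamily: no section binder, no class hypothesis -/

/-- ★★★ **THE CODED-CARRIER CHAIN ON A CORNER-FREE SUBFAMILY** (`hf : β` onto at every `f j`; sections `Function.surjInv (hf j)`; coded class `C37Y`): the Sect.-B
step for the augmented coded readings over the members `f j` gives the Sect.-B step for the record's families over them — the displayed hypotheses are the
frames' output `h`, the analyticity transport `hAn`, and structural record data only. [cite: Balaban1985BackgroundPropagators, Thm 3.4 p.400, Sect. B pp.400–407, p.403 l.1–9, (3.35)–(3.37) p.396, (3.58) p.402, p.399; Balaban1984PropagatorsII, (2.45) p.231, Lemma 2.1 p.234] -/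
theorem sectBStepPrinted_cornerFree_of_KSC_C37Y (hf : ∀ j : J, Function.Surjective (β (f j).toKIdx.hN (f j).toKIdx.D (f j).toKIdx.hk))
    (hG1 : ∀ u : 𝔸ˣ, u ∈ G → ‖(u : 𝔸)‖ ≤ 1) {M₂ : ℝ} (hM₂ : 0 ≤ M₂) (hrepr : ∀ (v : 𝔸) (j : ι), |b.repr v j| ≤ M₂ * ‖v‖) (c35 : ℝ) (dC : ℕ)
    (GA : ∀ j : J, B9.KernelFamily (geo9Y (f j)) (bg9YC 𝔸 G P (f j))) (Cinv : ∀ j : J, B9.SiteKernel (geo9Y (f j)) (bg9YC 𝔸 G P (f j)))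
    (hGA : ∀ (j : J) (U : (bg9YC 𝔸 G P (f j)).Cfg),
      (∀ lam β' ζ, 0 ≤ (GA j).h1 U lam β' ζ) ∧ (∀ lam y, 0 ≤ (GA j).e4 U lam y) ∧ (∀ lam β' ζ, 0 ≤ (GA j).h2 U lam β' ζ))
    (IsAnK : ∀ j : J,
      B9.KernelFamily (geo9Y (f j))
          (codingYx P G (f j) (C37Y G (f j) (fun s => Function.surjInv (hf j) s) (4 * ((d : ℝ) + 1) * Real.exp (3 * (((d : ℝ) + 1) / 2)))) (C38 j)).bg →
        (codingYx P G (f j) (C37Y G (f j) (fun s => Function.surjInv (hf j) s) (4 * ((d : ℝ) + 1) * Real.exp (3 * (((d : ℝ) + 1) / 2)))) (C38 j)).bg.Cfg →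
          ℝ → Prop)
    (IsAn : ∀ j : J, B9.KernelFamily (geo9Y (f j)) (bg9YC 𝔸 G P (f j)) → (bg9YC 𝔸 G P (f j)).Cfg → ℝ → Prop) {ac : ℝ} (hac : 0 < ac)
    (hAn : ∀ (j : J)
      (c : (codingYx P G (f j) (C37Y G (f j) (fun s => Function.surjInv (hf j) s) (4 * ((d : ℝ) + 1) * Real.exp (3 * (((d : ℝ) + 1) / 2)))) (C38 j)).bg.Cfg)
      (α : ℝ),
      (IsAnK j (KSC P G (f j) (parSymY (f j).toKIdx)
          (C37Y G (f j) (fun s => Function.surjInv (hf j) s) (4 * ((d : ℝ) + 1) * Real.exp (3 * (((d : ℝ) + 1) / 2)))) (C38 j)) c α →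
        pullAn (codingYx P G (f j) (C37Y G (f j) (fun s => Function.surjInv (hf j) s) (4 * ((d : ℝ) + 1) * Real.exp (3 * (((d : ℝ) + 1) / 2)))) (C38 j))
          (((ℓ : ℝ) + 1) ^ 4) (IsAn j)
          (pullK (codingYx P G (f j) (C37Y G (f j) (fun s => Function.surjInv (hf j) s) (4 * ((d : ℝ) + 1) * Real.exp (3 * (((d : ℝ) + 1) / 2)))) (C38 j))
            (kernelFamilyS (f j).toKIdx (bg9YC 𝔸 G P (f j)) (fun U => U) (GpY (f j).toKIdx (parSymY (f j).toKIdx)) (parSymY (f j).toKIdx))) c α) ∧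
      (IsAnK j (pullK (codingYx P G (f j) (C37Y G (f j) (fun s => Function.surjInv (hf j) s) (4 * ((d : ℝ) + 1) * Real.exp (3 * (((d : ℝ) + 1) / 2))))
          (C38 j)) (GA j)) c α →
        pullAn (codingYx P G (f j) (C37Y G (f j) (fun s => Function.surjInv (hf j) s) (4 * ((d : ℝ) + 1) * Real.exp (3 * (((d : ℝ) + 1) / 2)))) (C38 j))
          (((ℓ : ℝ) + 1) ^ 4) (IsAn j)
          (pullK (codingYx P G (f j) (C37Y G (f j) (fun s => Function.surjInv (hf j) s) (4 * ((d : ℝ) + 1) * Real.exp (3 * (((d : ℝ) + 1) / 2)))) (C38 j))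
            (GA j)) c α))
    (h : B9.SectBStepPrinted dC c35 (fun j => geo9Y (f j))
      (fun j => (codingYx P G (f j) (C37Y G (f j) (fun s => Function.surjInv (hf j) s) (4 * ((d : ℝ) + 1) * Real.exp (3 * (((d : ℝ) + 1) / 2)))) (C38 j)).bg)
      (fun j => KSC P G (f j) (parSymY (f j).toKIdx)
        (C37Y G (f j) (fun s => Function.surjInv (hf j) s) (4 * ((d : ℝ) + 1) * Real.exp (3 * (((d : ℝ) + 1) / 2)))) (C38 j))
      (fun j => pullK (codingYx P G (f j) (C37Y G (f j) (fun s => Function.surjInv (hf j) s) (4 * ((d : ℝ) + 1) * Real.exp (3 * (((d : ℝ) + 1) / 2))))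
        (C38 j)) (GA j))
      (fun j => pullS (codingYx P G (f j) (C37Y G (f j) (fun s => Function.surjInv (hf j) s) (4 * ((d : ℝ) + 1) * Real.exp (3 * (((d : ℝ) + 1) / 2))))
        (C38 j)) (Cinv j)) IsAnK) :
    B9.SectBStepPrinted dC c35 (fun j => geo9Y (f j)) (fun j => bg9YC 𝔸 G P (f j))
      (fun j => kernelFamilyS (f j).toKIdx (bg9YC 𝔸 G P (f j)) (fun U => U) (GpY (f j).toKIdx (parSymY (f j).toKIdx)) (parSymY (f j).toKIdx)) GA Cinv IsAn :=
  sectBStepPrinted_on_of_KSC_C37Y P f G b (fun j s => Function.surjInv (hf j) s) C38 (fun j s => Function.surjInv_eq (hf j) s) hG1 hM₂ hrepr c35 dC GA Cinv hGA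
    IsAnK IsAn hac hAn h

end Literature.MathematicalPhysics.QuantumFieldTheory.Balaban1983to89.B9SectBCodedChainC37YR

/-!
# `Balaban1983to89.B9SectBCodedChainGlobR` — THE CLASS-PARAMETRIC TWIN of `B9SectBCodedChainGlob` (CASCADE-R, director-ym №279 GO-R; №277 (3) `hunitA` cure; dag-n06-d SOCKET-(α) class question)

statement-level skeleton of published theorems with citation tags; proofs where landed; nothing here is a claim about the
Yang–Mills mass gap

WHAT THIS FILE IS.  The original module `B9SectBCodedChainGlob` types its objects over MODULE 3's member carrier `bg9Y 𝔸 G x` (MODULE 2's small-cube class (3.35)).  This file RE-DECLARES, with UNCHANGED NAMES inside the namespace `…B9SectBCodedChainGlobR`, exactly its 15 class-dependent declarations over the CLASS-PARAMETRIC carrier `B9SectBCodedClassR.bg9YC 𝔸 G P x` (`P : RegExtraY …` = the two cube conditions of (3.35)∕(3.36) as a parameter; `bg9Y 𝔸 G x = bg9YC 𝔸 G (extraY 𝔸 G) x` by `rfl`, so every declaration here specialises definitionally to its original; at the record's reading of PRINT's class, `P := extraYPb 𝔸 G`, the displayed laws `hreg335P` ((3.35) on plaquettes) and the class-keyed `hunitA`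 become theorems).  The text is the original's VERBATIM under the token surgery `bg9Y 𝔸 G ↦ bg9YC 𝔸 G P`, `NAME ↦ NAME P` for the class-dependent names (P the first explicit argument), and — №277 — the binder `hunitA` re-keyed from «all G-valued U» to «all (3.35)-regular U of the carrier» (`∀ j α₀ U, (bg9YC 𝔸 G P (f j)).Reg335 c35 α₀ U → IsUnit (deltaAY …)`).  Class-free declarations of the original are NOT copied: they are imported and used BY NAME (`open … hiding` the re-declared ones).  Generated by dag-n06-c g16's `gen.py` (HOME `pub-ymgap-dag-n06-c/lean/g16/`); the ORIGINAL MODULE DOCUMENTATION FOLLOWS VERBATIM and describes the mathematics.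

HONEST SCOPE.  Re-typing bookkeeping; nothing of [B9] asserted beyond the original; COUNT-NEUTRAL; N06 NOT discharged; nothing continuum ∕ OS ∕ mass gap ∕ Clay.  Cell `pub-ymgap` (D-0062), Track A node N06 [B9], seat `pub-ymgap-dag-n06-c` g16, 2026-08-29.
-/

/-! Module documentation: that of the original `Balaban1983to89.B9SectBCodedChainGlob` applies verbatim to this twin (not repeated here). -/

namespace Literature.MathematicalPhysics.QuantumFieldTheory.Balaban1983to89.B9SectBCodedChainGlobR

open Literature.MathematicalPhysics.QuantumFieldTheory.Balaban1983to89.B9SectBCodedClassR (RegExtraY bg9YC)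
open Literature.MathematicalPhysics.QuantumFieldTheory.Balaban1983to89.B9SectBCodedChainGlob hiding KSC₂ KSC₂_members KSC₂_glob_base KSC₂_glob_prod thms_KSC₂_base_iff thms_KSC_prod_of_KSC₂ read342Y_KSC₂ write342Y_KSC₂ globBlock_KSC₂_prod globFrame₂CodedOn hin_KSC₂_on hout_KSC₂_on sectBStepPrinted_on_of_KSC₂ sectBStepPrinted_on_of_KSC₂_C37Y sectBStepPrinted_cornerFree_of_KSC₂_C37Y

open Literature.MathematicalPhysics.QuantumFieldTheory.Balaban1983to89
open Literature.MathematicalPhysics.QuantumFieldTheory.Balaban1983to89.B6KLevelCensusIndexV1 (KIdx kGeo)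
open Literature.MathematicalPhysics.QuantumFieldTheory.Balaban1983to89.B6Ineq2142KLevelV1 (β)
open Literature.MathematicalPhysics.QuantumFieldTheory.Balaban1983to89.B6RandomWalk (HasMajorant)
open Literature.MathematicalPhysics.QuantumFieldTheory.Balaban1983to89.B9Thm34Ext (toB6)
open Literature.MathematicalPhysics.QuantumFieldTheory.Balaban1983to89.B9FromB6 (EBlock GlobBlock)
open Literature.MathematicalPhysics.QuantumFieldTheory.Balaban1983to89.B9Eq39Adjoint (fluct)
open Literature.MathematicalPhysics.QuantumFieldTheory.Balaban1983to89.B9Eq352DivFormLetters (conj)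
open Literature.MathematicalPhysics.QuantumFieldTheory.Balaban1983to89.B9Eq352GradLetters (diffLetter)
open Literature.MathematicalPhysics.QuantumFieldTheory.Balaban1983to89.B9SectBCodedCarrier (CCfg Coding pullK pullS pullAn sectBStepPrinted_of_coded)
open Literature.MathematicalPhysics.QuantumFieldTheory.Balaban1983to89.B9SectBStepFamilyTransfer (sectBStepPrinted_of_family)
open Literature.MathematicalPhysics.QuantumFieldTheory.Balaban1983to89.B9SectBGpStepAtLettersV2 (GpFrame₂ GlobFrame₂)
open Literature.MathematicalPhysics.QuantumFieldTheory.Balaban1983to89.B9Eq360DeltaPrimeAY (AfldY mulY)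
open Literature.MathematicalPhysics.QuantumFieldTheory.Balaban1983to89.B9PinMembersKLevelV1 (MemberY geo9Y bg9Y)
open Literature.MathematicalPhysics.QuantumFieldTheory.Balaban1983to89.B9SectBGpLettersY
open Literature.MathematicalPhysics.QuantumFieldTheory.Balaban1983to89.B9SectBGpFrameCodedYR (codingYx Read342Y Write342Y)
open Literature.MathematicalPhysics.QuantumFieldTheory.Balaban1983to89.B9SectBGpFrameCodedY (CplxLettersY)
open Literature.MathematicalPhysics.QuantumFieldTheory.Balaban1983to89.B9SectBGpReadingsYR (KSC read342Y_KSC write342Y_KSC)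
open Literature.MathematicalPhysics.QuantumFieldTheory.Balaban1983to89.B9SectBGpTransferOutYR (thms_pullK_prod_of_KSC ineq342_346_347_weaken)
open Literature.MathematicalPhysics.QuantumFieldTheory.Balaban1983to89.B9SectBCodedClassY (C37Y cplxLettersY_of_C37Y)
open Literature.MathematicalPhysics.QuantumFieldTheory.Balaban1983to89.B9SectBCodedChainOnSubfamilyR (gpFrame₂CodedOn hin_KSC_on hconv_KSC_on)
open Literature.MathematicalPhysics.QuantumFieldTheory.Balaban1983to89.B9SectBCodedChainC37YR (hclass_C37Y_on)
open Literature.MathematicalPhysics.QuantumFieldTheory.Balaban1983to89.B9Ineq347SiteReadingY (globBlock_kernelFamilyS_of_eBlock)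
open Literature.MathematicalPhysics.QuantumFieldTheory.Balaban1983to89.B9GeoNormsKLevelV1 (geo9K_wNorm_nonneg)
open Literature.MathematicalPhysics.QuantumFieldTheory.Balaban1983to89.Node00 (SiteY BlkY IBondY CfgY SiteParY parSymY deltaPrimeAY kernelFamilyS GpY)

variable {d ℓ : ℕ} {hd : 1 ≤ d + 1} {hL : Odd (ℓ + 1) ∧ 1 < ℓ + 1} {b₀ b₁ : ℝ} {Mstar : ℕ}
variable {𝔸 : Type} [NormedRing 𝔸] (P : RegExtraY d ℓ hd hL b₀ b₁ Mstar 𝔸) [NormedAlgebra ℂ 𝔸] [CompleteSpace 𝔸] [FiniteDimensional ℝ 𝔸]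

/-! ## §1 The augmented readings with the global member silent at products -/

section KSC2

variable (G : Subgroup 𝔸ˣ) (x : MemberY d ℓ hd hL b₀ b₁ Mstar) (par : SiteParY 𝔸 x.toKIdx)
  (C37 C38 : ℝ → CfgY 𝔸 x.toKIdx → AfldY 𝔸 x.toKIdx → Prop)

/-- **THE AUGMENTED CODED READINGS WITH THE GLOBAL MEMBER SILENT AT PRODUCTS**: `KSC` (the record's readings at the decoded configuration, the (3.42) member at
products in U-letters) with the (3.47) member replaced by `0` at coded multipliers and products (kept at bases).  The record's (3.47) at `W = U′U` is NOT read
here; it is recovered in `hout` from (3.42) at `W`. [cite: Balaban1985BackgroundPropagators, (3.47) p.398 («consequences of the local ones (3.42) and Lemma 2.1»), Thm 3.4 p.400] -/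
noncomputable def KSC₂ : B9.KernelFamily (geo9Y x) (codingYx P G x C37 C38).bg :=
  { KSC P G x par C37 C38 with
    glob := fun n c lam γ => match c with
      | .base U => (KSC P G x par C37 C38).glob n (.base U) lam γ
      | .mult _ => 0
      | .prod _ _ => 0 }

omit [FiniteDimensional ℝ 𝔸] in
/-- the (3.42)–(3.46) members of `KSC₂` are `KSC`'s. [cite: Balaban1985BackgroundPropagators, (3.42)–(3.46) pp.397–398, bookkeeping] -/
theorem KSC₂_members :
    (KSC₂ P G x par C37 C38).e = (KSC P G x par C37 C38).e ∧ (KSC₂ P G x par C37 C38).h1 = (KSC P G x par C37 C38).h1 ∧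
    (KSC₂ P G x par C37 C38).e4 = (KSC P G x par C37 C38).e4 ∧ (KSC₂ P G x par C37 C38).h2 = (KSC P G x par C37 C38).h2 ∧
    (KSC₂ P G x par C37 C38).l2 = (KSC P G x par C37 C38).l2 := ⟨rfl, rfl, rfl, rfl, rfl⟩

omit [FiniteDimensional ℝ 𝔸] in
/-- the global member of `KSC₂` at a base is `KSC`'s (the record's at `U`). [cite: Balaban1985BackgroundPropagators, (3.47) p.398, bookkeeping] -/
theorem KSC₂_glob_base (n : Fin 4) (U : CfgY 𝔸 x.toKIdx) (lam : (geo9Y x).Loc) (γ : ℝ) :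
    (KSC₂ P G x par C37 C38).glob n (.base U) lam γ = (KSC P G x par C37 C38).glob n (.base U) lam γ := rfl

omit [FiniteDimensional ℝ 𝔸] in
/-- the global member of `KSC₂` at a product is silent. [cite: Balaban1985BackgroundPropagators, (3.47) p.398, bookkeeping] -/
theorem KSC₂_glob_prod (n : Fin 4) (U : CfgY 𝔸 x.toKIdx) (a : AfldY 𝔸 x.toKIdx) (lam : (geo9Y x).Loc) (γ : ℝ) :
    (KSC₂ P G x par C37 C38).glob n (.prod U a) lam γ = 0 := rfl

omit [FiniteDimensional ℝ 𝔸] in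
/-- **AT A BASE THE TWO READINGS HAVE THE SAME Theorem-3.1–3.3 BLOCK.** [cite: Balaban1985BackgroundPropagators, Thms 3.1–3.3 pp.397–399, bookkeeping] -/
theorem thms_KSC₂_base_iff (dC : ℕ) (GA : B9.KernelFamily (geo9Y x) (codingYx P G x C37 C38).bg) (Cinv : B9.SiteKernel (geo9Y x) (codingYx P G x C37 C38).bg)
    (B₀ δ₀ : ℝ) (Bβ Bε : ℝ → ℝ) (Bεβ : ℝ → ℝ → ℝ) (B₁ δ₁ : ℝ) (U : CfgY 𝔸 x.toKIdx) :
    B9.Thms31to33IneqAt dC (KSC₂ P G x par C37 C38) GA Cinv B₀ δ₀ Bβ Bε Bεβ B₁ δ₁ (.base U) ↔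
      B9.Thms31to33IneqAt dC (KSC P G x par C37 C38) GA Cinv B₀ δ₀ Bβ Bε Bεβ B₁ δ₁ (.base U) := Iff.rfl

omit [FiniteDimensional ℝ 𝔸] in
/-- **AT A PRODUCT, `KSC`'s BLOCK FROM `KSC₂`'s BLOCK AND THE RECORD's (3.47) BLOCK AT `W = e^{ηa}·U`** (constant `max B₀ B_g`).
[cite: Balaban1985BackgroundPropagators, (3.47) p.398, Thms 3.1–3.3 pp.397–399, bookkeeping] -/
theorem thms_KSC_prod_of_KSC₂ (dC : ℕ) (GA : B9.KernelFamily (geo9Y x) (codingYx P G x C37 C38).bg) (Cinv : B9.SiteKernel (geo9Y x) (codingYx P G x C37 C38).bg)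
    {B₀ δ₀ : ℝ} {Bβ Bε : ℝ → ℝ} {Bεβ : ℝ → ℝ → ℝ} {B₁ δ₁ : ℝ} {U : CfgY 𝔸 x.toKIdx} {a : AfldY 𝔸 x.toKIdx} (hB₀ : 0 ≤ B₀)
    (h : B9.Thms31to33IneqAt dC (KSC₂ P G x par C37 C38) GA Cinv B₀ δ₀ Bβ Bε Bεβ B₁ δ₁ (.prod U a)) {Bg : ℝ}
    (hglob : GlobBlock (kernelFamilyS x.toKIdx (bg9YC 𝔸 G P x) (fun U => U) (GpY x.toKIdx par) par) Bg (mulY x.toKIdx (fluct (kGeo x.toKIdx).eta a) U)) :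
    B9.Thms31to33IneqAt dC (KSC P G x par C37 C38) GA Cinv (max B₀ Bg) δ₀ Bβ Bε Bεβ B₁ δ₁ (.prod U a) := by
  obtain ⟨⟨h42, h43⟩, hC, ⟨g42, g43⟩⟩ := h
  have hw := ineq342_346_347_weaken P G x C37 C38 (KSC₂ P G x par C37 C38) hB₀ (le_max_left B₀ Bg) le_rfl h42
  refine ⟨⟨⟨hw.1, hw.2.1, fun n lam γ h1 h2 => ?_⟩, h43⟩, hC, ineq342_346_347_weaken P G x C37 C38 GA hB₀ (le_max_left _ _) le_rfl g42, g43⟩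
  exact (hglob n lam γ h1 h2).trans (mul_le_mul_of_nonneg_right (le_max_right _ _) (geo9K_wNorm_nonneg x.toKIdx γ lam))

end KSC2

/-! ## §2 The root dictionaries inherited, the silent global member, and ★ the (3.47) frame over the coded carriers of a subfamily -/

section Frames

variable [NormOneClass 𝔸] {J : Type} (f : J → MemberY d ℓ hd hL b₀ b₁ Mstar)
  (c35 : ℝ) (G : Subgroup 𝔸ˣ) {ι : Type} [Fintype ι] [DecidableEq ι] (b : Module.Basis ι ℝ 𝔸)
  [∀ x : MemberY d ℓ hd hL b₀ b₁ Mstar, Fintype (geo9Y x).Site] [instDS : ∀ x : MemberY d ℓ hd hL b₀ b₁ Mstar, DecidableEq (geo9Y x).Site]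
  [∀ x : MemberY d ℓ hd hL b₀ b₁ Mstar, Nonempty (geo9Y x).Site]
  (C37 C38 : ∀ j : J, ℝ → CfgY 𝔸 (f j).toKIdx → AfldY 𝔸 (f j).toKIdx → Prop)
  (par : ∀ j : J, SiteParY 𝔸 (f j).toKIdx)
  (ιB : ∀ j : J, BlkY (f j).toKIdx → IBondY (f j).toKIdx)

omit [NormOneClass 𝔸] [DecidableEq ι] instDS [∀ x : MemberY d ℓ hd hL b₀ b₁ Mstar, Nonempty (geo9Y x).Site] in
/-- the (3.42) reading dictionary of `KSC₂` is `KSC`'s (same (3.42) member). [cite: Balaban1985BackgroundPropagators, (3.42) p.397; Balaban1984PropagatorsII, (2.51) p.232] -/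
theorem read342Y_KSC₂ (j : J) (hι : ∀ s : BlkY (f j).toKIdx, β (f j).toKIdx.hN (f j).toKIdx.D (f j).toKIdx.hk (ιB j s) = s)
    (M₂ : ℝ) (hM₂ : 0 ≤ M₂) (hrepr : ∀ (v : 𝔸) (j : ι), |b.repr v j| ≤ M₂ * ‖v‖) (MInv aInv : ℝ) :
    Read342Y P G (f j) (par j) b (ιB j) (C37 j) (C38 j) (KSC₂ P G (f j) (par j) (C37 j) (C38 j)) c35 (M₂ * ∑ j, ‖b j‖) MInv aInv 0 True :=
  read342Y_KSC P G (f j) (par j) b (ιB j) (C37 j) (C38 j) hι M₂ hM₂ hrepr c35 MInv aInv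

omit [NormOneClass 𝔸] [FiniteDimensional ℝ 𝔸] [DecidableEq ι] instDS [∀ x : MemberY d ℓ hd hL b₀ b₁ Mstar, Nonempty (geo9Y x).Site] in
/-- the (3.42) writing dictionary of `KSC₂` is `KSC`'s. [cite: Balaban1985BackgroundPropagators, (3.42) p.397, p.403; Balaban1984PropagatorsII, (2.51) p.232] -/
theorem write342Y_KSC₂ (j : J) (hι : ∀ s : BlkY (f j).toKIdx, β (f j).toKIdx.hN (f j).toKIdx.D (f j).toKIdx.hk (ιB j s) = s)
    (M₂ : ℝ) (hM₂ : 0 ≤ M₂) (hrepr : ∀ (v : 𝔸) (j : ι), |b.repr v j| ≤ M₂ * ‖v‖) (aW : ℝ) (hC37 : ∀ β' U a, C37 j β' U a → GVal G (f j).toKIdx U) :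
    Write342Y P G (f j) (par j) b (ιB j) (C37 j) (C38 j) (KSC₂ P G (f j) (par j) (C37 j) (C38 j)) (fun B _ => (M₂ * ∑ j, ‖b j‖) * B + 1) (fun δ => δ) aW 0 True :=
  write342Y_KSC P G (f j) (par j) b (ιB j) (C37 j) (C38 j) hι M₂ hM₂ hrepr aW hC37

omit [NormOneClass 𝔸] [FiniteDimensional ℝ 𝔸] [Fintype ι] [DecidableEq ι] [∀ x : MemberY d ℓ hd hL b₀ b₁ Mstar, Fintype (geo9Y x).Site] instDS
  [∀ x : MemberY d ℓ hd hL b₀ b₁ Mstar, Nonempty (geo9Y x).Site] in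
/-- **THE SILENT GLOBAL MEMBER AT A PRODUCT SATISFIES EVERY (3.47) BLOCK WITH A NONNEGATIVE CONSTANT.** [cite: Balaban1985BackgroundPropagators, (3.47) p.398, bookkeeping] -/
theorem globBlock_KSC₂_prod (j : J) (U : CfgY 𝔸 (f j).toKIdx) (a : AfldY 𝔸 (f j).toKIdx) {B : ℝ} (hB : 0 ≤ B) :
    GlobBlock (KSC₂ P G (f j) (par j) (C37 j) (C38 j)) B (.prod U a) := fun n lam γ _ _ => by
  show (0 : ℝ) ≤ B * (geo9Y (f j)).wNorm γ lam
  exact mul_nonneg hB (geo9K_wNorm_nonneg (f j).toKIdx γ lam)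

/-- ★ **THE (3.47) FRAME `GlobFrame₂` OVER THE CODED CARRIERS OF A SUBFAMILY, INHABITED** for the readings `KSC₂`: the root frame
`B9SectBCodedChainOnSubfamily.gpFrame₂CodedOn` at `KC := KSC₂` (dictionaries `read342Y_KSC₂` ∕ `write342Y_KSC₂`, reading constant `c_R = M₂Σ‖b_j‖ > 0`,
writing functions `(c_R·B + 1, δ)`) extended by `wG := 1` and the trivially true writing of the silent global member.
[cite: Balaban1985BackgroundPropagators, Thm 3.4 p.400, (3.47) p.398, (3.42) p.397, p.403; Balaban1984PropagatorsII, Lemma 2.1 p.234, (2.51) p.232] -/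
noncomputable def globFrame₂CodedOn (hι : ∀ (j : J) (s : BlkY (f j).toKIdx), β (f j).toKIdx.hN (f j).toKIdx.D (f j).toKIdx.hk (ιB j s) = s)
    (hG1 : ∀ u : 𝔸ˣ, u ∈ G → ‖(u : 𝔸)‖ ≤ 1) (hpar : ∀ j (U : CfgY 𝔸 (f j).toKIdx), GVal G (f j).toKIdx U → ∀ z w, par j U z w ∈ G)
    (hunit : ∀ j (U : CfgY 𝔸 (f j).toKIdx), GVal G (f j).toKIdx U → IsUnit (deltaPrimeAY (f j).toKIdx (par j) U))
    (dB : ℕ) (M₂ : ℝ) (hM₂ : 0 ≤ M₂) (hrepr : ∀ (v : 𝔸) (j : ι), |b.repr v j| ≤ M₂ * ‖v‖) (hcR : 0 < M₂ * ∑ j, ‖b j‖)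
    (Cq : ℝ) (hCq : 0 ≤ Cq) (hC37 : ∀ j β' U a, C37 j β' U a → GVal G (f j).toKIdx U ∧ CplxLettersY G (f j) (par j) (ιB j) Cq β' U a)
    (MInv aInv aW : ℝ) (hMInv : 0 < MInv) (haInv : 0 < aInv) (haW : 0 < aW) :
    GlobFrame₂ c35 (fun j => geo9Y (f j)) (fun j => (codingYx P G (f j) (C37 j) (C38 j)).bg) (fun j => KSC₂ P G (f j) (par j) (C37 j) (C38 j)) b (Fin (d + 1))
      (fun j => SiteY (f j).toKIdx) :=
  { gpFrame₂CodedOn P f c35 G b C37 C38 par ιB (fun j => KSC₂ P G (f j) (par j) (C37 j) (C38 j)) hι hG1 hpar hunit dB M₂ hM₂ hrepr Cq hCq hC37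
      (M₂ * ∑ j, ‖b j‖) hcR (fun B _ => (M₂ * ∑ j, ‖b j‖) * B + 1) (fun B _ hB _ => by positivity) (fun δ => δ) (fun δ hδ => hδ)
      MInv aInv aW hMInv haInv haW (fun j => read342Y_KSC₂ P f c35 G b C37 C38 par ιB j (hι j) M₂ hM₂ hrepr MInv aInv)
      (fun j => write342Y_KSC₂ P f G b C37 C38 par ιB j (hι j) M₂ hM₂ hrepr aW fun β' U a h => (hC37 j β' U a h).1) with
    wG := fun _ _ => 1
    wG_pos := fun _ _ _ _ => one_pos
    writeGlob := fun j c c' α₁ B δ _ _ h37 _ _ _ _ _ _ => by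
      obtain ⟨U, a, rfl, rfl, -⟩ := (codingYx P G (f j) (C37 j) (C38 j)).exists_of_bg_Cplx337 h37
      exact globBlock_KSC₂_prod P f G C37 C38 par j U a zero_le_one }

end Frames

/-! ## §3 ★★ `hin`, `hout` and the composed chain for `KSC₂` -/

section Chain

variable [NormOneClass 𝔸] {J : Type} (f : J → MemberY d ℓ hd hL b₀ b₁ Mstar) [∀ x : MemberY d ℓ hd hL b₀ b₁ Mstar, Fintype (geo9Y x).Site]
  (G : Subgroup 𝔸ˣ) (par : ∀ j : J, SiteParY 𝔸 (f j).toKIdx) {ι : Type} [Fintype ι] (b : Module.Basis ι ℝ 𝔸)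
  (ιB : ∀ j : J, BlkY (f j).toKIdx → IBondY (f j).toKIdx)
  (C37 C38 : ∀ j : J, ℝ → CfgY 𝔸 (f j).toKIdx → AfldY 𝔸 (f j).toKIdx → Prop)

omit [NormOneClass 𝔸] [FiniteDimensional ℝ 𝔸] in
/-- ★ **`hin` FOR `KSC₂` ON A SUBFAMILY** (at a base the blocks of `KSC₂` and `KSC` coincide: `hin_KSC_on`). [cite: Balaban1985BackgroundPropagators, Thms 3.1–3.3 (3.42)–(3.48) pp.397–399, (3.35) p.396, p.403 l.1–9; Balaban1984PropagatorsII, Lemma 2.1 (2.61) p.234] -/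
theorem hin_KSC₂_on (hι : ∀ (j : J) (s : BlkY (f j).toKIdx), β (f j).toKIdx.hN (f j).toKIdx.D (f j).toKIdx.hk (ιB j s) = s)
    (hG1 : ∀ u : 𝔸ˣ, u ∈ G → ‖(u : 𝔸)‖ ≤ 1) {M₂ : ℝ} (hM₂ : 0 ≤ M₂) (hrepr : ∀ (v : 𝔸) (j : ι), |b.repr v j| ≤ M₂ * ‖v‖) (c35 : ℝ) (dC : ℕ)
    (GA : ∀ j : J, B9.KernelFamily (geo9Y (f j)) (codingYx P G (f j) (C37 j) (C38 j)).bg)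
    (Cinv : ∀ j : J, B9.SiteKernel (geo9Y (f j)) (codingYx P G (f j) (C37 j) (C38 j)).bg) :
    ∀ (B₀ δ₀ : ℝ) (Bβ Bε : ℝ → ℝ) (Bεβ : ℝ → ℝ → ℝ) (B₁ δ₁ : ℝ),
      ∃ (Mi ai B₀' δ₀' : ℝ) (Bβ' Bε' : ℝ → ℝ) (Bεβ' : ℝ → ℝ → ℝ) (B₁' δ₁' : ℝ), 0 < ai ∧
        ∀ j : J, Mi ≤ (geo9Y (f j)).M → ∀ α₀ : ℝ, 0 < α₀ → (geo9Y (f j)).M * α₀ ≤ ai →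
          ∀ c : (codingYx P G (f j) (C37 j) (C38 j)).bg.Cfg, (codingYx P G (f j) (C37 j) (C38 j)).bg.Reg335 c35 α₀ c →
          B9.Thms31to33IneqAt dC (pullK (codingYx P G (f j) (C37 j) (C38 j))
              (kernelFamilyS (f j).toKIdx (bg9YC 𝔸 G P (f j)) (fun U => U) (GpY (f j).toKIdx (par j)) (par j))) (GA j) (Cinv j) B₀ δ₀ Bβ Bε Bεβ B₁ δ₁ c →
          B9.Thms31to33IneqAt dC (KSC₂ P G (f j) (par j) (C37 j) (C38 j)) (GA j) (Cinv j) B₀' δ₀' Bβ' Bε' Bεβ' B₁' δ₁' c := by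
  intro B₀ δ₀ Bβ Bε Bεβ B₁ δ₁
  obtain ⟨Mi, ai, B₀', δ₀', Bβ', Bε', Bεβ', B₁', δ₁', hai, H⟩ := hin_KSC_on P f G par b ιB C37 C38 hι hG1 hM₂ hrepr c35 dC GA Cinv B₀ δ₀ Bβ Bε Bεβ B₁ δ₁
  refine ⟨Mi, ai, B₀', δ₀', Bβ', Bε', Bεβ', B₁', δ₁', hai, fun j hM α₀ hα₀ hMa c hreg hT => ?_⟩
  obtain ⟨U, rfl, -⟩ := (codingYx P G (f j) (C37 j) (C38 j)).exists_of_bg_Reg335 hreg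
  exact (thms_KSC₂_base_iff P G (f j) (par j) (C37 j) (C38 j) dC (GA j) (Cinv j) B₀' δ₀' Bβ' Bε' Bεβ' B₁' δ₁' U).2
    (H j hM α₀ hα₀ hMa _ hreg hT)

omit [NormOneClass 𝔸] in
/-- ★★ **`hout` FOR `KSC₂` ON A SUBFAMILY, THE GLOBAL MEMBER RECOVERED AT `W = U′U`**: threshold `max Mo Mg` (`hconv_KSC_on`'s and
`globBlock_kernelFamilyS_of_eBlock`'s at the rate `δ₀/2`), caps `ao = 1`, `a′ = min a (1/4)`, constants `(max (max B₀ (B″·Cg)) B″, min δ₀ (δ₀/2), B_β, B_ε, B_εβ, B₁, δ₁)`: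
`KSC₂`'s block at the product ⟹ (e-part) the record's (3.42) block at `W` by the letter conversion ⟹ the record's (3.47) block at `W` (print p. 398) ⟹ `KSC`'s block at
the product ⟹ the record family's block read along the decoding (`thms_pullK_prod_of_KSC`).
[cite: Balaban1985BackgroundPropagators, Thm 3.4 p.400, p.403 l.1–9, (3.42) p.397, (3.47) p.398; Balaban1984PropagatorsII, Lemma 2.1 p.234] -/
theorem hout_KSC₂_on (hG1 : ∀ u : 𝔸ˣ, u ∈ G → ‖(u : 𝔸)‖ ≤ 1) {M₂ : ℝ} (hM₂ : 0 ≤ M₂) (hrepr : ∀ (v : 𝔸) (j : ι), |b.repr v j| ≤ M₂ * ‖v‖)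
    (hι : ∀ (j : J) (s : BlkY (f j).toKIdx), β (f j).toKIdx.hN (f j).toKIdx.D (f j).toKIdx.hk (ιB j s) = s)
    {Cq : ℝ} (hC37 : ∀ j β' U a, C37 j β' U a → GVal G (f j).toKIdx U ∧ CplxLettersY G (f j) (par j) (ιB j) Cq β' U a) (c35 : ℝ) (dC : ℕ)
    (GA : ∀ j : J, B9.KernelFamily (geo9Y (f j)) (codingYx P G (f j) (C37 j) (C38 j)).bg)
    (Cinv : ∀ j : J, B9.SiteKernel (geo9Y (f j)) (codingYx P G (f j) (C37 j) (C38 j)).bg)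
    (hGA : ∀ (j : J) (c : (codingYx P G (f j) (C37 j) (C38 j)).bg.Cfg),
      (∀ lam β' ζ, 0 ≤ (GA j).h1 c lam β' ζ) ∧ (∀ lam y, 0 ≤ (GA j).e4 c lam y) ∧ (∀ lam β' ζ, 0 ≤ (GA j).h2 c lam β' ζ)) :
    ∀ (B₀ δ₀ : ℝ) (Bβ Bε : ℝ → ℝ) (Bεβ : ℝ → ℝ → ℝ) (B₁ δ₁ : ℝ) (acap : ℝ), 0 < B₀ → 0 < δ₀ → 0 < B₁ → 0 < δ₁ → 0 < acap →
      ∃ (Mo ao a' B₀' δ₀' : ℝ) (Bβ' Bε' : ℝ → ℝ) (Bεβ' : ℝ → ℝ → ℝ) (B₁' δ₁' : ℝ),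
        0 < ao ∧ 0 < a' ∧ a' ≤ acap ∧ 0 < B₀' ∧ 0 < δ₀' ∧ 0 < B₁' ∧ 0 < δ₁' ∧
        ∀ j : J, Mo ≤ (geo9Y (f j)).M → ∀ α₀ : ℝ, 0 < α₀ → (geo9Y (f j)).M * α₀ ≤ ao →
          ∀ c : (codingYx P G (f j) (C37 j) (C38 j)).bg.Cfg, (codingYx P G (f j) (C37 j) (C38 j)).bg.Reg335 c35 α₀ c →
          ∀ α₁ : ℝ, 0 < α₁ → α₁ ≤ a' → ∀ c' : (codingYx P G (f j) (C37 j) (C38 j)).bg.Cfg, (codingYx P G (f j) (C37 j) (C38 j)).bg.Cplx337 α₁ c c' →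
          B9.Thms31to33IneqAt dC (KSC₂ P G (f j) (par j) (C37 j) (C38 j)) (GA j) (Cinv j) B₀ δ₀ Bβ Bε Bεβ B₁ δ₁
              ((codingYx P G (f j) (C37 j) (C38 j)).bg.mul c' c) →
          B9.Thms31to33IneqAt dC (pullK (codingYx P G (f j) (C37 j) (C38 j))
              (kernelFamilyS (f j).toKIdx (bg9YC 𝔸 G P (f j)) (fun U => U) (GpY (f j).toKIdx (par j)) (par j))) (GA j) (Cinv j)
              B₀' δ₀' Bβ' Bε' Bεβ' B₁' δ₁' ((codingYx P G (f j) (C37 j) (C38 j)).bg.mul c' c) := by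
  intro B₀ δ₀ Bβ Bε Bεβ B₁ δ₁ acap hB₀ hδ₀ hB₁ hδ₁ hacap
  obtain ⟨Mo, B'', hB'', H⟩ := hconv_KSC_on P f G par b ιB C37 C38 hG1 hM₂ hrepr hι hC37 B₀ δ₀ hB₀.le hδ₀
  obtain ⟨Mg, Cg, hCg, HG⟩ := globBlock_kernelFamilyS_of_eBlock (d := d) (ℓ := ℓ) (hd := hd) (hL := hL) (b₀ := b₀) (b₁ := b₁) (Mstar := Mstar)
    (𝔸 := 𝔸) (half_pos hδ₀)
  refine ⟨max Mo Mg, 1, min acap (1 / 4), max (max B₀ (B'' * Cg)) B'', min δ₀ (δ₀ / 2), Bβ, Bε, Bεβ, B₁, δ₁, one_pos, lt_min hacap (by norm_num),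
    min_le_left _ _, lt_max_of_lt_left (lt_max_of_lt_left hB₀), lt_min hδ₀ (by linarith), hB₁, hδ₁,
    fun j hM α₀ _ _ c _ α₁ _ hα₁a c' h37 hT => ?_⟩
  obtain ⟨U, a, rfl, rfl, hC⟩ := (codingYx P G (f j) (C37 j) (C38 j)).exists_of_bg_Cplx337 h37
  have hMo : Mo ≤ (geo9Y (f j)).M := le_trans (le_max_left _ _) hM
  have hMg : Mg ≤ (geo9Y (f j)).M := le_trans (le_max_right _ _) hM
  have hα₁c : α₁ ≤ 1 / 4 := le_trans hα₁a (min_le_right _ _)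
  -- the (3.42) member of `KSC₂` at the product IS `KSC`'s
  have hE : EBlock (KSC P G (f j) (par j) (C37 j) (C38 j)) B₀ δ₀ (.prod U a) := hT.1.1.1
  -- the record's (3.42) block at W, then its (3.47) block at W
  have hconv := H j hMo U a α₁ hα₁c hC hE
  have hglob := HG (f j) (ιB j) (hι j) hMg (bg9YC 𝔸 G P (f j)) (fun U => U) (GpY (f j).toKIdx (par j)) (par j) _ B'' hB'' hconv
  -- `KSC`'s block at the product, then the record family's
  have hK := thms_KSC_prod_of_KSC₂ P G (f j) (par j) (C37 j) (C38 j) dC (GA j) (Cinv j) hB₀.le hT hglob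
  exact thms_pullK_prod_of_KSC P G (f j) (par j) (C37 j) (C38 j) dC (GA j) (Cinv j) (hGA j _).1 (hGA j _).2.1 (hGA j _).2.2
    (le_max_of_le_left hB₀.le) hK hB'' hconv

omit [NormOneClass 𝔸] in
/-- ★★ **THE CODED-CARRIER CHAIN FOR `KSC₂` ON A SUBFAMILY** (as `B9SectBCodedChainOnSubfamily.sectBStepPrinted_on_of_KSC`, with `hin_KSC₂_on`, `hout_KSC₂_on`).
[cite: Balaban1985BackgroundPropagators, Thm 3.4 p.400, Sect. B pp.400–407, p.403 l.1–9, (3.35)–(3.37) p.396, (3.47) p.398, p.399] -/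
theorem sectBStepPrinted_on_of_KSC₂ (hG1 : ∀ u : 𝔸ˣ, u ∈ G → ‖(u : 𝔸)‖ ≤ 1) {M₂ : ℝ} (hM₂ : 0 ≤ M₂)
    (hrepr : ∀ (v : 𝔸) (j : ι), |b.repr v j| ≤ M₂ * ‖v‖)
    (hι : ∀ (j : J) (s : BlkY (f j).toKIdx), β (f j).toKIdx.hN (f j).toKIdx.D (f j).toKIdx.hk (ιB j s) = s)
    {Cq : ℝ} (hC37 : ∀ j β' U a, C37 j β' U a → GVal G (f j).toKIdx U ∧ CplxLettersY G (f j) (par j) (ιB j) Cq β' U a) (c35 : ℝ) (dC : ℕ)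
    (GA : ∀ j : J, B9.KernelFamily (geo9Y (f j)) (bg9YC 𝔸 G P (f j))) (Cinv : ∀ j : J, B9.SiteKernel (geo9Y (f j)) (bg9YC 𝔸 G P (f j)))
    (hGA : ∀ (j : J) (U : (bg9YC 𝔸 G P (f j)).Cfg),
      (∀ lam β' ζ, 0 ≤ (GA j).h1 U lam β' ζ) ∧ (∀ lam y, 0 ≤ (GA j).e4 U lam y) ∧ (∀ lam β' ζ, 0 ≤ (GA j).h2 U lam β' ζ))
    (IsAnK : ∀ j : J, B9.KernelFamily (geo9Y (f j)) (codingYx P G (f j) (C37 j) (C38 j)).bg → (codingYx P G (f j) (C37 j) (C38 j)).bg.Cfg → ℝ → Prop)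
    (IsAn : ∀ j : J, B9.KernelFamily (geo9Y (f j)) (bg9YC 𝔸 G P (f j)) → (bg9YC 𝔸 G P (f j)).Cfg → ℝ → Prop)
    {r αcap Mc ac : ℝ} (hr : 0 < r) (hcap : 0 < αcap) (hac : 0 < ac)
    (hAn : ∀ (j : J) (c : (codingYx P G (f j) (C37 j) (C38 j)).bg.Cfg) (α : ℝ),
      (IsAnK j (KSC₂ P G (f j) (par j) (C37 j) (C38 j)) c α →
        pullAn (codingYx P G (f j) (C37 j) (C38 j)) r (IsAn j)
          (pullK (codingYx P G (f j) (C37 j) (C38 j)) (kernelFamilyS (f j).toKIdx (bg9YC 𝔸 G P (f j)) (fun U => U) (GpY (f j).toKIdx (par j)) (par j))) c α) ∧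
      (IsAnK j (pullK (codingYx P G (f j) (C37 j) (C38 j)) (GA j)) c α →
        pullAn (codingYx P G (f j) (C37 j) (C38 j)) r (IsAn j) (pullK (codingYx P G (f j) (C37 j) (C38 j)) (GA j)) c α))
    (hclass : ∀ (j : J) (α₀ α₁ : ℝ) (U U' : (bg9YC 𝔸 G P (f j)).Cfg), Mc ≤ (geo9Y (f j)).M → 0 < α₀ → (geo9Y (f j)).M * α₀ ≤ ac →
      (bg9YC 𝔸 G P (f j)).Reg335 c35 α₀ U → 0 < α₁ → α₁ ≤ αcap → (bg9YC 𝔸 G P (f j)).Cplx337 α₁ U U' →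
      ∃ a : (codingYx P G (f j) (C37 j) (C38 j)).A,
        (codingYx P G (f j) (C37 j) (C38 j)).decA a = U' ∧ (codingYx P G (f j) (C37 j) (C38 j)).C37 (r * α₁) U a)
    (h : B9.SectBStepPrinted dC c35 (fun j => geo9Y (f j)) (fun j => (codingYx P G (f j) (C37 j) (C38 j)).bg)
      (fun j => KSC₂ P G (f j) (par j) (C37 j) (C38 j)) (fun j => pullK (codingYx P G (f j) (C37 j) (C38 j)) (GA j))
      (fun j => pullS (codingYx P G (f j) (C37 j) (C38 j)) (Cinv j)) IsAnK) :
    B9.SectBStepPrinted dC c35 (fun j => geo9Y (f j)) (fun j => bg9YC 𝔸 G P (f j))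
      (fun j => kernelFamilyS (f j).toKIdx (bg9YC 𝔸 G P (f j)) (fun U => U) (GpY (f j).toKIdx (par j)) (par j)) GA Cinv IsAn := by
  refine sectBStepPrinted_of_coded dC c35 (fun j => geo9Y (f j)) (fun j => bg9YC 𝔸 G P (f j)) (fun j => codingYx P G (f j) (C37 j) (C38 j))
    (fun j => kernelFamilyS (f j).toKIdx (bg9YC 𝔸 G P (f j)) (fun U => U) (GpY (f j).toKIdx (par j)) (par j)) GA Cinv IsAn hr hcap hac hclass ?_
  exact sectBStepPrinted_of_family dC c35 (fun j => geo9Y (f j)) (fun j => (codingYx P G (f j) (C37 j) (C38 j)).bg)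
    (fun j => KSC₂ P G (f j) (par j) (C37 j) (C38 j))
    (fun j => pullK (codingYx P G (f j) (C37 j) (C38 j)) (kernelFamilyS (f j).toKIdx (bg9YC 𝔸 G P (f j)) (fun U => U) (GpY (f j).toKIdx (par j)) (par j)))
    (fun j => pullK (codingYx P G (f j) (C37 j) (C38 j)) (GA j)) (fun j => pullK (codingYx P G (f j) (C37 j) (C38 j)) (GA j))
    (fun j => pullS (codingYx P G (f j) (C37 j) (C38 j)) (Cinv j)) IsAnK
    (fun j => pullAn (codingYx P G (f j) (C37 j) (C38 j)) r (IsAn j))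
    (hin_KSC₂_on P f G par b ιB C37 C38 hι hG1 hM₂ hrepr c35 dC _ _)
    (hout_KSC₂_on P f G par b ιB C37 C38 hG1 hM₂ hrepr hι hC37 c35 dC _ _ fun j c => hGA j _) hAn h

/-- ★★ **THE SAME WITH THE CLASS HYPOTHESES DISCHARGED** (coded class `C37Y`, transporter `parSymY`, `r = L⁴`, `αcap = 1∕4`, `Mc = 2(d+1)+1`).
[cite: Balaban1985BackgroundPropagators, Thm 3.4 p.400, Sect. B pp.400–407, (3.35)–(3.37) p.396, (3.58) p.402, (3.47) p.398] -/
theorem sectBStepPrinted_on_of_KSC₂_C37Y (hι : ∀ (j : J) (s : BlkY (f j).toKIdx), β (f j).toKIdx.hN (f j).toKIdx.D (f j).toKIdx.hk (ιB j s) = s)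
    (hG1 : ∀ u : 𝔸ˣ, u ∈ G → ‖(u : 𝔸)‖ ≤ 1) {M₂ : ℝ} (hM₂ : 0 ≤ M₂) (hrepr : ∀ (v : 𝔸) (j : ι), |b.repr v j| ≤ M₂ * ‖v‖) (c35 : ℝ) (dC : ℕ)
    (GA : ∀ j : J, B9.KernelFamily (geo9Y (f j)) (bg9YC 𝔸 G P (f j))) (Cinv : ∀ j : J, B9.SiteKernel (geo9Y (f j)) (bg9YC 𝔸 G P (f j)))
    (hGA : ∀ (j : J) (U : (bg9YC 𝔸 G P (f j)).Cfg),
      (∀ lam β' ζ, 0 ≤ (GA j).h1 U lam β' ζ) ∧ (∀ lam y, 0 ≤ (GA j).e4 U lam y) ∧ (∀ lam β' ζ, 0 ≤ (GA j).h2 U lam β' ζ))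
    (IsAnK : ∀ j : J,
      B9.KernelFamily (geo9Y (f j)) (codingYx P G (f j) (C37Y G (f j) (ιB j) (4 * ((d : ℝ) + 1) * Real.exp (3 * (((d : ℝ) + 1) / 2)))) (C38 j)).bg →
        (codingYx P G (f j) (C37Y G (f j) (ιB j) (4 * ((d : ℝ) + 1) * Real.exp (3 * (((d : ℝ) + 1) / 2)))) (C38 j)).bg.Cfg → ℝ → Prop)
    (IsAn : ∀ j : J, B9.KernelFamily (geo9Y (f j)) (bg9YC 𝔸 G P (f j)) → (bg9YC 𝔸 G P (f j)).Cfg → ℝ → Prop) {ac : ℝ} (hac : 0 < ac)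
    (hAn : ∀ (j : J) (c : (codingYx P G (f j) (C37Y G (f j) (ιB j) (4 * ((d : ℝ) + 1) * Real.exp (3 * (((d : ℝ) + 1) / 2)))) (C38 j)).bg.Cfg) (α : ℝ),
      (IsAnK j (KSC₂ P G (f j) (parSymY (f j).toKIdx) (C37Y G (f j) (ιB j) (4 * ((d : ℝ) + 1) * Real.exp (3 * (((d : ℝ) + 1) / 2)))) (C38 j)) c α →
        pullAn (codingYx P G (f j) (C37Y G (f j) (ιB j) (4 * ((d : ℝ) + 1) * Real.exp (3 * (((d : ℝ) + 1) / 2)))) (C38 j)) (((ℓ : ℝ) + 1) ^ 4) (IsAn j)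
          (pullK (codingYx P G (f j) (C37Y G (f j) (ιB j) (4 * ((d : ℝ) + 1) * Real.exp (3 * (((d : ℝ) + 1) / 2)))) (C38 j))
            (kernelFamilyS (f j).toKIdx (bg9YC 𝔸 G P (f j)) (fun U => U) (GpY (f j).toKIdx (parSymY (f j).toKIdx)) (parSymY (f j).toKIdx))) c α) ∧
      (IsAnK j (pullK (codingYx P G (f j) (C37Y G (f j) (ιB j) (4 * ((d : ℝ) + 1) * Real.exp (3 * (((d : ℝ) + 1) / 2)))) (C38 j)) (GA j)) c α →
        pullAn (codingYx P G (f j) (C37Y G (f j) (ιB j) (4 * ((d : ℝ) + 1) * Real.exp (3 * (((d : ℝ) + 1) / 2)))) (C38 j)) (((ℓ : ℝ) + 1) ^ 4) (IsAn j)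
          (pullK (codingYx P G (f j) (C37Y G (f j) (ιB j) (4 * ((d : ℝ) + 1) * Real.exp (3 * (((d : ℝ) + 1) / 2)))) (C38 j)) (GA j)) c α))
    (h : B9.SectBStepPrinted dC c35 (fun j => geo9Y (f j))
      (fun j => (codingYx P G (f j) (C37Y G (f j) (ιB j) (4 * ((d : ℝ) + 1) * Real.exp (3 * (((d : ℝ) + 1) / 2)))) (C38 j)).bg)
      (fun j => KSC₂ P G (f j) (parSymY (f j).toKIdx) (C37Y G (f j) (ιB j) (4 * ((d : ℝ) + 1) * Real.exp (3 * (((d : ℝ) + 1) / 2)))) (C38 j))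
      (fun j => pullK (codingYx P G (f j) (C37Y G (f j) (ιB j) (4 * ((d : ℝ) + 1) * Real.exp (3 * (((d : ℝ) + 1) / 2)))) (C38 j)) (GA j))
      (fun j => pullS (codingYx P G (f j) (C37Y G (f j) (ιB j) (4 * ((d : ℝ) + 1) * Real.exp (3 * (((d : ℝ) + 1) / 2)))) (C38 j)) (Cinv j)) IsAnK) :
    B9.SectBStepPrinted dC c35 (fun j => geo9Y (f j)) (fun j => bg9YC 𝔸 G P (f j))
      (fun j => kernelFamilyS (f j).toKIdx (bg9YC 𝔸 G P (f j)) (fun U => U) (GpY (f j).toKIdx (parSymY (f j).toKIdx)) (parSymY (f j).toKIdx)) GA Cinv IsAn := by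
  have hL4 : (0 : ℝ) < ((ℓ : ℝ) + 1) ^ 4 := by positivity
  exact sectBStepPrinted_on_of_KSC₂ P f G (fun j => parSymY (f j).toKIdx) b ιB
    (fun j => C37Y G (f j) (ιB j) (4 * ((d : ℝ) + 1) * Real.exp (3 * (((d : ℝ) + 1) / 2)))) C38 hG1 hM₂ hrepr hι
    (fun j => cplxLettersY_of_C37Y G (f j) (ιB j) _) c35 dC GA Cinv hGA IsAnK IsAn hL4 (by norm_num : (0 : ℝ) < 1 / 4) hac hAn
    (hclass_C37Y_on P f G ιB C38 hι hG1 c35 ac) h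

/-- ★★ **THE SAME ON A CORNER-FREE SUBFAMILY** (`hf : β` onto at every `f j`; sections `Function.surjInv (hf j)`): no section binder, no class hypothesis.
[cite: Balaban1985BackgroundPropagators, Thm 3.4 p.400, Sect. B pp.400–407, (3.35)–(3.37) p.396, (3.47) p.398, p.399; Balaban1984PropagatorsII, (2.45) p.231] -/
theorem sectBStepPrinted_cornerFree_of_KSC₂_C37Y (hf : ∀ j : J, Function.Surjective (β (f j).toKIdx.hN (f j).toKIdx.D (f j).toKIdx.hk))
    (hG1 : ∀ u : 𝔸ˣ, u ∈ G → ‖(u : 𝔸)‖ ≤ 1) {M₂ : ℝ} (hM₂ : 0 ≤ M₂) (hrepr : ∀ (v : 𝔸) (j : ι), |b.repr v j| ≤ M₂ * ‖v‖) (c35 : ℝ) (dC : ℕ)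
    (GA : ∀ j : J, B9.KernelFamily (geo9Y (f j)) (bg9YC 𝔸 G P (f j))) (Cinv : ∀ j : J, B9.SiteKernel (geo9Y (f j)) (bg9YC 𝔸 G P (f j)))
    (hGA : ∀ (j : J) (U : (bg9YC 𝔸 G P (f j)).Cfg),
      (∀ lam β' ζ, 0 ≤ (GA j).h1 U lam β' ζ) ∧ (∀ lam y, 0 ≤ (GA j).e4 U lam y) ∧ (∀ lam β' ζ, 0 ≤ (GA j).h2 U lam β' ζ))
    (IsAnK : ∀ j : J,
      B9.KernelFamily (geo9Y (f j))
          (codingYx P G (f j) (C37Y G (f j) (fun s => Function.surjInv (hf j) s) (4 * ((d : ℝ) + 1) * Real.exp (3 * (((d : ℝ) + 1) / 2)))) (C38 j)).bg →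
        (codingYx P G (f j) (C37Y G (f j) (fun s => Function.surjInv (hf j) s) (4 * ((d : ℝ) + 1) * Real.exp (3 * (((d : ℝ) + 1) / 2)))) (C38 j)).bg.Cfg →
          ℝ → Prop)
    (IsAn : ∀ j : J, B9.KernelFamily (geo9Y (f j)) (bg9YC 𝔸 G P (f j)) → (bg9YC 𝔸 G P (f j)).Cfg → ℝ → Prop) {ac : ℝ} (hac : 0 < ac)
    (hAn : ∀ (j : J)
      (c : (codingYx P G (f j) (C37Y G (f j) (fun s => Function.surjInv (hf j) s) (4 * ((d : ℝ) + 1) * Real.exp (3 * (((d : ℝ) + 1) / 2)))) (C38 j)).bg.Cfg)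
      (α : ℝ),
      (IsAnK j (KSC₂ P G (f j) (parSymY (f j).toKIdx)
          (C37Y G (f j) (fun s => Function.surjInv (hf j) s) (4 * ((d : ℝ) + 1) * Real.exp (3 * (((d : ℝ) + 1) / 2)))) (C38 j)) c α →
        pullAn (codingYx P G (f j) (C37Y G (f j) (fun s => Function.surjInv (hf j) s) (4 * ((d : ℝ) + 1) * Real.exp (3 * (((d : ℝ) + 1) / 2)))) (C38 j))
          (((ℓ : ℝ) + 1) ^ 4) (IsAn j)
          (pullK (codingYx P G (f j) (C37Y G (f j) (fun s => Function.surjInv (hf j) s) (4 * ((d : ℝ) + 1) * Real.exp (3 * (((d : ℝ) + 1) / 2)))) (C38 j))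
            (kernelFamilyS (f j).toKIdx (bg9YC 𝔸 G P (f j)) (fun U => U) (GpY (f j).toKIdx (parSymY (f j).toKIdx)) (parSymY (f j).toKIdx))) c α) ∧
      (IsAnK j (pullK (codingYx P G (f j) (C37Y G (f j) (fun s => Function.surjInv (hf j) s) (4 * ((d : ℝ) + 1) * Real.exp (3 * (((d : ℝ) + 1) / 2))))
          (C38 j)) (GA j)) c α →
        pullAn (codingYx P G (f j) (C37Y G (f j) (fun s => Function.surjInv (hf j) s) (4 * ((d : ℝ) + 1) * Real.exp (3 * (((d : ℝ) + 1) / 2)))) (C38 j))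
          (((ℓ : ℝ) + 1) ^ 4) (IsAn j)
          (pullK (codingYx P G (f j) (C37Y G (f j) (fun s => Function.surjInv (hf j) s) (4 * ((d : ℝ) + 1) * Real.exp (3 * (((d : ℝ) + 1) / 2)))) (C38 j))
            (GA j)) c α))
    (h : B9.SectBStepPrinted dC c35 (fun j => geo9Y (f j))
      (fun j => (codingYx P G (f j) (C37Y G (f j) (fun s => Function.surjInv (hf j) s) (4 * ((d : ℝ) + 1) * Real.exp (3 * (((d : ℝ) + 1) / 2)))) (C38 j)).bg)
      (fun j => KSC₂ P G (f j) (parSymY (f j).toKIdx)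
        (C37Y G (f j) (fun s => Function.surjInv (hf j) s) (4 * ((d : ℝ) + 1) * Real.exp (3 * (((d : ℝ) + 1) / 2)))) (C38 j))
      (fun j => pullK (codingYx P G (f j) (C37Y G (f j) (fun s => Function.surjInv (hf j) s) (4 * ((d : ℝ) + 1) * Real.exp (3 * (((d : ℝ) + 1) / 2))))
        (C38 j)) (GA j))
      (fun j => pullS (codingYx P G (f j) (C37Y G (f j) (fun s => Function.surjInv (hf j) s) (4 * ((d : ℝ) + 1) * Real.exp (3 * (((d : ℝ) + 1) / 2))))
        (C38 j)) (Cinv j)) IsAnK) :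
    B9.SectBStepPrinted dC c35 (fun j => geo9Y (f j)) (fun j => bg9YC 𝔸 G P (f j))
      (fun j => kernelFamilyS (f j).toKIdx (bg9YC 𝔸 G P (f j)) (fun U => U) (GpY (f j).toKIdx (parSymY (f j).toKIdx)) (parSymY (f j).toKIdx)) GA Cinv IsAn :=
  sectBStepPrinted_on_of_KSC₂_C37Y P f G b (fun j s => Function.surjInv (hf j) s) C38 (fun j s => Function.surjInv_eq (hf j) s) hG1 hM₂ hrepr c35 dC GA Cinv hGA
    IsAnK IsAn hac hAn h

end Chain

end Literature.MathematicalPhysics.QuantumFieldTheory.Balaban1983to89.B9SectBCodedChainGlobR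

/-!
# `Balaban1983to89.B9SectBCodedChainAnR` — THE CLASS-PARAMETRIC TWIN of `B9SectBCodedChainAn` (CASCADE-R, director-ym №279 GO-R; №277 (3) `hunitA` cure; dag-n06-d SOCKET-(α) class question)

statement-level skeleton of published theorems with citation tags; proofs where landed; nothing here is a claim about the
Yang–Mills mass gap

WHAT THIS FILE IS.  The original module `B9SectBCodedChainAn` types its objects over MODULE 3's member carrier `bg9Y 𝔸 G x` (MODULE 2's small-cube class (3.35)).  This file RE-DECLARES, with UNCHANGED NAMES inside the namespace `…B9SectBCodedChainAnR`, exactly its 8 class-dependent declarations over the CLASS-PARAMETRIC carrier `B9SectBCodedClassR.bg9YC 𝔸 G P x` (`P : RegExtraY …` = the two cube conditions of (3.35)∕(3.36) as a parameter; `bg9Y 𝔸 G x = bg9YC 𝔸 G (extraY 𝔸 G) x` by `rfl`, so every declaration here specialises definitionally to its original; at the record's reading of PRINT's class, `P := extraYPb 𝔸 G`, the displayed laws `hreg335P` ((3.35) on plaquettes) and the class-keyed `hunitA` become theorems).  The text is the original's VERBATIM under the token surgery `bg9Y 𝔸 G ↦ bg9YC 𝔸 G P`, `NAME ↦ NAME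 P` for the class-dependent names (P the first explicit argument), and — №277 — the binder `hunitA` re-keyed from «all G-valued U» to «all (3.35)-regular U of the carrier» (`∀ j α₀ U, (bg9YC 𝔸 G P (f j)).Reg335 c35 α₀ U → IsUnit (deltaAY …)`).  Class-free declarations of the original are NOT copied: they are imported and used BY NAME (`open … hiding` the re-declared ones).  Generated by dag-n06-c g16's `gen.py` (HOME `pub-ymgap-dag-n06-c/lean/g16/`); the ORIGINAL MODULE DOCUMENTATION FOLLOWS VERBATIM and describes the mathematics.

HONEST SCOPE.  Re-typing bookkeeping; nothing of [B9] asserted beyond the original; COUNT-NEUTRAL; N06 NOT discharged; nothing continuum ∕ OS ∕ mass gap ∕ Clay.  Cell `pub-ymgap` (D-0062), Track A node N06 [B9], seat `pub-ymgap-dag-n06-c` g16, 2026-08-29.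
-/

/-! Module documentation: that of the original `Balaban1983to89.B9SectBCodedChainAn` applies verbatim to this twin (not repeated here). -/

namespace Literature.MathematicalPhysics.QuantumFieldTheory.Balaban1983to89.B9SectBCodedChainAnR

open Literature.MathematicalPhysics.QuantumFieldTheory.Balaban1983to89.B9SectBCodedClassR (RegExtraY bg9YC)
open Literature.MathematicalPhysics.QuantumFieldTheory.Balaban1983to89.B9SectBCodedChainAn hiding IsAnKY IsAnRecY isAnKY_base_iff hAn_of_pin anFrame₂CodedOn sectBStepPrinted_on_of_KSC₂_C37Y_an sectBStepPrinted_cornerFree_of_KSC₂_C37Y_an isUnit_deltaPrimeAY_of_isAnRecY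

open Literature.MathematicalPhysics.QuantumFieldTheory.Balaban1983to89
open Literature.MathematicalPhysics.QuantumFieldTheory.Balaban1983to89.B6KLevelCensusIndexV1 (KIdx kGeo)
open Literature.MathematicalPhysics.QuantumFieldTheory.Balaban1983to89.B6Ineq2142KLevelV1 (β)
open Literature.MathematicalPhysics.QuantumFieldTheory.Balaban1983to89.B9FromB6 (EBlock GlobBlock)
open Literature.MathematicalPhysics.QuantumFieldTheory.Balaban1983to89.B9Eq39Adjoint (fluct)
open Literature.MathematicalPhysics.QuantumFieldTheory.Balaban1983to89.B9Eq352DivFormLetters (conj)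
open Literature.MathematicalPhysics.QuantumFieldTheory.Balaban1983to89.B9SectBCodedCarrier (CCfg Coding pullK pullS pullAn pullAn_base_iff pullK_injective)
open Literature.MathematicalPhysics.QuantumFieldTheory.Balaban1983to89.B9SectBGpStepAtLettersV2 (GpFrame₂ AnFrame₂)
open Literature.MathematicalPhysics.QuantumFieldTheory.Balaban1983to89.B9Eq360DeltaPrimeAY (AfldY mulY)
open Literature.MathematicalPhysics.QuantumFieldTheory.Balaban1983to89.B9PinMembersKLevelV1 (MemberY geo9Y bg9Y)
open Literature.MathematicalPhysics.QuantumFieldTheory.Balaban1983to89.B9SectBGpLettersY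
open Literature.MathematicalPhysics.QuantumFieldTheory.Balaban1983to89.B9SectBGpFrameCodedYR (codingYx Read342Y Write342Y)
open Literature.MathematicalPhysics.QuantumFieldTheory.Balaban1983to89.B9SectBGpFrameCodedY (CplxLettersY)
open Literature.MathematicalPhysics.QuantumFieldTheory.Balaban1983to89.B9SectBCodedClassY (C37Y cplxLettersY_of_C37Y)
open Literature.MathematicalPhysics.QuantumFieldTheory.Balaban1983to89.B9SectBCodedChainOnSubfamilyR (gpFrame₂CodedOn)
open Literature.MathematicalPhysics.QuantumFieldTheory.Balaban1983to89.B9SectBCodedChainGlobR (KSC₂ sectBStepPrinted_on_of_KSC₂_C37Y)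
open Literature.MathematicalPhysics.QuantumFieldTheory.Balaban1983to89.Node00 (SiteY BlkY IBondY CfgY SiteParY parSymY deltaPrimeAY kernelFamilyS GpY)

variable {d ℓ : ℕ} {hd : 1 ≤ d + 1} {hL : Odd (ℓ + 1) ∧ 1 < ℓ + 1} {b₀ b₁ : ℝ} {Mstar : ℕ}
variable {𝔸 : Type} [NormedRing 𝔸] (P : RegExtraY d ℓ hd hL b₀ b₁ Mstar 𝔸) [NormedAlgebra ℂ 𝔸] [CompleteSpace 𝔸]

/-! ## §1 The two analyticity predicates and the transport `hAn` -/

section Predicates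

variable (G : Subgroup 𝔸ˣ) (x : MemberY d ℓ hd hL b₀ b₁ Mstar) (par : SiteParY 𝔸 x.toKIdx) {ι : Type} [Fintype ι] (b : Module.Basis ι ℝ 𝔸)
  (C37 C38 : ℝ → CfgY 𝔸 x.toKIdx → AfldY 𝔸 x.toKIdx → Prop)

/-- **THE CODED ANALYTICITY PREDICATE** (kernel-family independent): at a base `U` and exponent `α`, for every code `a` with `C37 α U a` the letters satisfy
`Δp(prod U a)·Gop(prod U a) = 1 = Gop(prod U a)·Δp(prod U a)` — the hypothesis of `AnFrame₂.writeAn`, verbatim; `True` off the bases.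
[cite: Balaban1985BackgroundPropagators, Thm 3.4 p.400, (3.62)–(3.64) p.402] -/
def IsAnKY : B9.KernelFamily (geo9Y x) (codingYx P G x C37 C38).bg → (codingYx P G x C37 C38).bg.Cfg → ℝ → Prop :=
  fun _ c α => match c with
    | .base U => ∀ a : AfldY 𝔸 x.toKIdx, C37 α U a →
        ΔpC x.toKIdx par b (.prod U a) * GopC x.toKIdx par b (.prod U a) = 1 ∧ GopC x.toKIdx par b (.prod U a) * ΔpC x.toKIdx par b (.prod U a) = 1
    | .mult _ => True
    | .prod _ _ => True

/-- **THE RECORD-SIDE ANALYTICITY PREDICATE THE CODED ONE TRANSPORTS TO** (kernel-family independent; rescaling `r` of the exponent as in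
`sectBStepPrinted_of_coded`): at `U` and exponent `β`, for every code `a` of the class at `r·β`, `η²G′(e^{ηa}U)` is the two-sided inverse of `η⁻²Δ′_a(e^{ηa}U)` in
the real coordinates of `b`. [cite: Balaban1985BackgroundPropagators, Thm 3.4 p.400 («extend to configurations U′U … as analytic functions of A′»), (3.62)–(3.64) p.402] -/
def IsAnRecY (r : ℝ) : B9.KernelFamily (geo9Y x) (bg9YC 𝔸 G P x) → (bg9YC 𝔸 G P x).Cfg → ℝ → Prop :=
  fun _ U β' => ∀ a : AfldY 𝔸 x.toKIdx, C37 (r * β') U a →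
    ΔpC x.toKIdx par b (.prod U a) * GopC x.toKIdx par b (.prod U a) = 1 ∧ GopC x.toKIdx par b (.prod U a) * ΔpC x.toKIdx par b (.prod U a) = 1

/-- the coded predicate at a base, unfolded. [cite: Balaban1985BackgroundPropagators, Thm 3.4 p.400, bookkeeping] -/
theorem isAnKY_base_iff (K : B9.KernelFamily (geo9Y x) (codingYx P G x C37 C38).bg) (U : CfgY 𝔸 x.toKIdx) (α : ℝ) :
    IsAnKY P G x par b C37 C38 K (.base U) α ↔ ∀ a : AfldY 𝔸 x.toKIdx, C37 α U a →
      ΔpC x.toKIdx par b (.prod U a) * GopC x.toKIdx par b (.prod U a) = 1 ∧ GopC x.toKIdx par b (.prod U a) * ΔpC x.toKIdx par b (.prod U a) = 1 :=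
  Iff.rfl

/-- ★ **THE TRANSPORT `hAn` HOLDS FOR THE PAIR `(IsAnKY, IsAnRecY r)`**, for every kernel family on either side (both predicates ignore it): at a base by
`pullAn_base_iff` and `r·(α/r) = α`, off the bases `pullAn` is `True`. [cite: Balaban1985BackgroundPropagators, Thm 3.4 p.400, bookkeeping] -/
theorem hAn_of_pin {r : ℝ} (hr : 0 < r) (K : B9.KernelFamily (geo9Y x) (codingYx P G x C37 C38).bg) (Krec : B9.KernelFamily (geo9Y x) (bg9YC 𝔸 G P x))
    (c : (codingYx P G x C37 C38).bg.Cfg) (α : ℝ) :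
    IsAnKY P G x par b C37 C38 K c α → pullAn (codingYx P G x C37 C38) r (IsAnRecY P G x par b C37 r) (pullK (codingYx P G x C37 C38) Krec) c α := by
  intro h
  cases c with
  | base U =>
    rw [pullAn_base_iff]
    intro a ha
    rw [mul_div_cancel₀ α hr.ne'] at ha
    exact h a ha
  | mult a => trivial
  | prod U a => trivial

end Predicates

/-! ## §2 ★ The frame `AnFrame₂` over the coded carriers of a subfamily, inhabited -/

section Frame

variable [NormOneClass 𝔸] {J : Type} (f : J → MemberY d ℓ hd hL b₀ b₁ Mstar)
  (c35 : ℝ) (G : Subgroup 𝔸ˣ) {ι : Type} [Fintype ι] [DecidableEq ι] (b : Module.Basis ι ℝ 𝔸)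
  [∀ x : MemberY d ℓ hd hL b₀ b₁ Mstar, Fintype (geo9Y x).Site] [instDS : ∀ x : MemberY d ℓ hd hL b₀ b₁ Mstar, DecidableEq (geo9Y x).Site]
  [∀ x : MemberY d ℓ hd hL b₀ b₁ Mstar, Nonempty (geo9Y x).Site]
  (C37 C38 : ∀ j : J, ℝ → CfgY 𝔸 (f j).toKIdx → AfldY 𝔸 (f j).toKIdx → Prop)
  (par : ∀ j : J, SiteParY 𝔸 (f j).toKIdx)
  (ιB : ∀ j : J, BlkY (f j).toKIdx → IBondY (f j).toKIdx)
  (KC : ∀ j : J, B9.KernelFamily (geo9Y (f j)) (codingYx P G (f j) (C37 j) (C38 j)).bg)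

/-- ★ **THE ANALYTIC-EXTENSION FRAME `AnFrame₂` OVER THE CODED CARRIERS OF A SUBFAMILY, INHABITED** at the coded predicate `IsAnKY`: the root frame
`gpFrame₂CodedOn` (any coded family `KC` with its (3.42) dictionaries displayed) plus `writeAn`, which holds BY DEFINITION of `IsAnKY` (the class (3.37) of the
coding at a base is `C37` at the multipliers, `bg_Cplx337_base_mult`; the coded product is `prod U a`). [cite: Balaban1985BackgroundPropagators, Thm 3.4 p.400, (3.62)–(3.64) p.402, (3.35)–(3.37) p.396; Balaban1984PropagatorsII, Lemma 2.1 p.234] -/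
noncomputable def anFrame₂CodedOn (hι : ∀ (j : J) (s : BlkY (f j).toKIdx), β (f j).toKIdx.hN (f j).toKIdx.D (f j).toKIdx.hk (ιB j s) = s)
    (hG1 : ∀ u : 𝔸ˣ, u ∈ G → ‖(u : 𝔸)‖ ≤ 1) (hpar : ∀ j (U : CfgY 𝔸 (f j).toKIdx), GVal G (f j).toKIdx U → ∀ z w, par j U z w ∈ G)
    (hunit : ∀ j (U : CfgY 𝔸 (f j).toKIdx), GVal G (f j).toKIdx U → IsUnit (deltaPrimeAY (f j).toKIdx (par j) U))
    (dB : ℕ) (M₂ : ℝ) (hM₂ : 0 ≤ M₂) (hrepr : ∀ (v : 𝔸) (j : ι), |b.repr v j| ≤ M₂ * ‖v‖)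
    (Cq : ℝ) (hCq : 0 ≤ Cq) (hC37 : ∀ j β' U a, C37 j β' U a → GVal G (f j).toKIdx U ∧ CplxLettersY G (f j) (par j) (ιB j) Cq β' U a)
    (cR : ℝ) (hcR : 0 < cR) (wBf : ℝ → ℝ → ℝ) (hwBf : ∀ B δ : ℝ, 0 ≤ B → 0 < δ → 0 < wBf B δ) (wδf : ℝ → ℝ) (hwδf : ∀ δ : ℝ, 0 < δ → 0 < wδf δ)
    (MInv aInv aW : ℝ) (hMInv : 0 < MInv) (haInv : 0 < aInv) (haW : 0 < aW)
    (hread : ∀ j, Read342Y P G (f j) (par j) b (ιB j) (C37 j) (C38 j) (KC j) c35 cR MInv aInv 0 True)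
    (hwrite : ∀ j, Write342Y P G (f j) (par j) b (ιB j) (C37 j) (C38 j) (KC j) wBf wδf aW 0 True) :
    AnFrame₂ c35 (fun j => geo9Y (f j)) (fun j => (codingYx P G (f j) (C37 j) (C38 j)).bg) KC b (Fin (d + 1)) (fun j => SiteY (f j).toKIdx)
      (fun j => IsAnKY P G (f j) (par j) b (C37 j) (C38 j)) :=
  { gpFrame₂CodedOn P f c35 G b C37 C38 par ιB KC hι hG1 hpar hunit dB M₂ hM₂ hrepr Cq hCq hC37 cR hcR wBf hwBf wδf hwδf MInv aInv aW hMInv haInv haW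
      hread hwrite with
    writeAn := fun j α₀ c α₁ _ _ _ hreg _ _ H => by
      obtain ⟨U, rfl, -⟩ := (codingYx P G (f j) (C37 j) (C38 j)).exists_of_bg_Reg335 hreg
      intro a ha
      exact H (.mult a) (((codingYx P G (f j) (C37 j) (C38 j)).bg_Cplx337_base_mult α₁ U a).2 ha) }

end Frame

/-! ## §3 ★★★ The chain with `hAn` discharged (pin `IsAnRecY L⁴`) -/

section Chain

variable [NormOneClass 𝔸] [FiniteDimensional ℝ 𝔸] {J : Type} (f : J → MemberY d ℓ hd hL b₀ b₁ Mstar) [∀ x : MemberY d ℓ hd hL b₀ b₁ Mstar, Fintype (geo9Y x).Site]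
  (G : Subgroup 𝔸ˣ) {ι : Type} [Fintype ι] (b : Module.Basis ι ℝ 𝔸)
  (ιB : ∀ j : J, BlkY (f j).toKIdx → IBondY (f j).toKIdx)
  (C38 : ∀ j : J, ℝ → CfgY 𝔸 (f j).toKIdx → AfldY 𝔸 (f j).toKIdx → Prop)

/-- ★★★ **THE CODED-CARRIER CHAIN (`KSC₂`, class `C37Y`) ON A SUBFAMILY WITH SECTIONS, `hAn` DISCHARGED**: analyticity predicates `IsAnKY` (coded) and
`IsAnRecY L⁴` (record).  IF the Sect.-B step holds for `(KSC₂, pullK GA, pullS Cinv, IsAnKY)` over the coded carriers on `J` — the letters-level frames' output —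
THEN it holds for the record's `(G′ read by kernelFamilyS (GpY parSymY) parSymY, GA, Cinv, IsAnRecY L⁴)` on `J`; displayed besides: `hι`, `hG1`, the basis data,
nonnegative Hölder members of `GA`, `C38`, `ac`. [cite: Balaban1985BackgroundPropagators, Thm 3.4 p.400, Sect. B pp.400–407, (3.35)–(3.37) p.396, (3.47) p.398, (3.62)–(3.64) p.402; Balaban1984PropagatorsII, Lemma 2.1 p.234] -/
theorem sectBStepPrinted_on_of_KSC₂_C37Y_an (hι : ∀ (j : J) (s : BlkY (f j).toKIdx), β (f j).toKIdx.hN (f j).toKIdx.D (f j).toKIdx.hk (ιB j s) = s)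
    (hG1 : ∀ u : 𝔸ˣ, u ∈ G → ‖(u : 𝔸)‖ ≤ 1) {M₂ : ℝ} (hM₂ : 0 ≤ M₂) (hrepr : ∀ (v : 𝔸) (j : ι), |b.repr v j| ≤ M₂ * ‖v‖) (c35 : ℝ) (dC : ℕ)
    (GA : ∀ j : J, B9.KernelFamily (geo9Y (f j)) (bg9YC 𝔸 G P (f j))) (Cinv : ∀ j : J, B9.SiteKernel (geo9Y (f j)) (bg9YC 𝔸 G P (f j)))
    (hGA : ∀ (j : J) (U : (bg9YC 𝔸 G P (f j)).Cfg),
      (∀ lam β' ζ, 0 ≤ (GA j).h1 U lam β' ζ) ∧ (∀ lam y, 0 ≤ (GA j).e4 U lam y) ∧ (∀ lam β' ζ, 0 ≤ (GA j).h2 U lam β' ζ))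
    {ac : ℝ} (hac : 0 < ac)
    (h : B9.SectBStepPrinted dC c35 (fun j => geo9Y (f j))
      (fun j => (codingYx P G (f j) (C37Y G (f j) (ιB j) (4 * ((d : ℝ) + 1) * Real.exp (3 * (((d : ℝ) + 1) / 2)))) (C38 j)).bg)
      (fun j => KSC₂ P G (f j) (parSymY (f j).toKIdx) (C37Y G (f j) (ιB j) (4 * ((d : ℝ) + 1) * Real.exp (3 * (((d : ℝ) + 1) / 2)))) (C38 j))
      (fun j => pullK (codingYx P G (f j) (C37Y G (f j) (ιB j) (4 * ((d : ℝ) + 1) * Real.exp (3 * (((d : ℝ) + 1) / 2)))) (C38 j)) (GA j))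
      (fun j => pullS (codingYx P G (f j) (C37Y G (f j) (ιB j) (4 * ((d : ℝ) + 1) * Real.exp (3 * (((d : ℝ) + 1) / 2)))) (C38 j)) (Cinv j))
      (fun j => IsAnKY P G (f j) (parSymY (f j).toKIdx) b (C37Y G (f j) (ιB j) (4 * ((d : ℝ) + 1) * Real.exp (3 * (((d : ℝ) + 1) / 2)))) (C38 j))) :
    B9.SectBStepPrinted dC c35 (fun j => geo9Y (f j)) (fun j => bg9YC 𝔸 G P (f j))
      (fun j => kernelFamilyS (f j).toKIdx (bg9YC 𝔸 G P (f j)) (fun U => U) (GpY (f j).toKIdx (parSymY (f j).toKIdx)) (parSymY (f j).toKIdx)) GA Cinv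
      (fun j => IsAnRecY P G (f j) (parSymY (f j).toKIdx) b (C37Y G (f j) (ιB j) (4 * ((d : ℝ) + 1) * Real.exp (3 * (((d : ℝ) + 1) / 2)))) (((ℓ : ℝ) + 1) ^ 4)) := by
  have hL4 : (0 : ℝ) < ((ℓ : ℝ) + 1) ^ 4 := by positivity
  refine sectBStepPrinted_on_of_KSC₂_C37Y P f G b ιB C38 hι hG1 hM₂ hrepr c35 dC GA Cinv hGA _ _ hac (fun j c α => ⟨?_, ?_⟩) h
  · exact hAn_of_pin P G (f j) (parSymY (f j).toKIdx) b _ (C38 j) hL4 _ _ c α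
  · exact hAn_of_pin P G (f j) (parSymY (f j).toKIdx) b _ (C38 j) hL4 _ _ c α

/-- ★★★ **THE SAME ON A CORNER-FREE SUBFAMILY** (`hf : β` onto at every `f j`; sections `Function.surjInv (hf j)`): the displayed hypotheses are the frames' output
`h` and structural record data ONLY. [cite: Balaban1985BackgroundPropagators, Thm 3.4 p.400, Sect. B pp.400–407, (3.35)–(3.37) p.396, p.399; Balaban1984PropagatorsII, (2.45) p.231] -/
theorem sectBStepPrinted_cornerFree_of_KSC₂_C37Y_an (hf : ∀ j : J, Function.Surjective (β (f j).toKIdx.hN (f j).toKIdx.D (f j).toKIdx.hk))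
    (hG1 : ∀ u : 𝔸ˣ, u ∈ G → ‖(u : 𝔸)‖ ≤ 1) {M₂ : ℝ} (hM₂ : 0 ≤ M₂) (hrepr : ∀ (v : 𝔸) (j : ι), |b.repr v j| ≤ M₂ * ‖v‖) (c35 : ℝ) (dC : ℕ)
    (GA : ∀ j : J, B9.KernelFamily (geo9Y (f j)) (bg9YC 𝔸 G P (f j))) (Cinv : ∀ j : J, B9.SiteKernel (geo9Y (f j)) (bg9YC 𝔸 G P (f j)))
    (hGA : ∀ (j : J) (U : (bg9YC 𝔸 G P (f j)).Cfg),
      (∀ lam β' ζ, 0 ≤ (GA j).h1 U lam β' ζ) ∧ (∀ lam y, 0 ≤ (GA j).e4 U lam y) ∧ (∀ lam β' ζ, 0 ≤ (GA j).h2 U lam β' ζ))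
    {ac : ℝ} (hac : 0 < ac)
    (h : B9.SectBStepPrinted dC c35 (fun j => geo9Y (f j))
      (fun j => (codingYx P G (f j) (C37Y G (f j) (fun s => Function.surjInv (hf j) s) (4 * ((d : ℝ) + 1) * Real.exp (3 * (((d : ℝ) + 1) / 2)))) (C38 j)).bg)
      (fun j => KSC₂ P G (f j) (parSymY (f j).toKIdx)
        (C37Y G (f j) (fun s => Function.surjInv (hf j) s) (4 * ((d : ℝ) + 1) * Real.exp (3 * (((d : ℝ) + 1) / 2)))) (C38 j))
      (fun j => pullK (codingYx P G (f j) (C37Y G (f j) (fun s => Function.surjInv (hf j) s) (4 * ((d : ℝ) + 1) * Real.exp (3 * (((d : ℝ) + 1) / 2))))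
        (C38 j)) (GA j))
      (fun j => pullS (codingYx P G (f j) (C37Y G (f j) (fun s => Function.surjInv (hf j) s) (4 * ((d : ℝ) + 1) * Real.exp (3 * (((d : ℝ) + 1) / 2))))
        (C38 j)) (Cinv j))
      (fun j => IsAnKY P G (f j) (parSymY (f j).toKIdx) b
        (C37Y G (f j) (fun s => Function.surjInv (hf j) s) (4 * ((d : ℝ) + 1) * Real.exp (3 * (((d : ℝ) + 1) / 2)))) (C38 j))) :
    B9.SectBStepPrinted dC c35 (fun j => geo9Y (f j)) (fun j => bg9YC 𝔸 G P (f j))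
      (fun j => kernelFamilyS (f j).toKIdx (bg9YC 𝔸 G P (f j)) (fun U => U) (GpY (f j).toKIdx (parSymY (f j).toKIdx)) (parSymY (f j).toKIdx)) GA Cinv
      (fun j => IsAnRecY P G (f j) (parSymY (f j).toKIdx) b
        (C37Y G (f j) (fun s => Function.surjInv (hf j) s) (4 * ((d : ℝ) + 1) * Real.exp (3 * (((d : ℝ) + 1) / 2)))) (((ℓ : ℝ) + 1) ^ 4)) :=
  sectBStepPrinted_on_of_KSC₂_C37Y_an P f G b (fun j s => Function.surjInv (hf j) s) C38 (fun j s => Function.surjInv_eq (hf j) s) hG1 hM₂ hrepr c35 dC GA Cinv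
    hGA hac h

end Chain

/-! ## §4 The record pin in NODE 00's vocabulary -/

section Pin

variable (G : Subgroup 𝔸ˣ) (x : MemberY d ℓ hd hL b₀ b₁ Mstar) (par : SiteParY 𝔸 x.toKIdx) {ι : Type} [Fintype ι] (b : Module.Basis ι ℝ 𝔸)
  (C37 : ℝ → CfgY 𝔸 x.toKIdx → AfldY 𝔸 x.toKIdx → Prop)

/-- **THE PIN READ BACK: `Δ′_a(e^{ηa}U)` IS A UNIT** for every code `a` of the class at `r·β`, whenever `IsAnRecY r … U β` — the two-sided inverse identities in
coordinates are those of `η⁻²Δ′_a` and `η²G′` as `ℂ`-linear maps (`conj b` and `restrictScalars` are injective and multiplicative).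
[cite: Balaban1985BackgroundPropagators, Thm 3.4 p.400, Thm 3.11 p.416 (Δ′ invertible), bookkeeping] -/
theorem isUnit_deltaPrimeAY_of_isAnRecY {r β' : ℝ} (K : B9.KernelFamily (geo9Y x) (bg9YC 𝔸 G P x)) {U : CfgY 𝔸 x.toKIdx}
    (h : IsAnRecY P G x par b C37 r K U β') {a : AfldY 𝔸 x.toKIdx} (ha : C37 (r * β') U a) :
    IsUnit (deltaPrimeAY x.toKIdx par (mulY x.toKIdx (fluct (kGeo x.toKIdx).eta a) U)) := by
  obtain ⟨h1, h2⟩ := h a ha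
  set W := mulY x.toKIdx (fluct (kGeo x.toKIdx).eta a) U with hW
  set η := (kGeo x.toKIdx).eta with hη
  have hη0 : η ≠ 0 := by rw [hη]; show |x.cf|⁻¹ ≠ 0; exact inv_ne_zero (abs_ne_zero.2 x.hcf)
  have hη2 : (η ^ 2 : ℝ) ≠ 0 := pow_ne_zero 2 hη0
  -- the letters at the coded product are the conjugates of the scaled operators at `W`
  have hΔ : ΔpC x.toKIdx par b (.prod U a) = conj b ((η ^ 2)⁻¹ • (deltaPrimeAY x.toKIdx par W).restrictScalars ℝ) := rfl
  have hG : GopC x.toKIdx par b (.prod U a) = conj b ((η ^ 2) • (GpY x.toKIdx par W).restrictScalars ℝ) := rfl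
  rw [hΔ, hG, ← B9Eq352DivFormLetters.conj_mul, smul_mul_smul_comm, inv_mul_cancel₀ hη2, one_smul] at h1
  rw [hΔ, hG, ← B9Eq352DivFormLetters.conj_mul, smul_mul_smul_comm, mul_inv_cancel₀ hη2, one_smul] at h2
  have hinj : Function.Injective (conj (S := SiteY x.toKIdx) b) := fun T₁ T₂ hT => (B9Eq352DivFormLetters.coordEquiv b).conj.injective hT
  have hone : conj (S := SiteY x.toKIdx) b (1 : Module.End ℝ (SiteY x.toKIdx → 𝔸)) = 1 := by
    show (B9Eq352DivFormLetters.coordEquiv b).conj LinearMap.id = LinearMap.id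
    exact LinearEquiv.conj_id _
  rw [← hone] at h1 h2
  have h1' := hinj h1
  have h2' := hinj h2
  -- restrict scalars: the identities hold for the ℂ-linear operators
  have hr : ∀ (A Bm : (SiteY x.toKIdx → 𝔸) →ₗ[ℂ] (SiteY x.toKIdx → 𝔸)), A.restrictScalars ℝ * Bm.restrictScalars ℝ = 1 → A * Bm = 1 := by
    intro A Bm hAB
    apply LinearMap.restrictScalars_injective ℝ
    rw [Module.End.mul_eq_comp, LinearMap.restrictScalars_comp] -- (A ∘ B).restrict = A.restrict ∘ B.restrict
    rw [Module.End.mul_eq_comp] at hAB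
    rw [hAB]
    rfl
  exact ⟨⟨deltaPrimeAY x.toKIdx par W, GpY x.toKIdx par W, hr _ _ h1', hr _ _ h2'⟩, rfl⟩

end Pin

end Literature.MathematicalPhysics.QuantumFieldTheory.Balaban1983to89.B9SectBCodedChainAnR

/-!
# `Balaban1983to89.B9SectBL2DictionaryYR` — THE CLASS-PARAMETRIC TWIN of `B9SectBL2DictionaryY` (CASCADE-R, director-ym №279 GO-R; №277 (3) `hunitA` cure; dag-n06-d SOCKET-(α) class question)

statement-level skeleton of published theorems with citation tags; proofs where landed; nothing here is a claim about the
Yang–Mills mass gap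

WHAT THIS FILE IS.  The original module `B9SectBL2DictionaryY` types its objects over MODULE 3's member carrier `bg9Y 𝔸 G x` (MODULE 2's small-cube class (3.35)).  This file RE-DECLARES, with UNCHANGED NAMES inside the namespace `…B9SectBL2DictionaryYR`, exactly its 21 class-dependent declarations over the CLASS-PARAMETRIC carrier `B9SectBCodedClassR.bg9YC 𝔸 G P x` (`P : RegExtraY …` = the two cube conditions of (3.35)∕(3.36) as a parameter; `bg9Y 𝔸 G x = bg9YC 𝔸 G (extraY 𝔸 G) x` by `rfl`, so every declaration here specialises definitionally to its original; at the record's reading of PRINT's class, `P := extraYPb 𝔸 G`, the displayed laws `hreg335P` ((3.35) on plaquettes) and the class-keyed `hunitA` become theorems).  The text is the original's VERBATIM under the token surgery `bg9Y 𝔸 G ↦ bg9YC 𝔸 G P`, `NAME ↦ NAME P` for the class-dependent names (P the first explicit argument), and — №277 — the binder `hunitA` re-keyed from «all G-valued U» to «all (3.35)-regular U of the carrier» (`∀ j α₀ U, (bg9YC 𝔸 G P (f j)).Reg335 c35 α₀ U → IsUnit (deltaAY …)`).  Class-free declarations of the original are NOT copied: they are imported and used BY NAME (`open … hiding` the re-declared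 ones).  Generated by dag-n06-c g16's `gen.py` (HOME `pub-ymgap-dag-n06-c/lean/g16/`); the ORIGINAL MODULE DOCUMENTATION FOLLOWS VERBATIM and describes the mathematics.

HONEST SCOPE.  Re-typing bookkeeping; nothing of [B9] asserted beyond the original; COUNT-NEUTRAL; N06 NOT discharged; nothing continuum ∕ OS ∕ mass gap ∕ Clay.  Cell `pub-ymgap` (D-0062), Track A node N06 [B9], seat `pub-ymgap-dag-n06-c` g16, 2026-08-29.
-/

/-! Module documentation: that of the original `Balaban1983to89.B9SectBL2DictionaryY` applies verbatim to this twin (not repeated here). -/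

noncomputable section

namespace Literature.MathematicalPhysics.QuantumFieldTheory.Balaban1983to89.B9SectBL2DictionaryYR

open Literature.MathematicalPhysics.QuantumFieldTheory.Balaban1983to89.B9SectBCodedClassR (RegExtraY bg9YC)
open Literature.MathematicalPhysics.QuantumFieldTheory.Balaban1983to89.B9SectBL2DictionaryY hiding KSC₃ KSC₃_members KSC₃_l2 eBlock_KSC₃_iff globBlock_KSC₃_prod read342Y_KSC₃ write342Y_KSC₃ readL2_KSC₃ readL2_two_KSC₃ readL2_three_KSC₃ readL2_four_KSC₃ readL2_five_KSC₃ writeL2_KSC₃ writeL2_zero_KSC₃ writeL2_one_KSC₃ writeL2_two_KSC₃ writeL2_three_KSC₃ writeL2_four_KSC₃ writeL2_five_KSC₃ l2Frame₂CodedOn globFrame₂CodedOn₃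

open Literature.MathematicalPhysics.QuantumFieldTheory.Balaban1983to89
open Literature.MathematicalPhysics.QuantumFieldTheory.Balaban1983to89.B6KLevelCensusIndexV1 (KIdx kGeo)
open Literature.MathematicalPhysics.QuantumFieldTheory.Balaban1983to89.B6Ineq2142KLevelV1 (β)
open Literature.MathematicalPhysics.QuantumFieldTheory.Balaban1983to89.B6RandomWalk (blockPiece)
open Literature.MathematicalPhysics.QuantumFieldTheory.Balaban1983to89.B6RandomWalkL2 (l2n l2n_nonneg l2n_sq l2n_add_le l2n_sum_le l2n_smul l2n_mono HasL2Majorant)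
open Literature.MathematicalPhysics.QuantumFieldTheory.Balaban1983to89.B9Thm34Ext (toB6)
open Literature.MathematicalPhysics.QuantumFieldTheory.Balaban1983to89.B9FromB6 (EBlock L2Block GlobBlock pref6_nonneg)
open Literature.MathematicalPhysics.QuantumFieldTheory.Balaban1983to89.B9Eq39Adjoint (fluct)
open Literature.MathematicalPhysics.QuantumFieldTheory.Balaban1983to89.B9Eq352DivFormLetters (conj conj_apply conj_mul coordEquiv coordEquiv_apply
  coordEquiv_symm_apply)
open Literature.MathematicalPhysics.QuantumFieldTheory.Balaban1983to89.B9Eq352GradLetters (diffLetter)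
open Literature.MathematicalPhysics.QuantumFieldTheory.Balaban1983to89.B9SectBCodedCarrier (CCfg)
open Literature.MathematicalPhysics.QuantumFieldTheory.Balaban1983to89.B9Eq360DeltaPrimeAY (AfldY mulY blkY blkY_apply)
open Literature.MathematicalPhysics.QuantumFieldTheory.Balaban1983to89.B9PinMembersKLevelV1 (MemberY geo9Y bg9Y)
open Literature.MathematicalPhysics.QuantumFieldTheory.Balaban1983to89.B9SectBGpLettersY (decY GVal coordC blkC GopC letters_base_of_gVal)
open Literature.MathematicalPhysics.QuantumFieldTheory.Balaban1983to89.B9SectBGpFrameCodedYR (codingYx Read342Y Write342Y)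
open Literature.MathematicalPhysics.QuantumFieldTheory.Balaban1983to89.B9SectBGpFrameCodedY (CplxLettersY)
open Literature.MathematicalPhysics.QuantumFieldTheory.Balaban1983to89.B9SectBGpReadingsYR (KSC read342Y_KSC write342Y_KSC)
open Literature.MathematicalPhysics.QuantumFieldTheory.Balaban1983to89.B9SectBGpReadingsY (baseY exists_ball_bound suppIn_inl_of_blkC etaS_eq_eta coordEquiv_symm_eq_sum_liftY liftY_eq_liftY_unit real_smul_fun len_label dist_label off_of_suppIn_inl)
open Literature.MathematicalPhysics.QuantumFieldTheory.Balaban1983to89.B9SectBL2ReadingsY (indY indY_nonneg_le_one supF_indY_le_one cutIn_indY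
  l2OfY_eq_l2n l2OfY_smul l2OfY_sum_le l2Norm_col_le l2n_blockPiece_conj_le)
open Literature.MathematicalPhysics.QuantumFieldTheory.Balaban1983to89.B9Thm314WholeExpansionReads (le_iSup_ball le_iSup_ball_iSup)
open Literature.MathematicalPhysics.QuantumFieldTheory.Balaban1983to89.B9GeoLemma21KLevelV1 (geo9Y_len_pos geo9K_eta_pos)
open Literature.MathematicalPhysics.QuantumFieldTheory.Balaban1983to89.Node00 (SiteY BlkY IBondY CfgY BallY SiteOpY SiteParY UboxY shiftY cdS cdsS
  liftY liftY_apply l2OfY etaS kernelFamilyS GpY cdS_add cdS_smul cdsS_add cdsS_smul ballY_nonempty)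

variable {𝔸 : Type} [NormedRing 𝔸] [NormedAlgebra ℂ 𝔸] [CompleteSpace 𝔸] [FiniteDimensional ℝ 𝔸]
variable {d ℓ : ℕ} {hd : 1 ≤ d + 1} {hL : Odd (ℓ + 1) ∧ 1 < ℓ + 1} {b₀ b₁ : ℝ} {Mstar : ℕ} (P : RegExtraY d ℓ hd hL b₀ b₁ Mstar 𝔸)

/-! ## §0 ★ The generic `ℓ²` conj-`b` dictionary -/

section Dictionary

variable (x : MemberY d ℓ hd hL b₀ b₁ Mstar) (ιB : BlkY x.toKIdx → IBondY x.toKIdx) {ι : Type} [Fintype ι] (b : Module.Basis ι ℝ 𝔸)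
  [Fintype (geo9Y x).Site] [DecidableEq (geo9Y x).Site]

end Dictionary

/-! ### `ℓ²` reading helpers on any finite carrier -/

section L2Helpers

end L2Helpers

/-! ## §1 The six `L²` words: the `𝔸`-side words `wordSL` (all sign combinations) and the frame-side composites `wordL` -/

section Words

variable (i : KIdx d ℓ hd hL b₀ b₁)

end Words

/-! ## §2 The augmented `L²` reading `l2AugS` and ★★ its two-way dictionary -/

section Aug

variable (i : KIdx d ℓ hd hL b₀ b₁)

end Aug

section AugDictionary

variable (x : MemberY d ℓ hd hL b₀ b₁ Mstar) (ιB : BlkY x.toKIdx → IBondY x.toKIdx) {ι : Type} [Fintype ι] (b : Module.Basis ι ℝ 𝔸)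
  [Fintype (geo9Y x).Site] [DecidableEq (geo9Y x).Site]

end AugDictionary

/-! ## §3 `KSC₃` — the coded readings of record with the augmented `L²` member — and ★★ the eleven `L²` fields of the frames PROVED for it -/

section KSC3

variable (G : Subgroup 𝔸ˣ) (x : MemberY d ℓ hd hL b₀ b₁ Mstar) (par : SiteParY 𝔸 x.toKIdx)
  (C37 C38 : ℝ → CfgY 𝔸 x.toKIdx → AfldY 𝔸 x.toKIdx → Prop)

/-- ★ **THE CODED READINGS OF RECORD WITH THE AUGMENTED `L²` MEMBER**: `KSC₂` (gen 8: `KSC` with the (3.47) member silent at products) with the (3.46)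
member replaced by `l2AugS` (all sign combinations, letters at the base, operator NODE 00's `G′ = GpY par` at the decoding).
[cite: Balaban1985BackgroundPropagators, Thm 3.1 (3.42)–(3.47) pp.397–398, Thm 3.4 p.400, p.403 l.1–9] -/
def KSC₃ : B9.KernelFamily (geo9Y x) (codingYx P G x C37 C38).bg :=
  { B9SectBCodedChainGlobR.KSC₂ P G x par C37 C38 with
    l2 := l2AugS x.toKIdx (B := (codingYx P G x C37 C38).bg) (fun c => c) (GpY x.toKIdx par) }

omit [FiniteDimensional ℝ 𝔸] in
/-- the (3.42)–(3.45) members of `KSC₃` are `KSC`'s, the (3.47) member is `KSC₂`'s. [cite: Balaban1985BackgroundPropagators, (3.42)–(3.47) pp.397–398, bookkeeping] -/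
theorem KSC₃_members :
    (KSC₃ P G x par C37 C38).e = (KSC P G x par C37 C38).e ∧ (KSC₃ P G x par C37 C38).h1 = (KSC P G x par C37 C38).h1 ∧
    (KSC₃ P G x par C37 C38).e4 = (KSC P G x par C37 C38).e4 ∧ (KSC₃ P G x par C37 C38).h2 = (KSC P G x par C37 C38).h2 ∧
    (KSC₃ P G x par C37 C38).glob = (B9SectBCodedChainGlobR.KSC₂ P G x par C37 C38).glob := ⟨rfl, rfl, rfl, rfl, rfl⟩

omit [FiniteDimensional ℝ 𝔸] in
/-- the `L²` member of `KSC₃` is the augmented reading of `G′ = GpY par` over the coded configurations. [cite: Balaban1985BackgroundPropagators, (3.46) p.398, bookkeeping] -/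
theorem KSC₃_l2 : (KSC₃ P G x par C37 C38).l2 = l2AugS x.toKIdx (B := (codingYx P G x C37 C38).bg) (fun c => c) (GpY x.toKIdx par) := rfl

omit [FiniteDimensional ℝ 𝔸] in
/-- at a base the (3.42)–(3.45) and (3.47) blocks of `KSC₃` are `KSC`'s: the `EBlock` of `KSC₃` IS the `EBlock` of `KSC`. [cite: Balaban1985BackgroundPropagators, (3.42) p.397, bookkeeping] -/
theorem eBlock_KSC₃_iff (B₀ δ : ℝ) (c : (codingYx P G x C37 C38).bg.Cfg) : EBlock (KSC₃ P G x par C37 C38) B₀ δ c ↔ EBlock (KSC P G x par C37 C38) B₀ δ c := Iff.rfl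

omit [FiniteDimensional ℝ 𝔸] in
/-- the silent global member of `KSC₃` at a product satisfies every (3.47) block with a nonnegative constant (as `KSC₂`'s).
[cite: Balaban1985BackgroundPropagators, (3.47) p.398, bookkeeping] -/
theorem globBlock_KSC₃_prod (U : CfgY 𝔸 x.toKIdx) (a : AfldY 𝔸 x.toKIdx) {B : ℝ} (hB : 0 ≤ B) : GlobBlock (KSC₃ P G x par C37 C38) B (.prod U a) :=
  fun n lam γ _ _ => by
    show (0 : ℝ) ≤ B * (geo9Y x).wNorm γ lam
    exact mul_nonneg hB (B9GeoNormsKLevelV1.geo9K_wNorm_nonneg x.toKIdx γ lam)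

variable {ι : Type} [Fintype ι] (b : Module.Basis ι ℝ 𝔸) (ιB : BlkY x.toKIdx → IBondY x.toKIdx) [Fintype (geo9Y x).Site]

/-- the root frame's (3.42) reading dictionary for `KSC₃` (same (3.42) member as `KSC`). [cite: Balaban1985BackgroundPropagators, (3.42) p.397; Balaban1984PropagatorsII, (2.51) p.232] -/
theorem read342Y_KSC₃ (hι : ∀ s : BlkY x.toKIdx, β x.toKIdx.hN x.toKIdx.D x.toKIdx.hk (ιB s) = s)
    (M₂ : ℝ) (hM₂ : 0 ≤ M₂) (hrepr : ∀ (v : 𝔸) (j : ι), |b.repr v j| ≤ M₂ * ‖v‖) (c35 MInv aInv : ℝ) :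
    Read342Y P G x par b ιB C37 C38 (KSC₃ P G x par C37 C38) c35 (M₂ * ∑ j, ‖b j‖) MInv aInv 0 True :=
  read342Y_KSC P G x par b ιB C37 C38 hι M₂ hM₂ hrepr c35 MInv aInv

omit [FiniteDimensional ℝ 𝔸] in
/-- the root frame's (3.42) writing dictionary for `KSC₃`. [cite: Balaban1985BackgroundPropagators, (3.42) p.397, p.403; Balaban1984PropagatorsII, (2.51) p.232] -/
theorem write342Y_KSC₃ (hι : ∀ s : BlkY x.toKIdx, β x.toKIdx.hN x.toKIdx.D x.toKIdx.hk (ιB s) = s)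
    (M₂ : ℝ) (hM₂ : 0 ≤ M₂) (hrepr : ∀ (v : 𝔸) (j : ι), |b.repr v j| ≤ M₂ * ‖v‖) (aW : ℝ) (hC37 : ∀ β' U a, C37 β' U a → GVal G x.toKIdx U) :
    Write342Y P G x par b ιB C37 C38 (KSC₃ P G x par C37 C38) (fun B _ => (M₂ * ∑ j, ‖b j‖) * B + 1) (fun δ => δ) aW 0 True :=
  write342Y_KSC P G x par b ιB C37 C38 hι M₂ hM₂ hrepr aW hC37

variable [DecidableEq (geo9Y x).Site]

/-- ★★ **FIELD `L2Frame₂.readL2` AT `KSC₃`** (members 0 and 1): at a `G`-valued base `U`, the (3.46) block of `KSC₃` with `(B₀, δ)` gives the block-`ℓ²`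
majorants of `Gop = GopC (base U)` (`c_L·B₀·ℓ(a)²·e^{−δd}`) and of every `conj b (∇♯_k-letter) * Gop` (`c_L·B₀·ℓ(a)·e^{−δd}`).
[cite: Balaban1985BackgroundPropagators, Thm 3.1 (3.46) p.398; Balaban1984PropagatorsII, Prop. 2.6 (2.140) p.247, (2.51) p.232] -/
theorem readL2_KSC₃ (hι : ∀ s : BlkY x.toKIdx, β x.toKIdx.hN x.toKIdx.D x.toKIdx.hk (ιB s) = s)
    {M₂ : ℝ} (hM₂ : 0 ≤ M₂) (hrepr : ∀ (v : 𝔸) (j : ι), |b.repr v j| ≤ M₂ * ‖v‖) {U : CfgY 𝔸 x.toKIdx} (hU : GVal G x.toKIdx U)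
    {B₀ δ : ℝ} (hB₀ : 0 ≤ B₀) (hL2 : L2Block (KSC₃ P G x par C37 C38) B₀ δ (.base U)) :
    HasL2Majorant (g := toB6 (geo9Y x) 0 True) (fun p : SiteY x.toKIdx × ι => blkC x.toKIdx ιB p.1) (GopC x.toKIdx par b (.base U))
        (fun a a' => (Real.sqrt (Fintype.card ι) * M₂ * ∑ j, ‖b j‖) * B₀ * (geo9Y x).len a ^ 2 * Real.exp (-(δ * (geo9Y x).dist a a'))) ∧
      ∀ k : Fin (d + 1) ⊕ Fin (d + 1), HasL2Majorant (g := toB6 (geo9Y x) 0 True) (fun p : SiteY x.toKIdx × ι => blkC x.toKIdx ιB p.1)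
        (conj b (diffLetter (shiftY x.toKIdx) (coordC G x.toKIdx (.base U)) ((((geo9Y x).eta : ℂ))⁻¹) k) * GopC x.toKIdx par b (.base U))
        (fun a a' => (Real.sqrt (Fintype.card ι) * M₂ * ∑ j, ‖b j‖) * B₀ * (geo9Y x).len a * Real.exp (-(δ * (geo9Y x).dist a a'))) := by
  have h := fun n => hasL2Majorant_wordL_of_l2AugS x ιB b hι hM₂ hrepr 0 True (B := (codingYx P G x C37 C38).bg) (fun c => c) (GpY x.toKIdx par) hB₀
    (c := .base U) n (fun lam hh y y' hc hs => hL2 n lam hh y y' hc hs)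
  rw [coordC_base_eq G x hU]
  refine ⟨B6RandomWalkL2.hasL2Majorant_mono _ (h 0 (Sum.inl 0) (Sum.inl 0)) fun a a' => le_of_eq rfl, fun k => ?_⟩
  rw [show GopC x.toKIdx par b (.base U) = conj b (((kGeo x.toKIdx).eta ^ 2) • (GpY x.toKIdx par U).restrictScalars ℝ) from rfl, ← B9Eq352DivFormLetters.conj_mul]
  exact B6RandomWalkL2.hasL2Majorant_mono _ (h 1 k k) fun a a' => le_of_eq rfl

/-- ★★ **FIELD `SectBFrame₄.readL2_2` AT `KSC₃`**: `Gop * conj b (∇♯_k-letter) ≺₂ c_L·B₀·ℓ(a)·e^{−δd}`. [cite: Balaban1985BackgroundPropagators, Thm 3.1 (3.46) p.398, p.398 (first remark); Balaban1984PropagatorsII, (2.140) p.247] -/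
theorem readL2_two_KSC₃ (hι : ∀ s : BlkY x.toKIdx, β x.toKIdx.hN x.toKIdx.D x.toKIdx.hk (ιB s) = s)
    {M₂ : ℝ} (hM₂ : 0 ≤ M₂) (hrepr : ∀ (v : 𝔸) (j : ι), |b.repr v j| ≤ M₂ * ‖v‖) {U : CfgY 𝔸 x.toKIdx} (hU : GVal G x.toKIdx U)
    {B₀ δ : ℝ} (hB₀ : 0 ≤ B₀) (hL2 : L2Block (KSC₃ P G x par C37 C38) B₀ δ (.base U)) (k : Fin (d + 1) ⊕ Fin (d + 1)) :
    HasL2Majorant (g := toB6 (geo9Y x) 0 True) (fun p : SiteY x.toKIdx × ι => blkC x.toKIdx ιB p.1)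
      (GopC x.toKIdx par b (.base U) * conj b (diffLetter (shiftY x.toKIdx) (coordC G x.toKIdx (.base U)) ((((geo9Y x).eta : ℂ))⁻¹) k))
      (fun a a' => (Real.sqrt (Fintype.card ι) * M₂ * ∑ j, ‖b j‖) * B₀ * (geo9Y x).len a * Real.exp (-(δ * (geo9Y x).dist a a'))) := by
  have h := hasL2Majorant_wordL_of_l2AugS x ιB b hι hM₂ hrepr 0 True (B := (codingYx P G x C37 C38).bg) (fun c => c) (GpY x.toKIdx par) hB₀
    (c := .base U) 2 (fun lam hh y y' hc hs => hL2 2 lam hh y y' hc hs) k k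
  rw [coordC_base_eq G x hU, show GopC x.toKIdx par b (.base U) = conj b (((kGeo x.toKIdx).eta ^ 2) • (GpY x.toKIdx par U).restrictScalars ℝ) from rfl,
    ← B9Eq352DivFormLetters.conj_mul]
  exact B6RandomWalkL2.hasL2Majorant_mono _ h fun a a' => le_of_eq rfl

/-- ★★ **FIELD `SectBFrame₄.readL2_3` AT `KSC₃`**: `conj b (∇♯_k) * conj b (∇♯_l) * Gop ≺₂ c_L·B₀·1·e^{−δd}`. [cite: Balaban1985BackgroundPropagators, Thm 3.1 (3.46) p.398, p.398 (first remark); Balaban1984PropagatorsII, (2.140) p.247] -/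
theorem readL2_three_KSC₃ (hι : ∀ s : BlkY x.toKIdx, β x.toKIdx.hN x.toKIdx.D x.toKIdx.hk (ιB s) = s)
    {M₂ : ℝ} (hM₂ : 0 ≤ M₂) (hrepr : ∀ (v : 𝔸) (j : ι), |b.repr v j| ≤ M₂ * ‖v‖) {U : CfgY 𝔸 x.toKIdx} (hU : GVal G x.toKIdx U)
    {B₀ δ : ℝ} (hB₀ : 0 ≤ B₀) (hL2 : L2Block (KSC₃ P G x par C37 C38) B₀ δ (.base U)) (k l : Fin (d + 1) ⊕ Fin (d + 1)) :
    HasL2Majorant (g := toB6 (geo9Y x) 0 True) (fun p : SiteY x.toKIdx × ι => blkC x.toKIdx ιB p.1)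
      (conj b (diffLetter (shiftY x.toKIdx) (coordC G x.toKIdx (.base U)) ((((geo9Y x).eta : ℂ))⁻¹) k) *
        conj b (diffLetter (shiftY x.toKIdx) (coordC G x.toKIdx (.base U)) ((((geo9Y x).eta : ℂ))⁻¹) l) * GopC x.toKIdx par b (.base U))
      (fun a a' => (Real.sqrt (Fintype.card ι) * M₂ * ∑ j, ‖b j‖) * B₀ * 1 * Real.exp (-(δ * (geo9Y x).dist a a'))) := by
  have h := hasL2Majorant_wordL_of_l2AugS x ιB b hι hM₂ hrepr 0 True (B := (codingYx P G x C37 C38).bg) (fun c => c) (GpY x.toKIdx par) hB₀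
    (c := .base U) 3 (fun lam hh y y' hc hs => hL2 3 lam hh y y' hc hs) k l
  rw [coordC_base_eq G x hU, show GopC x.toKIdx par b (.base U) = conj b (((kGeo x.toKIdx).eta ^ 2) • (GpY x.toKIdx par U).restrictScalars ℝ) from rfl,
    ← B9Eq352DivFormLetters.conj_mul, ← B9Eq352DivFormLetters.conj_mul]
  exact B6RandomWalkL2.hasL2Majorant_mono _ h fun a a' => le_of_eq rfl

/-- ★★ **FIELD `SectBFrame₄.readL2_4` AT `KSC₃`** (the mixed member): `conj b (∇♯_k) * Gop * conj b (∇♯_l) ≺₂ c_L·B₀·1·e^{−δd}`. [cite: Balaban1985BackgroundPropagators, Thm 3.1 (3.46) p.398, p.398 (first remark); Balaban1984PropagatorsII, (2.140) p.247] -/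
theorem readL2_four_KSC₃ (hι : ∀ s : BlkY x.toKIdx, β x.toKIdx.hN x.toKIdx.D x.toKIdx.hk (ιB s) = s)
    {M₂ : ℝ} (hM₂ : 0 ≤ M₂) (hrepr : ∀ (v : 𝔸) (j : ι), |b.repr v j| ≤ M₂ * ‖v‖) {U : CfgY 𝔸 x.toKIdx} (hU : GVal G x.toKIdx U)
    {B₀ δ : ℝ} (hB₀ : 0 ≤ B₀) (hL2 : L2Block (KSC₃ P G x par C37 C38) B₀ δ (.base U)) (k l : Fin (d + 1) ⊕ Fin (d + 1)) :
    HasL2Majorant (g := toB6 (geo9Y x) 0 True) (fun p : SiteY x.toKIdx × ι => blkC x.toKIdx ιB p.1)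
      (conj b (diffLetter (shiftY x.toKIdx) (coordC G x.toKIdx (.base U)) ((((geo9Y x).eta : ℂ))⁻¹) k) * GopC x.toKIdx par b (.base U) *
        conj b (diffLetter (shiftY x.toKIdx) (coordC G x.toKIdx (.base U)) ((((geo9Y x).eta : ℂ))⁻¹) l))
      (fun a a' => (Real.sqrt (Fintype.card ι) * M₂ * ∑ j, ‖b j‖) * B₀ * 1 * Real.exp (-(δ * (geo9Y x).dist a a'))) := by
  have h := hasL2Majorant_wordL_of_l2AugS x ιB b hι hM₂ hrepr 0 True (B := (codingYx P G x C37 C38).bg) (fun c => c) (GpY x.toKIdx par) hB₀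
    (c := .base U) 4 (fun lam hh y y' hc hs => hL2 4 lam hh y y' hc hs) k l
  rw [coordC_base_eq G x hU, show GopC x.toKIdx par b (.base U) = conj b (((kGeo x.toKIdx).eta ^ 2) • (GpY x.toKIdx par U).restrictScalars ℝ) from rfl,
    ← B9Eq352DivFormLetters.conj_mul, ← B9Eq352DivFormLetters.conj_mul]
  exact B6RandomWalkL2.hasL2Majorant_mono _ h fun a a' => le_of_eq rfl

/-- ★★ **FIELD `SectBFrame₄.readL2_5` AT `KSC₃`**: `Gop * conj b (∇♯_k) * conj b (∇♯_l) ≺₂ c_L·B₀·1·e^{−δd}`. [cite: Balaban1985BackgroundPropagators, Thm 3.1 (3.46) p.398, p.398 (first remark); Balaban1984PropagatorsII, (2.140) p.247] -/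
theorem readL2_five_KSC₃ (hι : ∀ s : BlkY x.toKIdx, β x.toKIdx.hN x.toKIdx.D x.toKIdx.hk (ιB s) = s)
    {M₂ : ℝ} (hM₂ : 0 ≤ M₂) (hrepr : ∀ (v : 𝔸) (j : ι), |b.repr v j| ≤ M₂ * ‖v‖) {U : CfgY 𝔸 x.toKIdx} (hU : GVal G x.toKIdx U)
    {B₀ δ : ℝ} (hB₀ : 0 ≤ B₀) (hL2 : L2Block (KSC₃ P G x par C37 C38) B₀ δ (.base U)) (k l : Fin (d + 1) ⊕ Fin (d + 1)) :
    HasL2Majorant (g := toB6 (geo9Y x) 0 True) (fun p : SiteY x.toKIdx × ι => blkC x.toKIdx ιB p.1)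
      (GopC x.toKIdx par b (.base U) * conj b (diffLetter (shiftY x.toKIdx) (coordC G x.toKIdx (.base U)) ((((geo9Y x).eta : ℂ))⁻¹) k) *
        conj b (diffLetter (shiftY x.toKIdx) (coordC G x.toKIdx (.base U)) ((((geo9Y x).eta : ℂ))⁻¹) l))
      (fun a a' => (Real.sqrt (Fintype.card ι) * M₂ * ∑ j, ‖b j‖) * B₀ * 1 * Real.exp (-(δ * (geo9Y x).dist a a'))) := by
  have h := hasL2Majorant_wordL_of_l2AugS x ιB b hι hM₂ hrepr 0 True (B := (codingYx P G x C37 C38).bg) (fun c => c) (GpY x.toKIdx par) hB₀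
    (c := .base U) 5 (fun lam hh y y' hc hs => hL2 5 lam hh y y' hc hs) k l
  rw [coordC_base_eq G x hU, show GopC x.toKIdx par b (.base U) = conj b (((kGeo x.toKIdx).eta ^ 2) • (GpY x.toKIdx par U).restrictScalars ℝ) from rfl,
    ← B9Eq352DivFormLetters.conj_mul, ← B9Eq352DivFormLetters.conj_mul]
  exact B6RandomWalkL2.hasL2Majorant_mono _ h fun a a' => le_of_eq rfl

omit [FiniteDimensional ℝ 𝔸] in
/-- ★★ **FIELDS `writeL2_0 … writeL2_5` AT `KSC₃`, ALL SIX AT ONCE**: at a coded product `prod U a` over a `G`-valued base `U`, block-`ℓ²` majorants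
`B·pref6_n(ℓ(a))·e^{−δd}` (`B ≧ 0`) of all the composites `conj b (wordL_n(k,l))` — letters at the base `U`, operator `G′(e^{ηa}U)` — give member `n` of `KSC₃` at
the product with `((c_L·B + 1), δ)`. [cite: Balaban1985BackgroundPropagators, Thm 3.1 (3.46) p.398, Thm 3.4 p.400, p.403 («of course with different constants»); Balaban1984PropagatorsII, Prop. 2.6 (2.140) p.247] -/
theorem writeL2_KSC₃ (hι : ∀ s : BlkY x.toKIdx, β x.toKIdx.hN x.toKIdx.D x.toKIdx.hk (ιB s) = s)
    {M₂ : ℝ} (hM₂ : 0 ≤ M₂) (hrepr : ∀ (v : 𝔸) (j : ι), |b.repr v j| ≤ M₂ * ‖v‖) (U : CfgY 𝔸 x.toKIdx) (a : AfldY 𝔸 x.toKIdx)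
    {B δ : ℝ} (hB : 0 ≤ B) (n : Fin 6)
    (hW : ∀ k l : Fin (d + 1) ⊕ Fin (d + 1), HasL2Majorant (g := toB6 (geo9Y x) 0 True) (fun p : SiteY x.toKIdx × ι => blkC x.toKIdx ιB p.1)
      (conj b (wordL x.toKIdx (GpY x.toKIdx par) U (mulY x.toKIdx (fluct (kGeo x.toKIdx).eta a) U) (kGeo x.toKIdx).eta n k l))
      (fun a a' => B * B9.pref6 ((geo9Y x).len a) n * Real.exp (-(δ * (geo9Y x).dist a a'))))
    (lam : (geo9Y x).Loc) (h : (geo9Y x).Cut) (y y' : IBondY x.toKIdx) (hcut : (geo9Y x).cutIn h y) (hsupp : (geo9Y x).suppIn lam y') :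
    (KSC₃ P G x par C37 C38).l2 n (.prod U a) lam h ≤ ((Real.sqrt (Fintype.card ι) * M₂ * ∑ j, ‖b j‖) * B + 1) * B9.pref6 ((geo9Y x).len y) n *
      (geo9Y x).cutSup h * Real.exp (-(δ * (geo9Y x).dist y y')) * (geo9Y x).l2Norm lam := by
  have hmain := l2AugS_le_of_hasL2Majorant_wordL x ιB b hι hM₂ hrepr 0 True (B := (codingYx P G x C37 C38).bg) (fun c => c) (GpY x.toKIdx par) hB
    (c := .prod U a) n hW lam h y y' hcut hsupp
  exact member_bound_weaken (by linarith) (pref6_nonneg (geo9Y_len_pos x y).le n) (B9GeoNormsKLevelV1.geo9K_cutSup_nonneg x.toKIdx h)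
    (Real.exp_pos _).le (B9GeoNormsKLevelV1.geo9K_l2Norm_nonneg x.toKIdx lam) hmain

omit [FiniteDimensional ℝ 𝔸] in
/-- ★★ **FIELD `L2Frame₂.writeL2_0` AT `KSC₃`** in the frame's literal shape (majorant of `Gop (prod U a)`).
[cite: Balaban1985BackgroundPropagators, Thm 3.1 (3.46) p.398, Thm 3.4 p.400, p.403 l.1–9; Balaban1984PropagatorsII, (2.140) p.247] -/
theorem writeL2_zero_KSC₃ (hι : ∀ s : BlkY x.toKIdx, β x.toKIdx.hN x.toKIdx.D x.toKIdx.hk (ιB s) = s)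
    {M₂ : ℝ} (hM₂ : 0 ≤ M₂) (hrepr : ∀ (v : 𝔸) (j : ι), |b.repr v j| ≤ M₂ * ‖v‖) (U : CfgY 𝔸 x.toKIdx) (a : AfldY 𝔸 x.toKIdx) {B δ : ℝ} (hB : 0 ≤ B)
    (hG : HasL2Majorant (g := toB6 (geo9Y x) 0 True) (fun p : SiteY x.toKIdx × ι => blkC x.toKIdx ιB p.1) (GopC x.toKIdx par b (.prod U a))
      (fun a a' => B * (geo9Y x).len a ^ 2 * Real.exp (-(δ * (geo9Y x).dist a a'))))
    (lam : (geo9Y x).Loc) (h : (geo9Y x).Cut) (y y' : IBondY x.toKIdx) (hcut : (geo9Y x).cutIn h y) (hsupp : (geo9Y x).suppIn lam y') :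
    (KSC₃ P G x par C37 C38).l2 0 (.prod U a) lam h ≤ ((Real.sqrt (Fintype.card ι) * M₂ * ∑ j, ‖b j‖) * B + 1) * B9.pref6 ((geo9Y x).len y) 0 *
      (geo9Y x).cutSup h * Real.exp (-(δ * (geo9Y x).dist y y')) * (geo9Y x).l2Norm lam :=
  writeL2_KSC₃ P G x par C37 C38 b ιB hι hM₂ hrepr U a hB 0 (fun _ _ => B6RandomWalkL2.hasL2Majorant_mono _ hG fun _ _ => le_of_eq rfl) lam h y y' hcut hsupp

omit [FiniteDimensional ℝ 𝔸] in
/-- ★★ **FIELD `L2Frame₂.writeL2_1` AT `KSC₃`** (majorants of every `conj b (∇♯_k at the base) * Gop (prod U a)`).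
[cite: Balaban1985BackgroundPropagators, Thm 3.1 (3.46) p.398, Thm 3.4 p.400, p.403 l.1–9; Balaban1984PropagatorsII, (2.140) p.247] -/
theorem writeL2_one_KSC₃ (hι : ∀ s : BlkY x.toKIdx, β x.toKIdx.hN x.toKIdx.D x.toKIdx.hk (ιB s) = s)
    {M₂ : ℝ} (hM₂ : 0 ≤ M₂) (hrepr : ∀ (v : 𝔸) (j : ι), |b.repr v j| ≤ M₂ * ‖v‖) {U : CfgY 𝔸 x.toKIdx} (hU : GVal G x.toKIdx U) (a : AfldY 𝔸 x.toKIdx)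
    {B δ : ℝ} (hB : 0 ≤ B)
    (hDG : ∀ k : Fin (d + 1) ⊕ Fin (d + 1), HasL2Majorant (g := toB6 (geo9Y x) 0 True) (fun p : SiteY x.toKIdx × ι => blkC x.toKIdx ιB p.1)
      (conj b (diffLetter (shiftY x.toKIdx) (coordC G x.toKIdx (.base U)) ((((geo9Y x).eta : ℂ))⁻¹) k) * GopC x.toKIdx par b (.prod U a))
      (fun a a' => B * (geo9Y x).len a * Real.exp (-(δ * (geo9Y x).dist a a'))))
    (lam : (geo9Y x).Loc) (h : (geo9Y x).Cut) (y y' : IBondY x.toKIdx) (hcut : (geo9Y x).cutIn h y) (hsupp : (geo9Y x).suppIn lam y') :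
    (KSC₃ P G x par C37 C38).l2 1 (.prod U a) lam h ≤ ((Real.sqrt (Fintype.card ι) * M₂ * ∑ j, ‖b j‖) * B + 1) * B9.pref6 ((geo9Y x).len y) 1 *
      (geo9Y x).cutSup h * Real.exp (-(δ * (geo9Y x).dist y y')) * (geo9Y x).l2Norm lam := by
  refine writeL2_KSC₃ P G x par C37 C38 b ιB hι hM₂ hrepr U a hB 1 (fun k _ => ?_) lam h y y' hcut hsupp
  have h := hDG k
  rw [coordC_base_eq G x hU, show GopC x.toKIdx par b (.prod U a) =
    conj b (((kGeo x.toKIdx).eta ^ 2) • (GpY x.toKIdx par (mulY x.toKIdx (fluct (kGeo x.toKIdx).eta a) U)).restrictScalars ℝ) from rfl, ← B9Eq352DivFormLetters.conj_mul] at h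
  exact B6RandomWalkL2.hasL2Majorant_mono _ h fun a a' => le_of_eq rfl

omit [FiniteDimensional ℝ 𝔸] in
/-- ★★ **FIELD `SectBFrame₄.writeL2_2` AT `KSC₃`** (majorants of every `Gop (prod U a) * conj b (∇♯_k at the base)`).
[cite: Balaban1985BackgroundPropagators, Thm 3.1 (3.46) p.398, Thm 3.4 p.400, p.403 l.1–9; Balaban1984PropagatorsII, (2.140) p.247] -/
theorem writeL2_two_KSC₃ (hι : ∀ s : BlkY x.toKIdx, β x.toKIdx.hN x.toKIdx.D x.toKIdx.hk (ιB s) = s)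
    {M₂ : ℝ} (hM₂ : 0 ≤ M₂) (hrepr : ∀ (v : 𝔸) (j : ι), |b.repr v j| ≤ M₂ * ‖v‖) {U : CfgY 𝔸 x.toKIdx} (hU : GVal G x.toKIdx U) (a : AfldY 𝔸 x.toKIdx)
    {B δ : ℝ} (hB : 0 ≤ B)
    (hGD : ∀ k : Fin (d + 1) ⊕ Fin (d + 1), HasL2Majorant (g := toB6 (geo9Y x) 0 True) (fun p : SiteY x.toKIdx × ι => blkC x.toKIdx ιB p.1)
      (GopC x.toKIdx par b (.prod U a) * conj b (diffLetter (shiftY x.toKIdx) (coordC G x.toKIdx (.base U)) ((((geo9Y x).eta : ℂ))⁻¹) k))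
      (fun a a' => B * (geo9Y x).len a * Real.exp (-(δ * (geo9Y x).dist a a'))))
    (lam : (geo9Y x).Loc) (h : (geo9Y x).Cut) (y y' : IBondY x.toKIdx) (hcut : (geo9Y x).cutIn h y) (hsupp : (geo9Y x).suppIn lam y') :
    (KSC₃ P G x par C37 C38).l2 2 (.prod U a) lam h ≤ ((Real.sqrt (Fintype.card ι) * M₂ * ∑ j, ‖b j‖) * B + 1) * B9.pref6 ((geo9Y x).len y) 2 *
      (geo9Y x).cutSup h * Real.exp (-(δ * (geo9Y x).dist y y')) * (geo9Y x).l2Norm lam := by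
  refine writeL2_KSC₃ P G x par C37 C38 b ιB hι hM₂ hrepr U a hB 2 (fun k _ => ?_) lam h y y' hcut hsupp
  have h := hGD k
  rw [coordC_base_eq G x hU, show GopC x.toKIdx par b (.prod U a) =
    conj b (((kGeo x.toKIdx).eta ^ 2) • (GpY x.toKIdx par (mulY x.toKIdx (fluct (kGeo x.toKIdx).eta a) U)).restrictScalars ℝ) from rfl, ← B9Eq352DivFormLetters.conj_mul] at h
  exact B6RandomWalkL2.hasL2Majorant_mono _ h fun a a' => le_of_eq rfl

omit [FiniteDimensional ℝ 𝔸] in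
/-- ★★ **FIELD `SectBFrame₄.writeL2_3` AT `KSC₃`** (majorants of every `conj b (∇♯_k) * conj b (∇♯_l) * Gop (prod U a)`).
[cite: Balaban1985BackgroundPropagators, Thm 3.1 (3.46) p.398, Thm 3.4 p.400, p.403 l.1–9; Balaban1984PropagatorsII, (2.140) p.247] -/
theorem writeL2_three_KSC₃ (hι : ∀ s : BlkY x.toKIdx, β x.toKIdx.hN x.toKIdx.D x.toKIdx.hk (ιB s) = s)
    {M₂ : ℝ} (hM₂ : 0 ≤ M₂) (hrepr : ∀ (v : 𝔸) (j : ι), |b.repr v j| ≤ M₂ * ‖v‖) {U : CfgY 𝔸 x.toKIdx} (hU : GVal G x.toKIdx U) (a : AfldY 𝔸 x.toKIdx)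
    {B δ : ℝ} (hB : 0 ≤ B)
    (hDDG : ∀ k l : Fin (d + 1) ⊕ Fin (d + 1), HasL2Majorant (g := toB6 (geo9Y x) 0 True) (fun p : SiteY x.toKIdx × ι => blkC x.toKIdx ιB p.1)
      (conj b (diffLetter (shiftY x.toKIdx) (coordC G x.toKIdx (.base U)) ((((geo9Y x).eta : ℂ))⁻¹) k) *
        conj b (diffLetter (shiftY x.toKIdx) (coordC G x.toKIdx (.base U)) ((((geo9Y x).eta : ℂ))⁻¹) l) * GopC x.toKIdx par b (.prod U a))
      (fun a a' => B * 1 * Real.exp (-(δ * (geo9Y x).dist a a'))))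
    (lam : (geo9Y x).Loc) (h : (geo9Y x).Cut) (y y' : IBondY x.toKIdx) (hcut : (geo9Y x).cutIn h y) (hsupp : (geo9Y x).suppIn lam y') :
    (KSC₃ P G x par C37 C38).l2 3 (.prod U a) lam h ≤ ((Real.sqrt (Fintype.card ι) * M₂ * ∑ j, ‖b j‖) * B + 1) * B9.pref6 ((geo9Y x).len y) 3 *
      (geo9Y x).cutSup h * Real.exp (-(δ * (geo9Y x).dist y y')) * (geo9Y x).l2Norm lam := by
  refine writeL2_KSC₃ P G x par C37 C38 b ιB hι hM₂ hrepr U a hB 3 (fun k l => ?_) lam h y y' hcut hsupp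
  have h := hDDG k l
  rw [coordC_base_eq G x hU, show GopC x.toKIdx par b (.prod U a) =
    conj b (((kGeo x.toKIdx).eta ^ 2) • (GpY x.toKIdx par (mulY x.toKIdx (fluct (kGeo x.toKIdx).eta a) U)).restrictScalars ℝ) from rfl,
    ← B9Eq352DivFormLetters.conj_mul, ← B9Eq352DivFormLetters.conj_mul] at h
  exact B6RandomWalkL2.hasL2Majorant_mono _ h fun a a' => le_of_eq rfl

omit [FiniteDimensional ℝ 𝔸] in
/-- ★★ **FIELD `SectBFrame₄.writeL2_4` AT `KSC₃`** (the mixed member: majorants of every `conj b (∇♯_k) * Gop (prod U a) * conj b (∇♯_l)`).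
[cite: Balaban1985BackgroundPropagators, Thm 3.1 (3.46) p.398, Thm 3.4 p.400, p.403 l.1–9; Balaban1984PropagatorsII, (2.140) p.247] -/
theorem writeL2_four_KSC₃ (hι : ∀ s : BlkY x.toKIdx, β x.toKIdx.hN x.toKIdx.D x.toKIdx.hk (ιB s) = s)
    {M₂ : ℝ} (hM₂ : 0 ≤ M₂) (hrepr : ∀ (v : 𝔸) (j : ι), |b.repr v j| ≤ M₂ * ‖v‖) {U : CfgY 𝔸 x.toKIdx} (hU : GVal G x.toKIdx U) (a : AfldY 𝔸 x.toKIdx)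
    {B δ : ℝ} (hB : 0 ≤ B)
    (hDGD : ∀ k l : Fin (d + 1) ⊕ Fin (d + 1), HasL2Majorant (g := toB6 (geo9Y x) 0 True) (fun p : SiteY x.toKIdx × ι => blkC x.toKIdx ιB p.1)
      (conj b (diffLetter (shiftY x.toKIdx) (coordC G x.toKIdx (.base U)) ((((geo9Y x).eta : ℂ))⁻¹) k) * GopC x.toKIdx par b (.prod U a) *
        conj b (diffLetter (shiftY x.toKIdx) (coordC G x.toKIdx (.base U)) ((((geo9Y x).eta : ℂ))⁻¹) l))
      (fun a a' => B * 1 * Real.exp (-(δ * (geo9Y x).dist a a'))))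
    (lam : (geo9Y x).Loc) (h : (geo9Y x).Cut) (y y' : IBondY x.toKIdx) (hcut : (geo9Y x).cutIn h y) (hsupp : (geo9Y x).suppIn lam y') :
    (KSC₃ P G x par C37 C38).l2 4 (.prod U a) lam h ≤ ((Real.sqrt (Fintype.card ι) * M₂ * ∑ j, ‖b j‖) * B + 1) * B9.pref6 ((geo9Y x).len y) 4 *
      (geo9Y x).cutSup h * Real.exp (-(δ * (geo9Y x).dist y y')) * (geo9Y x).l2Norm lam := by
  refine writeL2_KSC₃ P G x par C37 C38 b ιB hι hM₂ hrepr U a hB 4 (fun k l => ?_) lam h y y' hcut hsupp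
  have h := hDGD k l
  rw [coordC_base_eq G x hU, show GopC x.toKIdx par b (.prod U a) =
    conj b (((kGeo x.toKIdx).eta ^ 2) • (GpY x.toKIdx par (mulY x.toKIdx (fluct (kGeo x.toKIdx).eta a) U)).restrictScalars ℝ) from rfl,
    ← B9Eq352DivFormLetters.conj_mul, ← B9Eq352DivFormLetters.conj_mul] at h
  exact B6RandomWalkL2.hasL2Majorant_mono _ h fun a a' => le_of_eq rfl

omit [FiniteDimensional ℝ 𝔸] in
/-- ★★ **FIELD `SectBFrame₄.writeL2_5` AT `KSC₃`** (majorants of every `Gop (prod U a) * conj b (∇♯_k) * conj b (∇♯_l)`).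
[cite: Balaban1985BackgroundPropagators, Thm 3.1 (3.46) p.398, Thm 3.4 p.400, p.403 l.1–9; Balaban1984PropagatorsII, (2.140) p.247] -/
theorem writeL2_five_KSC₃ (hι : ∀ s : BlkY x.toKIdx, β x.toKIdx.hN x.toKIdx.D x.toKIdx.hk (ιB s) = s)
    {M₂ : ℝ} (hM₂ : 0 ≤ M₂) (hrepr : ∀ (v : 𝔸) (j : ι), |b.repr v j| ≤ M₂ * ‖v‖) {U : CfgY 𝔸 x.toKIdx} (hU : GVal G x.toKIdx U) (a : AfldY 𝔸 x.toKIdx)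
    {B δ : ℝ} (hB : 0 ≤ B)
    (hGDD : ∀ k l : Fin (d + 1) ⊕ Fin (d + 1), HasL2Majorant (g := toB6 (geo9Y x) 0 True) (fun p : SiteY x.toKIdx × ι => blkC x.toKIdx ιB p.1)
      (GopC x.toKIdx par b (.prod U a) * conj b (diffLetter (shiftY x.toKIdx) (coordC G x.toKIdx (.base U)) ((((geo9Y x).eta : ℂ))⁻¹) k) *
        conj b (diffLetter (shiftY x.toKIdx) (coordC G x.toKIdx (.base U)) ((((geo9Y x).eta : ℂ))⁻¹) l))
      (fun a a' => B * 1 * Real.exp (-(δ * (geo9Y x).dist a a'))))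
    (lam : (geo9Y x).Loc) (h : (geo9Y x).Cut) (y y' : IBondY x.toKIdx) (hcut : (geo9Y x).cutIn h y) (hsupp : (geo9Y x).suppIn lam y') :
    (KSC₃ P G x par C37 C38).l2 5 (.prod U a) lam h ≤ ((Real.sqrt (Fintype.card ι) * M₂ * ∑ j, ‖b j‖) * B + 1) * B9.pref6 ((geo9Y x).len y) 5 *
      (geo9Y x).cutSup h * Real.exp (-(δ * (geo9Y x).dist y y')) * (geo9Y x).l2Norm lam := by
  refine writeL2_KSC₃ P G x par C37 C38 b ιB hι hM₂ hrepr U a hB 5 (fun k l => ?_) lam h y y' hcut hsupp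
  have h := hGDD k l
  rw [coordC_base_eq G x hU, show GopC x.toKIdx par b (.prod U a) =
    conj b (((kGeo x.toKIdx).eta ^ 2) • (GpY x.toKIdx par (mulY x.toKIdx (fluct (kGeo x.toKIdx).eta a) U)).restrictScalars ℝ) from rfl,
    ← B9Eq352DivFormLetters.conj_mul, ← B9Eq352DivFormLetters.conj_mul] at h
  exact B6RandomWalkL2.hasL2Majorant_mono _ h fun a a' => le_of_eq rfl

end KSC3

/-! ## §4 ★★ The `L²` frame `L2Frame₂` over the coded carriers of a subfamily, INHABITED at `KSC₃` (and the (3.47) frame re-instantiated at `KSC₃`) -/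

section Frames

variable [NormOneClass 𝔸] {J : Type} (f : J → MemberY d ℓ hd hL b₀ b₁ Mstar)
  (c35 : ℝ) (G : Subgroup 𝔸ˣ) {ι : Type} [Fintype ι] [DecidableEq ι] (b : Module.Basis ι ℝ 𝔸)
  [∀ x : MemberY d ℓ hd hL b₀ b₁ Mstar, Fintype (geo9Y x).Site] [instDS : ∀ x : MemberY d ℓ hd hL b₀ b₁ Mstar, DecidableEq (geo9Y x).Site]
  [∀ x : MemberY d ℓ hd hL b₀ b₁ Mstar, Nonempty (geo9Y x).Site]
  (C37 C38 : ∀ j : J, ℝ → CfgY 𝔸 (f j).toKIdx → AfldY 𝔸 (f j).toKIdx → Prop)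
  (par : ∀ j : J, SiteParY 𝔸 (f j).toKIdx)
  (ιB : ∀ j : J, BlkY (f j).toKIdx → IBondY (f j).toKIdx)

/-- ★★ **THE `L²` FRAME `L2Frame₂` OVER THE CODED CARRIERS OF A SUBFAMILY, INHABITED** at the readings `KSC₃`: gen 8's root frame `gpFrame₂CodedOn` at `KC := KSC₃`
(dictionaries `read342Y_KSC₃` ∕ `write342Y_KSC₃`, reading constant `c_R = M₂Σ‖b_j‖`, writing functions `(c_R·B + 1, δ)`) extended by the `L²` reading constant
`c_L = √|ι|·M₂·Σ_j‖b_j‖`, the writing functions `(c_L·B + 1, δ)`, and the fields `readL2` ∕ `writeL2_0` ∕ `writeL2_1` DISCHARGED by §3 — threshold-free, as the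
(O4) architecture requires.  The six further `L²` fields of `SectBFrame₄` are §3's `readL2_two … writeL2_five_KSC₃` in their literal shapes.
[cite: Balaban1985BackgroundPropagators, Thm 3.4 p.400, Thm 3.1 (3.46) p.398, (3.42) p.397, p.403 l.1–9; Balaban1984PropagatorsII, Prop. 2.6 (2.140) p.247, Lemma 2.1 p.234, (2.51) p.232] -/
noncomputable def l2Frame₂CodedOn (hι : ∀ (j : J) (s : BlkY (f j).toKIdx), β (f j).toKIdx.hN (f j).toKIdx.D (f j).toKIdx.hk (ιB j s) = s)
    (hG1 : ∀ u : 𝔸ˣ, u ∈ G → ‖(u : 𝔸)‖ ≤ 1) (hpar : ∀ j (U : CfgY 𝔸 (f j).toKIdx), GVal G (f j).toKIdx U → ∀ z w, par j U z w ∈ G)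
    (hunit : ∀ j (U : CfgY 𝔸 (f j).toKIdx), GVal G (f j).toKIdx U → IsUnit (Node00.deltaPrimeAY (f j).toKIdx (par j) U))
    (dB : ℕ) (M₂ : ℝ) (hM₂ : 0 ≤ M₂) (hrepr : ∀ (v : 𝔸) (j : ι), |b.repr v j| ≤ M₂ * ‖v‖) (hcR : 0 < M₂ * ∑ j, ‖b j‖)
    (hcL : 0 < Real.sqrt (Fintype.card ι) * M₂ * ∑ j, ‖b j‖)
    (Cq : ℝ) (hCq : 0 ≤ Cq) (hC37 : ∀ j β' U a, C37 j β' U a → GVal G (f j).toKIdx U ∧ CplxLettersY G (f j) (par j) (ιB j) Cq β' U a)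
    (MInv aInv aW : ℝ) (hMInv : 0 < MInv) (haInv : 0 < aInv) (haW : 0 < aW) :
    B9SectBL2StepAtLettersV2.L2Frame₂ c35 (fun j => geo9Y (f j)) (fun j => (codingYx P G (f j) (C37 j) (C38 j)).bg)
      (fun j => KSC₃ P G (f j) (par j) (C37 j) (C38 j)) b (Fin (d + 1)) (fun j => SiteY (f j).toKIdx) :=
  { B9SectBCodedChainOnSubfamilyR.gpFrame₂CodedOn P f c35 G b C37 C38 par ιB (fun j => KSC₃ P G (f j) (par j) (C37 j) (C38 j)) hι hG1 hpar hunit dB M₂ hM₂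
      hrepr Cq hCq hC37 (M₂ * ∑ j, ‖b j‖) hcR (fun B _ => (M₂ * ∑ j, ‖b j‖) * B + 1) (fun B _ hB _ => by positivity) (fun δ => δ) (fun δ hδ => hδ)
      MInv aInv aW hMInv haInv haW (fun j => read342Y_KSC₃ P G (f j) (par j) (C37 j) (C38 j) b (ιB j) (hι j) M₂ hM₂ hrepr c35 MInv aInv)
      (fun j => write342Y_KSC₃ P G (f j) (par j) (C37 j) (C38 j) b (ιB j) (hι j) M₂ hM₂ hrepr aW fun β' U a h => (hC37 j β' U a h).1) with
    cL := Real.sqrt (Fintype.card ι) * M₂ * ∑ j, ‖b j‖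
    wL := fun B _ => (Real.sqrt (Fintype.card ι) * M₂ * ∑ j, ‖b j‖) * B + 1
    wLδ := fun δ => δ
    cL_pos := hcL
    wL_pos := fun B _ hB _ => by positivity
    wLδ_pos := fun δ hδ => hδ
    readL2 := fun j α₀ c B₀ δ _ _ _ hreg hB₀ _ hL2 => by
      obtain ⟨U, rfl, hU⟩ := (codingYx P G (f j) (C37 j) (C38 j)).exists_of_bg_Reg335 hreg
      exact readL2_KSC₃ P G (f j) (par j) (C37 j) (C38 j) b (ιB j) (hι j) hM₂ hrepr hU.1.1 hB₀.le hL2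
    writeL2_0 := fun j c c' α₁ B δ _ _ h37 hB _ hG lam h y y' hc hs => by
      obtain ⟨U, a, rfl, rfl, hC⟩ := (codingYx P G (f j) (C37 j) (C38 j)).exists_of_bg_Cplx337 h37
      exact writeL2_zero_KSC₃ P G (f j) (par j) (C37 j) (C38 j) b (ιB j) (hι j) hM₂ hrepr U a hB hG lam h y y' hc hs
    writeL2_1 := fun j c c' α₁ B δ _ _ h37 hB _ hDG lam h y y' hc hs => by
      obtain ⟨U, a, rfl, rfl, hC⟩ := (codingYx P G (f j) (C37 j) (C38 j)).exists_of_bg_Cplx337 h37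
      exact writeL2_one_KSC₃ P G (f j) (par j) (C37 j) (C38 j) b (ιB j) (hι j) hM₂ hrepr (hC37 j _ U a hC).1 a hB hDG lam h y y' hc hs }

/-- ★ **THE (3.47) FRAME OVER THE CODED CARRIERS OF A SUBFAMILY AT `KSC₃`** (as gen 8's `globFrame₂CodedOn` at `KSC₂`: the global member of `KSC₃` is `KSC₂`'s,
silent at products). [cite: Balaban1985BackgroundPropagators, Thm 3.4 p.400, (3.47) p.398, (3.42) p.397; Balaban1984PropagatorsII, Lemma 2.1 p.234, (2.51) p.232] -/
noncomputable def globFrame₂CodedOn₃ (hι : ∀ (j : J) (s : BlkY (f j).toKIdx), β (f j).toKIdx.hN (f j).toKIdx.D (f j).toKIdx.hk (ιB j s) = s)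
    (hG1 : ∀ u : 𝔸ˣ, u ∈ G → ‖(u : 𝔸)‖ ≤ 1) (hpar : ∀ j (U : CfgY 𝔸 (f j).toKIdx), GVal G (f j).toKIdx U → ∀ z w, par j U z w ∈ G)
    (hunit : ∀ j (U : CfgY 𝔸 (f j).toKIdx), GVal G (f j).toKIdx U → IsUnit (Node00.deltaPrimeAY (f j).toKIdx (par j) U))
    (dB : ℕ) (M₂ : ℝ) (hM₂ : 0 ≤ M₂) (hrepr : ∀ (v : 𝔸) (j : ι), |b.repr v j| ≤ M₂ * ‖v‖) (hcR : 0 < M₂ * ∑ j, ‖b j‖)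
    (Cq : ℝ) (hCq : 0 ≤ Cq) (hC37 : ∀ j β' U a, C37 j β' U a → GVal G (f j).toKIdx U ∧ CplxLettersY G (f j) (par j) (ιB j) Cq β' U a)
    (MInv aInv aW : ℝ) (hMInv : 0 < MInv) (haInv : 0 < aInv) (haW : 0 < aW) :
    B9SectBGpStepAtLettersV2.GlobFrame₂ c35 (fun j => geo9Y (f j)) (fun j => (codingYx P G (f j) (C37 j) (C38 j)).bg)
      (fun j => KSC₃ P G (f j) (par j) (C37 j) (C38 j)) b (Fin (d + 1)) (fun j => SiteY (f j).toKIdx) :=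
  { B9SectBCodedChainOnSubfamilyR.gpFrame₂CodedOn P f c35 G b C37 C38 par ιB (fun j => KSC₃ P G (f j) (par j) (C37 j) (C38 j)) hι hG1 hpar hunit dB M₂ hM₂
      hrepr Cq hCq hC37 (M₂ * ∑ j, ‖b j‖) hcR (fun B _ => (M₂ * ∑ j, ‖b j‖) * B + 1) (fun B _ hB _ => by positivity) (fun δ => δ) (fun δ hδ => hδ)
      MInv aInv aW hMInv haInv haW (fun j => read342Y_KSC₃ P G (f j) (par j) (C37 j) (C38 j) b (ιB j) (hι j) M₂ hM₂ hrepr c35 MInv aInv)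
      (fun j => write342Y_KSC₃ P G (f j) (par j) (C37 j) (C38 j) b (ιB j) (hι j) M₂ hM₂ hrepr aW fun β' U a h => (hC37 j β' U a h).1) with
    wG := fun _ _ => 1
    wG_pos := fun _ _ _ _ => one_pos
    writeGlob := fun j c c' α₁ B δ _ _ h37 _ _ _ _ _ _ => by
      obtain ⟨U, a, rfl, rfl, -⟩ := (codingYx P G (f j) (C37 j) (C38 j)).exists_of_bg_Cplx337 h37
      exact globBlock_KSC₃_prod P G (f j) (par j) (C37 j) (C38 j) U a zero_le_one }

end Frames

end Literature.MathematicalPhysics.QuantumFieldTheory.Balaban1983to89.B9SectBL2DictionaryYR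

end

/-!
# `Balaban1983to89.B9SectBL2TransferConvYR` — THE CLASS-PARAMETRIC TWIN of `B9SectBL2TransferConvY` (CASCADE-R, director-ym №279 GO-R; №277 (3) `hunitA` cure; dag-n06-d SOCKET-(α) class question)

statement-level skeleton of published theorems with citation tags; proofs where landed; nothing here is a claim about the
Yang–Mills mass gap

WHAT THIS FILE IS.  The original module `B9SectBL2TransferConvY` types its objects over MODULE 3's member carrier `bg9Y 𝔸 G x` (MODULE 2's small-cube class (3.35)).  This file RE-DECLARES, with UNCHANGED NAMES inside the namespace `…B9SectBL2TransferConvYR`, exactly its 2 class-dependent declarations over the CLASS-PARAMETRIC carrier `B9SectBCodedClassR.bg9YC 𝔸 G P x` (`P : RegExtraY …` = the two cube conditions of (3.35)∕(3.36) as a parameter; `bg9Y 𝔸 G x = bg9YC 𝔸 G (extraY 𝔸 G) x` by `rfl`, so every declaration here specialises definitionally to its original; at the record's reading of PRINT's class, `P := extraYPb 𝔸 G`, the displayed laws `hreg335P` ((3.35) on plaquettes) and the class-keyed `hunitA` become theorems).  The text is the original's VERBATIM under the token surgery `bg9Y 𝔸 G ↦ bg9YC 𝔸 G P`, `NAME ↦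 NAME P` for the class-dependent names (P the first explicit argument), and — №277 — the binder `hunitA` re-keyed from «all G-valued U» to «all (3.35)-regular U of the carrier» (`∀ j α₀ U, (bg9YC 𝔸 G P (f j)).Reg335 c35 α₀ U → IsUnit (deltaAY …)`).  Class-free declarations of the original are NOT copied: they are imported and used BY NAME (`open … hiding` the re-declared ones).  Generated by dag-n06-c g16's `gen.py` (HOME `pub-ymgap-dag-n06-c/lean/g16/`); the ORIGINAL MODULE DOCUMENTATION FOLLOWS VERBATIM and describes the mathematics.

HONEST SCOPE.  Re-typing bookkeeping; nothing of [B9] asserted beyond the original; COUNT-NEUTRAL; N06 NOT discharged; nothing continuum ∕ OS ∕ mass gap ∕ Clay.  Cell `pub-ymgap` (D-0062), Track A node N06 [B9], seat `pub-ymgap-dag-n06-c` g16, 2026-08-29.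
-/

/-! Module documentation: that of the original `Balaban1983to89.B9SectBL2TransferConvY` applies verbatim to this twin (not repeated here). -/

noncomputable section

namespace Literature.MathematicalPhysics.QuantumFieldTheory.Balaban1983to89.B9SectBL2TransferConvYR

open Literature.MathematicalPhysics.QuantumFieldTheory.Balaban1983to89.B9SectBCodedClassR (RegExtraY bg9YC)
open Literature.MathematicalPhysics.QuantumFieldTheory.Balaban1983to89.B9SectBL2TransferConvY hiding hconvL2_words_at l2Block_record_at_W_of_KSC₃

open Literature.MathematicalPhysics.QuantumFieldTheory.Balaban1983to89
open Literature.MathematicalPhysics.QuantumFieldTheory.Balaban1983to89.B6KLevelCensusIndexV1 (KIdx kGeo)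
open Literature.MathematicalPhysics.QuantumFieldTheory.Balaban1983to89.B6Ineq2142KLevelV1 (β)
open Literature.MathematicalPhysics.QuantumFieldTheory.Balaban1983to89.B6RandomWalk (Triangle254 Ineq261)
open Literature.MathematicalPhysics.QuantumFieldTheory.Balaban1983to89.B6RandomWalkL2 (HasL2Majorant hasL2Majorant_mono)
open Literature.MathematicalPhysics.QuantumFieldTheory.Balaban1983to89.B9Thm34Ext (toB6)
open Literature.MathematicalPhysics.QuantumFieldTheory.Balaban1983to89.B9Ineq347 (ScaleTransfer)
open Literature.MathematicalPhysics.QuantumFieldTheory.Balaban1983to89.B9FromB6 (L2Block pref6_nonneg)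
open Literature.MathematicalPhysics.QuantumFieldTheory.Balaban1983to89.B9Eq39Adjoint (fluct prodCfg)
open Literature.MathematicalPhysics.QuantumFieldTheory.Balaban1983to89.B9Eq352DivFormLetters (conj)
open Literature.MathematicalPhysics.QuantumFieldTheory.Balaban1983to89.B9Eq352GradLetters (diffLetter)
open Literature.MathematicalPhysics.QuantumFieldTheory.Balaban1983to89.B9SectBCodedCarrier (CCfg)
open Literature.MathematicalPhysics.QuantumFieldTheory.Balaban1983to89.B9Eq360DeltaPrimeAY (AfldY mulY chartA UboxY_mulY_fluct)
open Literature.MathematicalPhysics.QuantumFieldTheory.Balaban1983to89.B9PinMembersKLevelV1 (MemberY geo9Y bg9Y)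
open Literature.MathematicalPhysics.QuantumFieldTheory.Balaban1983to89.B9SectBGpLettersY (decY GVal coordC blkC GopC stencilF_blkC stencilB_blkC
  norm_le_one_and_inv_of_mem)
open Literature.MathematicalPhysics.QuantumFieldTheory.Balaban1983to89.B9SectBGpFrameCodedYR (codingYx)
open Literature.MathematicalPhysics.QuantumFieldTheory.Balaban1983to89.B9SectBGpFrameCodedY (CplxLettersY)
open Literature.MathematicalPhysics.QuantumFieldTheory.Balaban1983to89.B9SectBGpReadingsY (baseY etaS_eq_eta)
open Literature.MathematicalPhysics.QuantumFieldTheory.Balaban1983to89.B9SectBL2DictionaryYR (KSC₃ KSC₃_l2)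
open Literature.MathematicalPhysics.QuantumFieldTheory.Balaban1983to89.B9SectBL2DictionaryY (wordSL wordL e6 l2LatSC l2AugS l2AugS_inl exists_ball_bound_l2LatSC hasL2Majorant_wordL_of_l2AugS l2AugS_le_of_hasL2Majorant_wordL coordC_base_eq dirS)
open Literature.MathematicalPhysics.QuantumFieldTheory.Balaban1983to89.B9Eq370LetterConversionL2 (hasL2Majorant_diffLetter_prodCfg_mul
  hasL2Majorant_mul_diffLetter_prodCfg)
open Literature.MathematicalPhysics.QuantumFieldTheory.Balaban1983to89.B9SectBGpTransferConvY (letters337_of_cplxLettersY)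
open Literature.MathematicalPhysics.QuantumFieldTheory.Balaban1983to89.B9Ineq363L2 (hasL2Majorant_rate_mono)
open Literature.MathematicalPhysics.QuantumFieldTheory.Balaban1983to89.B9GeoLemma21KLevelV1 (geo9Y_dist_self geo9Y_dist_comm geo9Y_dist_triangle geo9Y_len_pos
  geo9K_eta_pos geo9K_one_le_L)
open Literature.MathematicalPhysics.QuantumFieldTheory.Balaban1983to89.B9RWSums347DefiniteFacesWindow (geo9Y_dist_nonneg)
open Literature.MathematicalPhysics.QuantumFieldTheory.Balaban1983to89.B9Thm314WholeExpansionReads (le_iSup_ball)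
open Literature.MathematicalPhysics.QuantumFieldTheory.Balaban1983to89.Node00 (SiteY BlkY IBondY CfgY BallY SiteOpY SiteParY UboxY shiftY cdS cdsS
  liftY l2OfY etaS kernelFamilyS GpY)

variable {𝔸 : Type} [NormedRing 𝔸] [NormedAlgebra ℂ 𝔸] [CompleteSpace 𝔸] [FiniteDimensional ℝ 𝔸]
variable {d ℓ : ℕ} {hd : 1 ≤ d + 1} {hL : Odd (ℓ + 1) ∧ 1 < ℓ + 1} {b₀ b₁ : ℝ} {Mstar : ℕ} (P : RegExtraY d ℓ hd hL b₀ b₁ Mstar 𝔸)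

/-! ## §1 The record's six members are among the augmented words at `(W, W)`; ★ WRITE at `W` -/

section Record

variable (x : MemberY d ℓ hd hL b₀ b₁ Mstar) (ιB : BlkY x.toKIdx → IBondY x.toKIdx) {ι : Type} [Fintype ι] (b : Module.Basis ι ℝ 𝔸)
  [Fintype (geo9Y x).Site] [DecidableEq (geo9Y x).Site]

end Record

/-! ## §2 ★★ The conversion at one member: the `W`-words with at most one difference on each side -/

section Member

variable (G : Subgroup 𝔸ˣ) (x : MemberY d ℓ hd hL b₀ b₁ Mstar) (par : SiteParY 𝔸 x.toKIdx) {ι : Type} [Fintype ι] [DecidableEq ι]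
  (b : Module.Basis ι ℝ 𝔸) (ιB : BlkY x.toKIdx → IBondY x.toKIdx) [Fintype (geo9Y x).Site] [DecidableEq (geo9Y x).Site]
  (C37 C38 : ℝ → CfgY 𝔸 x.toKIdx → AfldY 𝔸 x.toKIdx → Prop)

/-- ★★ **THE `L²` LETTER CONVERSION AT ONE MEMBER, THE WORDS WITH AT MOST ONE DIFFERENCE ON EACH SIDE.**  Data as in gen 8's `hconv_at`: unit-norm
structure group, a section `ιB` of `β`, a real basis with coordinate constant `M₂`, the coded-class dictionary `hC37`; Lemma 2.1 of [4] at `(δ₀, 1/12)`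
with exponent `dL`, the scale transfers of `ℓ, ℓ², ℓ⁻¹` at `(δ₀, 1/12)` with constant `Λ ≧ 0`.  Then for `(U, a)` in the coded class at `α₁ ≦ 1/4` and
`B₀ ≧ 0`, the (3.46) block of `KSC₃` at `prod U a` (letters at `U`) gives, AT `W = e^{ηa}·U` WITH LETTERS AT `W` and rate `δ₀/2`, the block-`ℓ²` majorants
of `conj b (η²G′(W))` (weight `ℓ²`), of every `conj b (∇♯_{W,k}-letter)·conj b (η²G′(W))` and `conj b (η²G′(W))·conj b (∇♯_{W,k}-letter)` (weight `ℓ`), and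
of every `conj b (∇♯_{W,k})·conj b (η²G′(W))·conj b (∇♯_{W,l})` (weight `1`), all with the constant `convConstL2 …`.
[cite: Balaban1985BackgroundPropagators, p.403 l.1–9, (3.70) p.404, (3.74) p.405, Thm 3.1 (3.46) p.398, (3.37) p.396; Balaban1984PropagatorsII, Prop. 2.6 (2.140)–(2.141) p.247, Lemma 2.1 p.234] -/
theorem hconvL2_words_at (hι : ∀ s : BlkY x.toKIdx, β x.toKIdx.hN x.toKIdx.D x.toKIdx.hk (ιB s) = s)
    (hG1 : ∀ u : 𝔸ˣ, u ∈ G → ‖(u : 𝔸)‖ ≤ 1) {M₂ : ℝ} (hM₂ : 0 ≤ M₂) (hrepr : ∀ (v : 𝔸) (j : ι), |b.repr v j| ≤ M₂ * ‖v‖)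
    {Cq : ℝ} (hC37 : ∀ β' U a, C37 β' U a → GVal G x.toKIdx U ∧ CplxLettersY G x par ιB Cq β' U a)
    {δ₀ : ℝ} (hδ₀ : 0 < δ₀) {dL : ℕ} (h261 : Ineq261 dL (toB6 (geo9Y x) (0 : ℝ) True) δ₀ (1 / 12)) {Λ : ℝ} (hΛ : 0 ≤ Λ)
    (hT1 : ScaleTransfer (geo9Y x) δ₀ (1 / 12) Λ (fun a => (geo9Y x).len a))
    (hT2 : ScaleTransfer (geo9Y x) δ₀ (1 / 12) Λ (fun a => (geo9Y x).len a ^ 2))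
    (hTi : ScaleTransfer (geo9Y x) δ₀ (1 / 12) Λ (fun a => ((geo9Y x).len a)⁻¹))
    {B₀ : ℝ} (hB₀ : 0 ≤ B₀) {U : CfgY 𝔸 x.toKIdx} {a : AfldY 𝔸 x.toKIdx} {α₁ : ℝ} (hα₁c : α₁ ≤ 1 / 4) (hC : C37 α₁ U a)
    (hL2 : L2Block (KSC₃ P G x par C37 C38) B₀ δ₀ (.prod U a)) :
    HasL2Majorant (g := toB6 (geo9Y x) (0 : ℝ) True) (fun p : SiteY x.toKIdx × ι => blkC x.toKIdx ιB p.1)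
        (conj b (((kGeo x.toKIdx).eta ^ 2) • (GpY x.toKIdx par (mulY x.toKIdx (fluct (kGeo x.toKIdx).eta a) U)).restrictScalars ℝ))
        (fun p q => convConstL2 M₂ (∑ j, ‖b j‖) (Real.sqrt (Fintype.card ι)) d dL δ₀ Λ B₀ * (geo9Y x).len p ^ 2 * Real.exp (-(δ₀ / 2 * (geo9Y x).dist p q))) ∧
      (∀ k : Fin (d + 1) ⊕ Fin (d + 1), HasL2Majorant (g := toB6 (geo9Y x) (0 : ℝ) True) (fun p : SiteY x.toKIdx × ι => blkC x.toKIdx ιB p.1)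
        (conj b (diffLetter (shiftY x.toKIdx) (UboxY x.toKIdx (mulY x.toKIdx (fluct (kGeo x.toKIdx).eta a) U)) ((((kGeo x.toKIdx).eta : ℂ))⁻¹) k) * conj b (((kGeo x.toKIdx).eta ^ 2) • (GpY x.toKIdx par (mulY x.toKIdx (fluct (kGeo x.toKIdx).eta a) U)).restrictScalars ℝ))
        (fun p q => convConstL2 M₂ (∑ j, ‖b j‖) (Real.sqrt (Fintype.card ι)) d dL δ₀ Λ B₀ * (geo9Y x).len p * Real.exp (-(δ₀ / 2 * (geo9Y x).dist p q)))) ∧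
      (∀ k : Fin (d + 1) ⊕ Fin (d + 1), HasL2Majorant (g := toB6 (geo9Y x) (0 : ℝ) True) (fun p : SiteY x.toKIdx × ι => blkC x.toKIdx ιB p.1)
        (conj b (((kGeo x.toKIdx).eta ^ 2) • (GpY x.toKIdx par (mulY x.toKIdx (fluct (kGeo x.toKIdx).eta a) U)).restrictScalars ℝ) * conj b (diffLetter (shiftY x.toKIdx) (UboxY x.toKIdx (mulY x.toKIdx (fluct (kGeo x.toKIdx).eta a) U)) ((((kGeo x.toKIdx).eta : ℂ))⁻¹) k))
        (fun p q => convConstL2 M₂ (∑ j, ‖b j‖) (Real.sqrt (Fintype.card ι)) d dL δ₀ Λ B₀ * (geo9Y x).len p * Real.exp (-(δ₀ / 2 * (geo9Y x).dist p q)))) ∧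
      (∀ k l : Fin (d + 1) ⊕ Fin (d + 1), HasL2Majorant (g := toB6 (geo9Y x) (0 : ℝ) True) (fun p : SiteY x.toKIdx × ι => blkC x.toKIdx ιB p.1)
        (conj b (diffLetter (shiftY x.toKIdx) (UboxY x.toKIdx (mulY x.toKIdx (fluct (kGeo x.toKIdx).eta a) U)) ((((kGeo x.toKIdx).eta : ℂ))⁻¹) k) * conj b (((kGeo x.toKIdx).eta ^ 2) • (GpY x.toKIdx par (mulY x.toKIdx (fluct (kGeo x.toKIdx).eta a) U)).restrictScalars ℝ) *
          conj b (diffLetter (shiftY x.toKIdx) (UboxY x.toKIdx (mulY x.toKIdx (fluct (kGeo x.toKIdx).eta a) U)) ((((kGeo x.toKIdx).eta : ℂ))⁻¹) l))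
        (fun p q => convConstL2 M₂ (∑ j, ‖b j‖) (Real.sqrt (Fintype.card ι)) d dL δ₀ Λ B₀ * 1 * Real.exp (-(δ₀ / 2 * (geo9Y x).dist p q)))) := by
  -- names for the letters and constants
  set η : ℝ := (kGeo x.toKIdx).eta with hηdef
  set W : CfgY 𝔸 x.toKIdx := mulY x.toKIdx (fluct η a) U with hW
  set Bc : ℝ := convConstL2 M₂ (∑ j, ‖b j‖) (Real.sqrt (Fintype.card ι)) d dL δ₀ Λ B₀ with hBcdef
  set Sb : ℝ := ∑ j, ‖b j‖ with hSbdef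
  set sι : ℝ := Real.sqrt (Fintype.card ι) with hsι
  set cL : ℝ := sι * M₂ * Sb with hcL
  set Bin : ℝ := cL * B₀ with hBin
  set d₀ : ℝ := 2 * ((d : ℝ) + 1) with hd₀
  set c₁ : ℝ := B6.c1 dL δ₀ (1 / 12) with hc₁
  set ρ₁ : ℝ := 5 * δ₀ / 6 with hρ₁
  set ρ₂ : ℝ := 2 * δ₀ / 3 with hρ₂
  set g₀ : ℝ := 1 + cDef M₂ Sb sι d δ₀ * (1 / 4) * Λ * c₁ with hg₀
  set g₁ : ℝ := 1 + cDef M₂ Sb sι d ρ₁ * (1 / 4) * Λ * c₁ with hg₁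
  -- signs
  have hSb : 0 ≤ Sb := Finset.sum_nonneg fun j _ => norm_nonneg _
  have hsι0 : 0 ≤ sι := Real.sqrt_nonneg _
  have hcL0 : 0 ≤ cL := by positivity
  have hBin0 : 0 ≤ Bin := mul_nonneg hcL0 hB₀
  have hc₁0 : 0 ≤ c₁ := B6RandomWalk.c1_nonneg dL δ₀ (1 / 12)
  have hcD0 : 0 ≤ cDef M₂ Sb sι d δ₀ := cDef_nonneg hM₂ hSb hsι0 d δ₀
  have hcD1 : 0 ≤ cDef M₂ Sb sι d ρ₁ := cDef_nonneg hM₂ hSb hsι0 d ρ₁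
  have hg₀1 : 1 ≤ g₀ := by rw [hg₀]; exact le_add_of_nonneg_right (mul_nonneg (mul_nonneg (mul_nonneg hcD0 (by norm_num)) hΛ) hc₁0)
  have hg₁1 : 1 ≤ g₁ := by rw [hg₁]; exact le_add_of_nonneg_right (mul_nonneg (mul_nonneg (mul_nonneg hcD1 (by norm_num)) hΛ) hc₁0)
  have hg₀0 : 0 ≤ g₀ := le_trans zero_le_one hg₀1
  have hg₁0 : 0 ≤ g₁ := le_trans zero_le_one hg₁1
  have hBc : Bc = g₀ * g₁ * Bin := by rw [hBcdef, hg₀, hg₁, hBin, hcL, hc₁, hρ₁]; rfl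
  -- geometry of the member
  have hη0 : 0 < η := geo9K_eta_pos x.toKIdx
  have hdnn : ∀ y y' : (geo9Y x).Site, 0 ≤ (geo9Y x).dist y y' := geo9Y_dist_nonneg x
  have htri : Triangle254 (toB6 (geo9Y x) (0 : ℝ) True) := fun p q r => geo9Y_dist_triangle x p q r
  have hlen : ∀ y : (geo9Y x).Site, 0 < (geo9Y x).len y := geo9Y_len_pos x
  have hd₀F : ∀ (μ : Fin (d + 1)) (z : SiteY x.toKIdx), (geo9Y x).dist (blkC x.toKIdx ιB z) (blkC x.toKIdx ιB (shiftY x.toKIdx μ z)) ≤ d₀ ∧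
      (geo9Y x).dist (blkC x.toKIdx ιB z) (blkC x.toKIdx ιB ((shiftY x.toKIdx μ).symm z)) ≤ d₀ :=
    fun μ z => ⟨stencilF_blkC x.toKIdx ιB hι μ z, stencilB_blkC x.toKIdx ιB hι μ z⟩
  -- the class: `U` is `G`-valued, the (3.37) letters at `α₁ ≤ 1/4`
  obtain ⟨hU, hcl⟩ := hC37 α₁ U a hC
  obtain ⟨hA, -⟩ := letters337_of_cplxLettersY G x par ιB hα₁c hU hcl
  have hρu : ∀ (μ : Fin (d + 1)) (z : SiteY x.toKIdx), ‖((UboxY x.toKIdx U μ z : 𝔸ˣ) : 𝔸)‖ ≤ 1 ∧ ‖(((UboxY x.toKIdx U μ z)⁻¹ : 𝔸ˣ) : 𝔸)‖ ≤ 1 :=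
    fun μ z => norm_le_one_and_inv_of_mem G hG1 (hU μ _ : UboxY x.toKIdx U μ z ∈ G)
  have hsmall : ∀ y : (geo9Y x).Site, η * ((1 / 4 : ℝ) * ((geo9Y x).len y)⁻¹) ≤ 1 / 4 := by
    intro y
    have hηle : η ≤ (geo9Y x).len y := by
      show (geo9Y x).eta ≤ (geo9Y x).L ^ (geo9Y x).scale y * (geo9Y x).eta
      exact le_mul_of_one_le_left (geo9K_eta_pos x.toKIdx).le (one_le_pow₀ (geo9K_one_le_L x.toKIdx))
    have hl := hlen y
    rw [show η * ((1 / 4 : ℝ) * ((geo9Y x).len y)⁻¹) = (1 / 4) * (η / (geo9Y x).len y) by ring]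
    have : η / (geo9Y x).len y ≤ 1 := (div_le_one hl).mpr hηle
    linarith
  -- the letters
  set Gw : Module.End ℝ (SiteY x.toKIdx → 𝔸) := (η ^ 2) • (GpY x.toKIdx par W).restrictScalars ℝ with hGw
  set DU : Fin (d + 1) ⊕ Fin (d + 1) → Module.End ℝ (SiteY x.toKIdx → 𝔸) := fun k => diffLetter (shiftY x.toKIdx) (UboxY x.toKIdx U) (((η : ℂ))⁻¹) k
    with hDU
  have hUW : UboxY x.toKIdx W = prodCfg (UboxY x.toKIdx U) η (chartA x.toKIdx a) := by rw [UboxY_mulY_fluct]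
  -- READ: the words of `KSC₃` at the product, letters at `U`, rate δ₀, constant `Bin`
  have hRd := fun n k l => hasL2Majorant_wordL_of_l2AugS x ιB b hι hM₂ hrepr (0 : ℝ) True (B := (codingYx P G x C37 C38).bg) (fun c => c)
    (GpY x.toKIdx par) hB₀ (c := .prod U a) n (fun lam hh y y' hc hs => hL2 n lam hh y y' hc hs) k l
  have hK : ∀ (n : Fin 6) (p q : (geo9Y x).Site), (sι * M₂ * ∑ j, ‖b j‖) * B₀ * B9.pref6 ((geo9Y x).len p) n * Real.exp (-(δ₀ * (geo9Y x).dist p q))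
      = Bin * B9.pref6 ((geo9Y x).len p) n * Real.exp (-(δ₀ * (geo9Y x).dist p q)) := fun n p q => by rw [hBin, hcL, hSbdef]
  have h0 : HasL2Majorant (g := toB6 (geo9Y x) (0 : ℝ) True) (fun p : SiteY x.toKIdx × ι => blkC x.toKIdx ιB p.1) (conj b Gw)
      (fun p q => Bin * (geo9Y x).len p ^ 2 * Real.exp (-(δ₀ * (geo9Y x).dist p q))) :=
    hasL2Majorant_mono (g := toB6 (geo9Y x) (0 : ℝ) True) _ (hRd 0 (Sum.inl 0) (Sum.inl 0)) fun p q => le_of_eq (by rw [hK]; rfl)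
  have h1 : ∀ k, HasL2Majorant (g := toB6 (geo9Y x) (0 : ℝ) True) (fun p : SiteY x.toKIdx × ι => blkC x.toKIdx ιB p.1) (conj b (DU k) * conj b Gw)
      (fun p q => Bin * (geo9Y x).len p * Real.exp (-(δ₀ * (geo9Y x).dist p q))) := fun k => by
    have h : HasL2Majorant (g := toB6 (geo9Y x) (0 : ℝ) True) (fun p : SiteY x.toKIdx × ι => blkC x.toKIdx ιB p.1) (conj b (DU k * Gw))
        (fun p q => (Real.sqrt (Fintype.card ι) * M₂ * ∑ j, ‖b j‖) * B₀ * B9.pref6 ((geo9Y x).len p) 1 * Real.exp (-(δ₀ * (geo9Y x).dist p q))) :=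
      hRd 1 k k
    rw [B9Eq352DivFormLetters.conj_mul] at h
    exact hasL2Majorant_mono (g := toB6 (geo9Y x) (0 : ℝ) True) _ h fun p q => le_of_eq (by rw [hK]; rfl)
  have h2 : ∀ k, HasL2Majorant (g := toB6 (geo9Y x) (0 : ℝ) True) (fun p : SiteY x.toKIdx × ι => blkC x.toKIdx ιB p.1) (conj b Gw * conj b (DU k))
      (fun p q => Bin * (geo9Y x).len p * Real.exp (-(δ₀ * (geo9Y x).dist p q))) := fun k => by
    have h : HasL2Majorant (g := toB6 (geo9Y x) (0 : ℝ) True) (fun p : SiteY x.toKIdx × ι => blkC x.toKIdx ιB p.1) (conj b (Gw * DU k))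
        (fun p q => (Real.sqrt (Fintype.card ι) * M₂ * ∑ j, ‖b j‖) * B₀ * B9.pref6 ((geo9Y x).len p) 2 * Real.exp (-(δ₀ * (geo9Y x).dist p q))) :=
      hRd 2 k k
    rw [B9Eq352DivFormLetters.conj_mul] at h
    exact hasL2Majorant_mono (g := toB6 (geo9Y x) (0 : ℝ) True) _ h fun p q => le_of_eq (by rw [hK]; rfl)
  have h4 : ∀ k l, HasL2Majorant (g := toB6 (geo9Y x) (0 : ℝ) True) (fun p : SiteY x.toKIdx × ι => blkC x.toKIdx ιB p.1)
      (conj b (DU k) * conj b Gw * conj b (DU l)) (fun p q => Bin * 1 * Real.exp (-(δ₀ * (geo9Y x).dist p q))) := fun k l => by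
    have h : HasL2Majorant (g := toB6 (geo9Y x) (0 : ℝ) True) (fun p : SiteY x.toKIdx × ι => blkC x.toKIdx ιB p.1) (conj b (DU k * Gw * DU l))
        (fun p q => (Real.sqrt (Fintype.card ι) * M₂ * ∑ j, ‖b j‖) * B₀ * B9.pref6 ((geo9Y x).len p) 4 * Real.exp (-(δ₀ * (geo9Y x).dist p q))) :=
      hRd 4 k l
    rw [B9Eq352DivFormLetters.conj_mul, B9Eq352DivFormLetters.conj_mul] at h
    exact hasL2Majorant_mono (g := toB6 (geo9Y x) (0 : ℝ) True) _ h fun p q => le_of_eq (by rw [hK]; rfl)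
  -- rates
  have hρ₁0 : 0 ≤ ρ₁ := by rw [hρ₁]; positivity
  have hρ₂0 : 0 ≤ ρ₂ := by rw [hρ₂]; positivity
  have hr₁ : ρ₁ + (1 / 12 + 1 / 12) * δ₀ ≤ δ₀ := by rw [hρ₁]; linarith
  have hρ₁δ : ρ₁ ≤ δ₀ := by rw [hρ₁]; linarith
  have hr₂ : ρ₂ + (1 / 12 + 1 / 12) * δ₀ ≤ ρ₁ := by rw [hρ₁, hρ₂]; linarith
  have hρ₂₁ : ρ₂ ≤ ρ₁ := by rw [hρ₁, hρ₂]; linarith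
  have hhalf₁ : δ₀ / 2 ≤ ρ₁ := by rw [hρ₁]; linarith
  have hhalf₂ : δ₀ / 2 ≤ ρ₂ := by rw [hρ₂]; linarith
  have hwℓ : ∀ p : (geo9Y x).Site, 0 ≤ (geo9Y x).len p := fun p => (hlen p).le
  have hwℓ2 : ∀ p : (geo9Y x).Site, 0 ≤ (geo9Y x).len p ^ 2 := fun p => sq_nonneg _
  have hw21 : ∀ p : (geo9Y x).Site, ((geo9Y x).len p)⁻¹ * (geo9Y x).len p ^ 2 ≤ (geo9Y x).len p := fun p =>
    le_of_eq (by rw [pow_two, ← mul_assoc, inv_mul_cancel₀ (hlen p).ne', one_mul])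
  have hw21' : ∀ p : (geo9Y x).Site, (geo9Y x).len p ^ 2 * ((geo9Y x).len p)⁻¹ ≤ (geo9Y x).len p := fun p =>
    le_of_eq (by rw [pow_two, mul_assoc, mul_inv_cancel₀ (hlen p).ne', mul_one])
  have hw10 : ∀ p : (geo9Y x).Site, ((geo9Y x).len p)⁻¹ * (geo9Y x).len p ≤ 1 := fun p => le_of_eq (inv_mul_cancel₀ (hlen p).ne')
  have hw10' : ∀ p : (geo9Y x).Site, (geo9Y x).len p * ((geo9Y x).len p)⁻¹ ≤ 1 := fun p => le_of_eq (mul_inv_cancel₀ (hlen p).ne')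
  have hcDef : ∀ r : ℝ, 4 * (1 : ℝ) ^ 2 * M₂ * (∑ j, ‖b j‖) * Real.sqrt (Fintype.card ι) * Real.exp (r * d₀) = cDef M₂ Sb sι d r := fun r => by
    rw [cDef, hSbdef, hsι, hd₀]
  -- CONVERT, left (member 1): `∇♯_{W,k}·Gw`, rate ρ₁, constant g₀·Bin
  have hLeft : ∀ k, HasL2Majorant (g := toB6 (geo9Y x) (0 : ℝ) True) (fun p : SiteY x.toKIdx × ι => blkC x.toKIdx ιB p.1)
      (conj b (diffLetter (shiftY x.toKIdx) (UboxY x.toKIdx W) (((η : ℂ))⁻¹) k) * conj b Gw)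
      (fun p q => (g₀ * Bin) * (geo9Y x).len p * Real.exp (-(ρ₁ * (geo9Y x).dist p q))) := fun k => by
    rw [hUW]
    have h := hasL2Majorant_diffLetter_prodCfg_mul b (shiftY x.toKIdx) (UboxY x.toKIdx U) (Rr := (0 : ℝ)) (H := True) (g := geo9Y x)
      (fun z => blkC x.toKIdx ιB z) dL hη0 (chartA x.toKIdx a) 1 d₀ M₂ (1 / 4) δ₀ δ₀ (1 / 12) (1 / 12) ρ₁ Λ Bin
      (fun p => (geo9Y x).len p ^ 2) (fun p => (geo9Y x).len p) hwℓ2 hwℓ hw21 (by norm_num) hδ₀.le hM₂ hBin0 hΛ hρ₁0 hr₁ hρ₁δ hrepr hdnn htri hlen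
      h261 hT2 hsmall hA hρu hd₀F k (Gp := conj b Gw) h0 (h1 k)
    refine hasL2Majorant_mono (g := toB6 (geo9Y x) (0 : ℝ) True) _ h fun p q => le_of_eq ?_
    rw [hcDef, hg₀]
  -- CONVERT, right (member 2): `Gw·∇♯_{W,k}`, rate ρ₁, constant g₁·Bin
  have hRight : ∀ k, HasL2Majorant (g := toB6 (geo9Y x) (0 : ℝ) True) (fun p : SiteY x.toKIdx × ι => blkC x.toKIdx ιB p.1)
      (conj b Gw * conj b (diffLetter (shiftY x.toKIdx) (UboxY x.toKIdx W) (((η : ℂ))⁻¹) k))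
      (fun p q => (g₁ * Bin) * (geo9Y x).len p * Real.exp (-(ρ₁ * (geo9Y x).dist p q))) := fun k => by
    rw [hUW]
    have h := hasL2Majorant_mul_diffLetter_prodCfg b (shiftY x.toKIdx) (UboxY x.toKIdx U) (Rr := (0 : ℝ)) (H := True) (g := geo9Y x)
      (fun z => blkC x.toKIdx ιB z) dL hη0 (chartA x.toKIdx a) 1 d₀ M₂ (1 / 4) δ₀ δ₀ (1 / 12) (1 / 12) ρ₁ Λ Bin
      (fun p => (geo9Y x).len p ^ 2) (fun p => (geo9Y x).len p) hwℓ2 hwℓ hw21' (by norm_num) hM₂ hBin0 hΛ hρ₁0 hr₁ hρ₁δ hrepr hdnn htri hlen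
      h261 hTi hsmall hA hρu hd₀F k (Gp := conj b Gw) h0 (h2 k)
    refine hasL2Majorant_mono (g := toB6 (geo9Y x) (0 : ℝ) True) _ h fun p q => le_of_eq ?_
    rw [hcDef, hg₁]
  -- CONVERT, mixed, step B: `(∇♯_{U,k}·Gw)·∇♯_{W,l}`, rate ρ₁, constant g₁·Bin
  have hStepB : ∀ k l, HasL2Majorant (g := toB6 (geo9Y x) (0 : ℝ) True) (fun p : SiteY x.toKIdx × ι => blkC x.toKIdx ιB p.1)
      (conj b (DU k) * conj b Gw * conj b (diffLetter (shiftY x.toKIdx) (UboxY x.toKIdx W) (((η : ℂ))⁻¹) l))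
      (fun p q => (g₁ * Bin) * 1 * Real.exp (-(ρ₁ * (geo9Y x).dist p q))) := fun k l => by
    rw [hUW]
    have h := hasL2Majorant_mul_diffLetter_prodCfg b (shiftY x.toKIdx) (UboxY x.toKIdx U) (Rr := (0 : ℝ)) (H := True) (g := geo9Y x)
      (fun z => blkC x.toKIdx ιB z) dL hη0 (chartA x.toKIdx a) 1 d₀ M₂ (1 / 4) δ₀ δ₀ (1 / 12) (1 / 12) ρ₁ Λ Bin
      (fun p => (geo9Y x).len p) (fun _ => (1 : ℝ)) hwℓ (fun _ => zero_le_one) hw10' (by norm_num) hM₂ hBin0 hΛ hρ₁0 hr₁ hρ₁δ hrepr hdnn htri hlen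
      h261 hTi hsmall hA hρu hd₀F l (Gp := conj b (DU k) * conj b Gw) (h1 k) (h4 k l)
    refine hasL2Majorant_mono (g := toB6 (geo9Y x) (0 : ℝ) True) _ h fun p q => le_of_eq ?_
    rw [hcDef, hg₁]
  -- CONVERT, mixed, step C: LEFT on `Gp′ := Gw·∇♯_{W,l}` (weight ℓ, rate ρ₁, step A = hRight) with left entries from step B, rate ρ₂
  have hMixed : ∀ k l, HasL2Majorant (g := toB6 (geo9Y x) (0 : ℝ) True) (fun p : SiteY x.toKIdx × ι => blkC x.toKIdx ιB p.1)
      (conj b (diffLetter (shiftY x.toKIdx) (UboxY x.toKIdx W) (((η : ℂ))⁻¹) k) * conj b Gw *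
        conj b (diffLetter (shiftY x.toKIdx) (UboxY x.toKIdx W) (((η : ℂ))⁻¹) l))
      (fun p q => (g₁ * (g₁ * Bin)) * 1 * Real.exp (-(ρ₂ * (geo9Y x).dist p q))) := fun k l => by
    have hGp' := hRight l
    have hDGp' : HasL2Majorant (g := toB6 (geo9Y x) (0 : ℝ) True) (fun p : SiteY x.toKIdx × ι => blkC x.toKIdx ιB p.1)
        (conj b (DU k) * (conj b Gw * conj b (diffLetter (shiftY x.toKIdx) (UboxY x.toKIdx W) (((η : ℂ))⁻¹) l)))
        (fun p q => (g₁ * Bin) * 1 * Real.exp (-(ρ₁ * (geo9Y x).dist p q))) := by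
      rw [← mul_assoc]; exact hStepB k l
    rw [mul_assoc, hUW]
    rw [hUW] at hGp' hDGp'
    have h := hasL2Majorant_diffLetter_prodCfg_mul b (shiftY x.toKIdx) (UboxY x.toKIdx U) (Rr := (0 : ℝ)) (H := True) (g := geo9Y x)
      (fun z => blkC x.toKIdx ιB z) dL hη0 (chartA x.toKIdx a) 1 d₀ M₂ (1 / 4) δ₀ ρ₁ (1 / 12) (1 / 12) ρ₂ Λ (g₁ * Bin)
      (fun p => (geo9Y x).len p) (fun _ => (1 : ℝ)) hwℓ (fun _ => zero_le_one) hw10 (by norm_num) hρ₁0 hM₂ (mul_nonneg hg₁0 hBin0) hΛ hρ₂0 hr₂ hρ₂₁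
      hrepr hdnn htri hlen h261 hT1 hsmall hA hρu hd₀F k
      (Gp := conj b Gw * conj b (diffLetter (shiftY x.toKIdx) (prodCfg (UboxY x.toKIdx U) η (chartA x.toKIdx a)) (((η : ℂ))⁻¹) l)) hGp' hDGp'
    refine hasL2Majorant_mono (g := toB6 (geo9Y x) (0 : ℝ) True) _ h fun p q => le_of_eq ?_
    rw [hcDef, hg₁]
  -- the common constant `Bc = g₀·g₁·Bin` and the common rate `δ₀/2`
  have hBc0 : 0 ≤ Bc := by rw [hBc]; exact mul_nonneg (mul_nonneg hg₀0 hg₁0) hBin0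
  have hleBin : Bin ≤ Bc := by rw [hBc]; exact le_mul_of_one_le_left hBin0 (one_le_mul_of_one_le_of_one_le hg₀1 hg₁1)
  have hleL : g₀ * Bin ≤ Bc := by rw [hBc]; exact mul_le_mul_of_nonneg_right (le_mul_of_one_le_right hg₀0 hg₁1) hBin0
  have hleR : g₁ * Bin ≤ Bc := by rw [hBc]; exact mul_le_mul_of_nonneg_right (le_mul_of_one_le_left hg₁0 hg₀1) hBin0
  have hleM : g₁ * (g₁ * Bin) ≤ Bc := by
    rw [hBc, ← mul_assoc]
    -- g₁ ≤ g₀ since cDef is monotone in the rate and ρ₁ ≤ δ₀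
    have hg : g₁ ≤ g₀ := by
      rw [hg₀, hg₁]
      have hcd : cDef M₂ Sb sι d ρ₁ ≤ cDef M₂ Sb sι d δ₀ := by
        unfold cDef
        have hd₀0 : 0 ≤ (2 * ((d : ℝ) + 1)) := by positivity
        exact mul_le_mul_of_nonneg_left (Real.exp_le_exp.2 (mul_le_mul_of_nonneg_right hρ₁δ hd₀0)) (by positivity)
      exact add_le_add_right (mul_le_mul_of_nonneg_right (mul_le_mul_of_nonneg_right (mul_le_mul_of_nonneg_right hcd (by norm_num : (0 : ℝ) ≤ 1 / 4)) hΛ) hc₁0) 1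
    exact mul_le_mul_of_nonneg_right (mul_le_mul_of_nonneg_right hg hg₁0) hBin0
  have mono : ∀ {T : Module.End ℝ (SiteY x.toKIdx × ι → ℝ)} {B r : ℝ} (w : (geo9Y x).Site → ℝ), (∀ p, 0 ≤ w p) → 0 ≤ B → B ≤ Bc → δ₀ / 2 ≤ r →
      HasL2Majorant (g := toB6 (geo9Y x) (0 : ℝ) True) (fun p : SiteY x.toKIdx × ι => blkC x.toKIdx ιB p.1) T
        (fun p q => B * w p * Real.exp (-(r * (geo9Y x).dist p q))) →
      HasL2Majorant (g := toB6 (geo9Y x) (0 : ℝ) True) (fun p : SiteY x.toKIdx × ι => blkC x.toKIdx ιB p.1) T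
        (fun p q => Bc * w p * Real.exp (-(δ₀ / 2 * (geo9Y x).dist p q))) := by
    intro T B r w hw hB hBBc hr h
    have h' := hasL2Majorant_rate_mono (R := (0 : ℝ)) (H := True) (g := geo9Y x) _ B w hB hw hr hdnn h
    exact hasL2Majorant_mono (g := toB6 (geo9Y x) (0 : ℝ) True) _ h' fun p q =>
      mul_le_mul_of_nonneg_right (mul_le_mul_of_nonneg_right hBBc (hw p)) (Real.exp_nonneg _)
  refine ⟨mono (fun p => (geo9Y x).len p ^ 2) hwℓ2 hBin0 hleBin (by linarith) h0,
    fun k => mono (fun p => (geo9Y x).len p) hwℓ (mul_nonneg hg₀0 hBin0) hleL hhalf₁ (hLeft k),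
    fun k => mono (fun p => (geo9Y x).len p) hwℓ (mul_nonneg hg₁0 hBin0) hleR hhalf₁ (hRight k),
    fun k l => mono (fun _ => (1 : ℝ)) (fun _ => zero_le_one) (mul_nonneg hg₁0 (mul_nonneg hg₁0 hBin0)) hleM hhalf₂ (hMixed k l)⟩

end Member

/-! ## §3 ★★ The record's (3.46) block at `W`, the two same-side second-difference members displayed -/

section Assembly

variable (G : Subgroup 𝔸ˣ) (x : MemberY d ℓ hd hL b₀ b₁ Mstar) (par : SiteParY 𝔸 x.toKIdx) {ι : Type} [Fintype ι] [DecidableEq ι]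
  (b : Module.Basis ι ℝ 𝔸) (ιB : BlkY x.toKIdx → IBondY x.toKIdx) [Fintype (geo9Y x).Site] [DecidableEq (geo9Y x).Site]
  (C37 C38 : ℝ → CfgY 𝔸 x.toKIdx → AfldY 𝔸 x.toKIdx → Prop)

/-- ★★ **THE RECORD'S (3.46) BLOCK AT `W = e^{ηa}·U` FROM THE `KSC₃` BLOCK AT THE PRODUCT — the `L²` `hconv` of the coded-carrier chain, WITH THE TWO SAME-SIDE
SECOND-DIFFERENCE MEMBERS DISPLAYED**: under the data of `hconvL2_words_at`, given ALSO block-`ℓ²` majorants `B_H·e^{−(δ₀/2)d}` of the `W`-words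
`∇♯_{W,k}∇♯_{W,l}·η²G′(W)` and `η²G′(W)·∇♯_{W,k}∇♯_{W,l}` (print's 4th and 6th quantities AT `W` — LOCATED: their conversion from the `U`-letters needs the
plaquette of the (3.35)-regular base — print p. 404 after (3.69), not yet typed), NODE 00's reading `kernelFamilyS … id (GpY par) par` satisfies its (3.46) block at `W` with constant
`c_L·max(B_c, B_H)` and rate `δ₀/2`. [cite: Balaban1985BackgroundPropagators, Thm 3.4 p.400, p.403 l.1–9, Thm 3.1 (3.46) p.398, (3.70) p.404, p.404 (after (3.69)), (3.74) p.405; Balaban1984PropagatorsII, Prop. 2.6 (2.140)–(2.141) p.247, Lemma 2.1 p.234] -/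
theorem l2Block_record_at_W_of_KSC₃ (hι : ∀ s : BlkY x.toKIdx, β x.toKIdx.hN x.toKIdx.D x.toKIdx.hk (ιB s) = s)
    (hG1 : ∀ u : 𝔸ˣ, u ∈ G → ‖(u : 𝔸)‖ ≤ 1) {M₂ : ℝ} (hM₂ : 0 ≤ M₂) (hrepr : ∀ (v : 𝔸) (j : ι), |b.repr v j| ≤ M₂ * ‖v‖)
    {Cq : ℝ} (hC37 : ∀ β' U a, C37 β' U a → GVal G x.toKIdx U ∧ CplxLettersY G x par ιB Cq β' U a)
    {δ₀ : ℝ} (hδ₀ : 0 < δ₀) {dL : ℕ} (h261 : Ineq261 dL (toB6 (geo9Y x) (0 : ℝ) True) δ₀ (1 / 12)) {Λ : ℝ} (hΛ : 0 ≤ Λ)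
    (hT1 : ScaleTransfer (geo9Y x) δ₀ (1 / 12) Λ (fun a => (geo9Y x).len a))
    (hT2 : ScaleTransfer (geo9Y x) δ₀ (1 / 12) Λ (fun a => (geo9Y x).len a ^ 2))
    (hTi : ScaleTransfer (geo9Y x) δ₀ (1 / 12) Λ (fun a => ((geo9Y x).len a)⁻¹))
    {B₀ : ℝ} (hB₀ : 0 ≤ B₀) {U : CfgY 𝔸 x.toKIdx} {a : AfldY 𝔸 x.toKIdx} {α₁ : ℝ} (hα₁c : α₁ ≤ 1 / 4) (hC : C37 α₁ U a)
    (hL2 : L2Block (KSC₃ P G x par C37 C38) B₀ δ₀ (.prod U a)) {BH : ℝ} (hBH : 0 ≤ BH)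
    (hLL : ∀ k l : Fin (d + 1) ⊕ Fin (d + 1), HasL2Majorant (g := toB6 (geo9Y x) (0 : ℝ) True) (fun p : SiteY x.toKIdx × ι => blkC x.toKIdx ιB p.1)
      (conj b (diffLetter (shiftY x.toKIdx) (UboxY x.toKIdx (mulY x.toKIdx (fluct (kGeo x.toKIdx).eta a) U)) ((((kGeo x.toKIdx).eta : ℂ))⁻¹) k) *
        conj b (diffLetter (shiftY x.toKIdx) (UboxY x.toKIdx (mulY x.toKIdx (fluct (kGeo x.toKIdx).eta a) U)) ((((kGeo x.toKIdx).eta : ℂ))⁻¹) l) *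
        conj b (((kGeo x.toKIdx).eta ^ 2) • (GpY x.toKIdx par (mulY x.toKIdx (fluct (kGeo x.toKIdx).eta a) U)).restrictScalars ℝ))
      (fun p q => BH * 1 * Real.exp (-(δ₀ / 2 * (geo9Y x).dist p q))))
    (hRR : ∀ k l : Fin (d + 1) ⊕ Fin (d + 1), HasL2Majorant (g := toB6 (geo9Y x) (0 : ℝ) True) (fun p : SiteY x.toKIdx × ι => blkC x.toKIdx ιB p.1)
      (conj b (((kGeo x.toKIdx).eta ^ 2) • (GpY x.toKIdx par (mulY x.toKIdx (fluct (kGeo x.toKIdx).eta a) U)).restrictScalars ℝ) *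
        conj b (diffLetter (shiftY x.toKIdx) (UboxY x.toKIdx (mulY x.toKIdx (fluct (kGeo x.toKIdx).eta a) U)) ((((kGeo x.toKIdx).eta : ℂ))⁻¹) k) *
        conj b (diffLetter (shiftY x.toKIdx) (UboxY x.toKIdx (mulY x.toKIdx (fluct (kGeo x.toKIdx).eta a) U)) ((((kGeo x.toKIdx).eta : ℂ))⁻¹) l))
      (fun p q => BH * 1 * Real.exp (-(δ₀ / 2 * (geo9Y x).dist p q)))) :
    L2Block (kernelFamilyS x.toKIdx (bg9YC 𝔸 G P x) (fun U => U) (GpY x.toKIdx par) par)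
      ((Real.sqrt (Fintype.card ι) * M₂ * ∑ j, ‖b j‖) * max (convConstL2 M₂ (∑ j, ‖b j‖) (Real.sqrt (Fintype.card ι)) d dL δ₀ Λ B₀) BH) (δ₀ / 2)
      (mulY x.toKIdx (fluct (kGeo x.toKIdx).eta a) U) := by
  obtain ⟨h0, h1, h2, h4⟩ := hconvL2_words_at P G x par b ιB C37 C38 hι hG1 hM₂ hrepr hC37 hδ₀ h261 hΛ hT1 hT2 hTi hB₀ hα₁c hC hL2
  set η : ℝ := (kGeo x.toKIdx).eta with hηdef
  set W : CfgY 𝔸 x.toKIdx := mulY x.toKIdx (fluct η a) U with hW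
  set Bc : ℝ := convConstL2 M₂ (∑ j, ‖b j‖) (Real.sqrt (Fintype.card ι)) d dL δ₀ Λ B₀ with hBcdef
  set Gw : Module.End ℝ (SiteY x.toKIdx → 𝔸) := (η ^ 2) • (GpY x.toKIdx par W).restrictScalars ℝ with hGw
  set DW : Fin (d + 1) ⊕ Fin (d + 1) → Module.End ℝ (SiteY x.toKIdx → 𝔸) := fun k => diffLetter (shiftY x.toKIdx) (UboxY x.toKIdx W) (((η : ℂ))⁻¹) k
    with hDW
  have hlen : ∀ y : (geo9Y x).Site, 0 < (geo9Y x).len y := geo9Y_len_pos x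
  have hm0 : 0 ≤ max Bc BH := le_max_of_le_right hBH
  -- the constants up to the common `max Bc BH`, the weights to `pref6`
  have mono : ∀ {T : Module.End ℝ (SiteY x.toKIdx × ι → ℝ)} {B : ℝ} (n : Fin 6) (w : (geo9Y x).Site → ℝ), (∀ p, 0 ≤ w p) → B ≤ max Bc BH →
      (∀ p, w p = B9.pref6 ((geo9Y x).len p) n) →
      HasL2Majorant (g := toB6 (geo9Y x) (0 : ℝ) True) (fun p : SiteY x.toKIdx × ι => blkC x.toKIdx ιB p.1) T
        (fun p q => B * w p * Real.exp (-(δ₀ / 2 * (geo9Y x).dist p q))) →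
      HasL2Majorant (g := toB6 (geo9Y x) (0 : ℝ) True) (fun p : SiteY x.toKIdx × ι => blkC x.toKIdx ιB p.1) T
        (fun p q => max Bc BH * B9.pref6 ((geo9Y x).len p) n * Real.exp (-(δ₀ / 2 * (geo9Y x).dist p q))) := by
    intro T B n w hw hB hwn h
    exact hasL2Majorant_mono (g := toB6 (geo9Y x) (0 : ℝ) True) _ h fun p q => by
      rw [← hwn p]; exact mul_le_mul_of_nonneg_right (mul_le_mul_of_nonneg_right hB (hw p)) (Real.exp_nonneg _)
  refine l2Block_kernelFamilyS_of_hasL2Majorant_wordL x ιB b hι hM₂ hrepr (0 : ℝ) True (B := bg9YC 𝔸 G P x) (fun U => U) (GpY x.toKIdx par) par hm0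
    (c := W) fun n k l => ?_
  match n with
  | 0 => exact mono 0 (fun p => (geo9Y x).len p ^ 2) (fun p => sq_nonneg _) (le_max_left _ _) (fun p => rfl) h0
  | 1 =>
    have h := h1 k
    rw [← B9Eq352DivFormLetters.conj_mul] at h
    exact mono 1 (fun p => (geo9Y x).len p) (fun p => (hlen p).le) (le_max_left _ _) (fun p => rfl) h
  | 2 =>
    have h := h2 k
    rw [← B9Eq352DivFormLetters.conj_mul] at h
    exact mono 2 (fun p => (geo9Y x).len p) (fun p => (hlen p).le) (le_max_left _ _) (fun p => rfl) h
  | 3 =>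
    have h := hLL k l
    rw [← B9Eq352DivFormLetters.conj_mul, ← B9Eq352DivFormLetters.conj_mul] at h
    exact mono 3 (fun _ => (1 : ℝ)) (fun _ => zero_le_one) (le_max_right _ _) (fun p => rfl) h
  | 4 =>
    have h := h4 k l
    rw [← B9Eq352DivFormLetters.conj_mul, ← B9Eq352DivFormLetters.conj_mul] at h
    exact mono 4 (fun _ => (1 : ℝ)) (fun _ => zero_le_one) (le_max_left _ _) (fun p => rfl) h
  | 5 =>
    have h := hRR k l
    rw [← B9Eq352DivFormLetters.conj_mul, ← B9Eq352DivFormLetters.conj_mul] at h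
    exact mono 5 (fun _ => (1 : ℝ)) (fun _ => zero_le_one) (le_max_right _ _) (fun p => rfl) h

end Assembly

end Literature.MathematicalPhysics.QuantumFieldTheory.Balaban1983to89.B9SectBL2TransferConvYR

end

/-!
# `Balaban1983to89.B9SectBL2TransferInYR` — THE CLASS-PARAMETRIC TWIN of `B9SectBL2TransferInY` (CASCADE-R, director-ym №279 GO-R; №277 (3) `hunitA` cure; dag-n06-d SOCKET-(α) class question)

statement-level skeleton of published theorems with citation tags; proofs where landed; nothing here is a claim about the
Yang–Mills mass gap

WHAT THIS FILE IS.  The original module `B9SectBL2TransferInY` types its objects over MODULE 3's member carrier `bg9Y 𝔸 G x` (MODULE 2's small-cube class (3.35)).  This file RE-DECLARES, with UNCHANGED NAMES inside the namespace `…B9SectBL2TransferInYR`, exactly its 2 class-dependent declarations over the CLASS-PARAMETRIC carrier `B9SectBCodedClassR.bg9YC 𝔸 G P x` (`P : RegExtraY …` = the two cube conditions of (3.35)∕(3.36) as a parameter; `bg9Y 𝔸 G x = bg9YC 𝔸 G (extraY 𝔸 G) x` by `rfl`, so every declaration here specialises definitionally to its original; at the record's reading of PRINT's class, `P := extraYPb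 𝔸 G`, the displayed laws `hreg335P` ((3.35) on plaquettes) and the class-keyed `hunitA` become theorems).  The text is the original's VERBATIM under the token surgery `bg9Y 𝔸 G ↦ bg9YC 𝔸 G P`, `NAME ↦ NAME P` for the class-dependent names (P the first explicit argument), and — №277 — the binder `hunitA` re-keyed from «all G-valued U» to «all (3.35)-regular U of the carrier» (`∀ j α₀ U, (bg9YC 𝔸 G P (f j)).Reg335 c35 α₀ U → IsUnit (deltaAY …)`).  Class-free declarations of the original are NOT copied: they are imported and used BY NAME (`open … hiding` the re-declared ones).  Generated by dag-n06-c g16's `gen.py` (HOME `pub-ymgap-dag-n06-c/lean/g16/`); the ORIGINAL MODULE DOCUMENTATION FOLLOWS VERBATIM and describes the mathematics.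

HONEST SCOPE.  Re-typing bookkeeping; nothing of [B9] asserted beyond the original; COUNT-NEUTRAL; N06 NOT discharged; nothing continuum ∕ OS ∕ mass gap ∕ Clay.  Cell `pub-ymgap` (D-0062), Track A node N06 [B9], seat `pub-ymgap-dag-n06-c` g16, 2026-08-29.
-/

/-! Module documentation: that of the original `Balaban1983to89.B9SectBL2TransferInY` applies verbatim to this twin (not repeated here). -/

noncomputable section

namespace Literature.MathematicalPhysics.QuantumFieldTheory.Balaban1983to89.B9SectBL2TransferInYR

open Literature.MathematicalPhysics.QuantumFieldTheory.Balaban1983to89.B9SectBCodedClassR (RegExtraY bg9YC)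
open Literature.MathematicalPhysics.QuantumFieldTheory.Balaban1983to89.B9SectBL2TransferInY hiding hasL2Majorant_allPatterns_of_l2Block l2_KSC₃_base_of_record

open Literature.MathematicalPhysics.QuantumFieldTheory.Balaban1983to89
open Literature.MathematicalPhysics.QuantumFieldTheory.Balaban1983to89.B6KLevelCensusIndexV1 (KIdx kGeo)
open Literature.MathematicalPhysics.QuantumFieldTheory.Balaban1983to89.B6Ineq2142KLevelV1 (β)
open Literature.MathematicalPhysics.QuantumFieldTheory.Balaban1983to89.B6RandomWalk (Triangle254 Ineq261)
open Literature.MathematicalPhysics.QuantumFieldTheory.Balaban1983to89.B6RandomWalkL2 (HasL2Majorant hasL2Majorant_mono)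
open Literature.MathematicalPhysics.QuantumFieldTheory.Balaban1983to89.B9Thm34Ext (toB6)
open Literature.MathematicalPhysics.QuantumFieldTheory.Balaban1983to89.B9Ineq347 (ScaleTransfer)
open Literature.MathematicalPhysics.QuantumFieldTheory.Balaban1983to89.B9FromB6 (L2Block pref6_nonneg)
open Literature.MathematicalPhysics.QuantumFieldTheory.Balaban1983to89.B9Eq352DivFormLetters (conj)
open Literature.MathematicalPhysics.QuantumFieldTheory.Balaban1983to89.B9Eq352GradLetters (diffLetter)
open Literature.MathematicalPhysics.QuantumFieldTheory.Balaban1983to89.B9SectBCodedCarrier (CCfg)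
open Literature.MathematicalPhysics.QuantumFieldTheory.Balaban1983to89.B9Eq360DeltaPrimeAY (AfldY)
open Literature.MathematicalPhysics.QuantumFieldTheory.Balaban1983to89.B9PinMembersKLevelV1 (MemberY geo9Y bg9Y)
open Literature.MathematicalPhysics.QuantumFieldTheory.Balaban1983to89.B9SectBGpLettersY (GVal blkC stencilF_blkC stencilB_blkC norm_le_one_and_inv_of_mem)
open Literature.MathematicalPhysics.QuantumFieldTheory.Balaban1983to89.B9SectBGpFrameCodedYR (codingYx)
open Literature.MathematicalPhysics.QuantumFieldTheory.Balaban1983to89.B9SectBGpReadingsY (suppIn_inl_of_blkC etaS_eq_eta len_label dist_label off_of_suppIn_inl)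
open Literature.MathematicalPhysics.QuantumFieldTheory.Balaban1983to89.B9SectBL2ReadingsY (indY indY_nonneg_le_one supF_indY_le_one cutIn_indY)
open Literature.MathematicalPhysics.QuantumFieldTheory.Balaban1983to89.B9SectBL2DictionaryYR (KSC₃ KSC₃_l2)
open Literature.MathematicalPhysics.QuantumFieldTheory.Balaban1983to89.B9SectBL2DictionaryY (wordSL wordL e6 dirS l2AugS hasL2Majorant_conj_of_indBound l2OfY_wordL l2OfY_le_of_pointwise l2AugS_le_of_hasL2Majorant_wordL abs_le_cutSup_inl cut_off_of_cutIn_inl l2OfY_liftY_le_of_hasL2Majorant_conj)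
open Literature.MathematicalPhysics.QuantumFieldTheory.Balaban1983to89.B9Eq38CrossLettersL2 (hasL2Majorant_cross_left hasL2Majorant_cross_right)
open Literature.MathematicalPhysics.QuantumFieldTheory.Balaban1983to89.B9Ineq363L2 (hasL2Majorant_rate_mono)
open Literature.MathematicalPhysics.QuantumFieldTheory.Balaban1983to89.B9GeoLemma21KLevelV1 (geo9Y_dist_triangle geo9Y_len_pos geo9K_eta_pos)
open Literature.MathematicalPhysics.QuantumFieldTheory.Balaban1983to89.B9RWSums347DefiniteFacesWindow (geo9Y_dist_nonneg)
open Literature.MathematicalPhysics.QuantumFieldTheory.Balaban1983to89.B9Thm314WholeExpansionReads (le_iSup_ball)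
open Literature.MathematicalPhysics.QuantumFieldTheory.Balaban1983to89.Node00 (SiteY BlkY IBondY CfgY BallY SiteOpY SiteParY UboxY shiftY cdS cdsS
  liftY l2OfY etaS kernelFamilyS GpY)

variable {𝔸 : Type} [NormedRing 𝔸] [NormedAlgebra ℂ 𝔸] [CompleteSpace 𝔸] [FiniteDimensional ℝ 𝔸]
variable {d ℓ : ℕ} {hd : 1 ≤ d + 1} {hL : Odd (ℓ + 1) ∧ 1 < ℓ + 1} {b₀ b₁ : ℝ} {Mstar : ℕ} (P : RegExtraY d ℓ hd hL b₀ b₁ Mstar 𝔸)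

/-! ## §1 ★ Reading the record's (3.46) block as block-`ℓ²` majorants of print's six words -/

section Read

variable (x : MemberY d ℓ hd hL b₀ b₁ Mstar) (ιB : BlkY x.toKIdx → IBondY x.toKIdx) {ι : Type} [Fintype ι] (b : Module.Basis ι ℝ 𝔸)
  [Fintype (geo9Y x).Site] [DecidableEq (geo9Y x).Site]

end Read

/-! ## §2 ★ Every orientation pattern with at most one difference on each side, and the cheap same-side patterns -/

section Cross

variable (G : Subgroup 𝔸ˣ) (x : MemberY d ℓ hd hL b₀ b₁ Mstar) (par : SiteParY 𝔸 x.toKIdx) {ι : Type} [Fintype ι] [DecidableEq ι]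
  (b : Module.Basis ι ℝ 𝔸) (ιB : BlkY x.toKIdx → IBondY x.toKIdx) [Fintype (geo9Y x).Site] [DecidableEq (geo9Y x).Site]

/-- ★★ **ALL ORIENTATION PATTERNS OF THE WORDS WITH AT MOST ONE DIFFERENCE ON EACH SIDE, FROM THE RECORD's (3.46) BLOCK AT A `G`-VALUED `U`**: with (2.61)
at `(δ₀, 1/12)` (exponent `dL`) and the transfers of `ℓ`, `ℓ²` at `(δ₀, 1/12)` (constant `Λ ≧ 1`) given, `L2Block (kernelFamilyS … id (GpY par) par) B₀ δ₀ U`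
(`B₀ ≧ 0`) gives at rate `δ₀/2`, constant `c_X·(c_L·B₀)` with `c_X = (1 + c_S·Λ·c₁)²`, `c_S = M₂(Σ‖b_i‖)√|ι|e^{δ₀·2(d+1)}`: `η²G′(U) ≺₂ …ℓ²`, every
`∇♯_k·η²G′(U)` and `η²G′(U)·∇♯_k` `≺₂ …ℓ`, every `∇♯_k·η²G′(U)·∇♯_l ≺₂ …1` — the words the augmented members 0, 1, 2, 4 of `KSC₃` read at `base U`.
[cite: Balaban1985BackgroundPropagators, Thm 3.1 (3.46) p.398, p.398 (first remark), p.403 l.1–9; Balaban1984PropagatorsII, Prop. 2.6 (2.140)–(2.141) p.247, Lemma 2.1 p.234] -/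
theorem hasL2Majorant_allPatterns_of_l2Block (hι : ∀ s : BlkY x.toKIdx, β x.toKIdx.hN x.toKIdx.D x.toKIdx.hk (ιB s) = s)
    (hG1 : ∀ u : 𝔸ˣ, u ∈ G → ‖(u : 𝔸)‖ ≤ 1) {M₂ : ℝ} (hM₂ : 0 ≤ M₂) (hrepr : ∀ (v : 𝔸) (j : ι), |b.repr v j| ≤ M₂ * ‖v‖)
    {δ₀ : ℝ} (hδ₀ : 0 < δ₀) {dL : ℕ} (h261 : Ineq261 dL (toB6 (geo9Y x) (0 : ℝ) True) δ₀ (1 / 12)) {Λ : ℝ} (hΛ : 1 ≤ Λ)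
    (hT1 : ScaleTransfer (geo9Y x) δ₀ (1 / 12) Λ (fun a => (geo9Y x).len a))
    {B₀ : ℝ} (hB₀ : 0 ≤ B₀) {U : CfgY 𝔸 x.toKIdx} (hU : GVal G x.toKIdx U)
    (hL2 : L2Block (kernelFamilyS x.toKIdx (bg9YC 𝔸 G P x) (fun U => U) (GpY x.toKIdx par) par) B₀ δ₀ U) :
    (∀ k l : Fin (d + 1) ⊕ Fin (d + 1), HasL2Majorant (g := toB6 (geo9Y x) (0 : ℝ) True) (fun p : SiteY x.toKIdx × ι => blkC x.toKIdx ιB p.1)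
        (conj b (wordL x.toKIdx (GpY x.toKIdx par) U U (kGeo x.toKIdx).eta 0 k l))
        (fun a a' => crossConstL2 M₂ (∑ j, ‖b j‖) (Real.sqrt (Fintype.card ι)) d dL δ₀ Λ B₀ * B9.pref6 ((geo9Y x).len a) 0 * Real.exp (-(δ₀ / 2 * (geo9Y x).dist a a')))) ∧
      (∀ k l : Fin (d + 1) ⊕ Fin (d + 1), HasL2Majorant (g := toB6 (geo9Y x) (0 : ℝ) True) (fun p : SiteY x.toKIdx × ι => blkC x.toKIdx ιB p.1)
        (conj b (wordL x.toKIdx (GpY x.toKIdx par) U U (kGeo x.toKIdx).eta 1 k l))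
        (fun a a' => crossConstL2 M₂ (∑ j, ‖b j‖) (Real.sqrt (Fintype.card ι)) d dL δ₀ Λ B₀ * B9.pref6 ((geo9Y x).len a) 1 * Real.exp (-(δ₀ / 2 * (geo9Y x).dist a a')))) ∧
      (∀ k l : Fin (d + 1) ⊕ Fin (d + 1), HasL2Majorant (g := toB6 (geo9Y x) (0 : ℝ) True) (fun p : SiteY x.toKIdx × ι => blkC x.toKIdx ιB p.1)
        (conj b (wordL x.toKIdx (GpY x.toKIdx par) U U (kGeo x.toKIdx).eta 2 k l))
        (fun a a' => crossConstL2 M₂ (∑ j, ‖b j‖) (Real.sqrt (Fintype.card ι)) d dL δ₀ Λ B₀ * B9.pref6 ((geo9Y x).len a) 2 * Real.exp (-(δ₀ / 2 * (geo9Y x).dist a a')))) ∧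
      (∀ k l : Fin (d + 1) ⊕ Fin (d + 1), HasL2Majorant (g := toB6 (geo9Y x) (0 : ℝ) True) (fun p : SiteY x.toKIdx × ι => blkC x.toKIdx ιB p.1)
        (conj b (wordL x.toKIdx (GpY x.toKIdx par) U U (kGeo x.toKIdx).eta 4 k l))
        (fun a a' => crossConstL2 M₂ (∑ j, ‖b j‖) (Real.sqrt (Fintype.card ι)) d dL δ₀ Λ B₀ * B9.pref6 ((geo9Y x).len a) 4 * Real.exp (-(δ₀ / 2 * (geo9Y x).dist a a')))) := by
  set cS : ℝ := (1 : ℝ) ^ 2 * M₂ * (∑ i, ‖b i‖) * Real.sqrt (Fintype.card ι) * Real.exp (δ₀ * (2 * ((d : ℝ) + 1))) with hcS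
  set Bx : ℝ := crossConstL2 M₂ (∑ j, ‖b j‖) (Real.sqrt (Fintype.card ι)) d dL δ₀ Λ B₀ with hBxdef
  -- constants and geometry
  set η : ℝ := (kGeo x.toKIdx).eta with hηdef
  have hη0 : 0 < η := geo9K_eta_pos x.toKIdx
  set cL : ℝ := Real.sqrt (Fintype.card ι) * M₂ * ∑ j, ‖b j‖ with hcL
  set Bin : ℝ := cL * B₀ with hBin
  set c₁ : ℝ := B6.c1 dL δ₀ (1 / 12) with hc₁
  set gX : ℝ := 1 + cS * Λ * c₁ with hgX
  set d₀ : ℝ := 2 * ((d : ℝ) + 1) with hd₀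
  have hSb : 0 ≤ ∑ i, ‖b i‖ := Finset.sum_nonneg fun i _ => norm_nonneg _
  have hcL0 : 0 ≤ cL := by positivity
  have hBin0 : 0 ≤ Bin := mul_nonneg hcL0 hB₀
  have hΛ0 : 0 ≤ Λ := le_trans zero_le_one hΛ
  have hc₁0 : 0 ≤ c₁ := B6RandomWalk.c1_nonneg dL δ₀ (1 / 12)
  have hcS0 : 0 ≤ cS := by positivity
  have hgX1 : 1 ≤ gX := by rw [hgX]; exact le_add_of_nonneg_right (by positivity)
  have hgX0 : 0 ≤ gX := le_trans zero_le_one hgX1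
  have hBx : Bx = gX ^ 2 * Bin := by rw [hBxdef, hgX, hcS, hc₁, hBin, hcL]; rfl
  have hdnn : ∀ y y' : (geo9Y x).Site, 0 ≤ (geo9Y x).dist y y' := geo9Y_dist_nonneg x
  have htri : Triangle254 (toB6 (geo9Y x) (0 : ℝ) True) := fun p q r => geo9Y_dist_triangle x p q r
  have hlen : ∀ y : (geo9Y x).Site, 0 < (geo9Y x).len y := geo9Y_len_pos x
  have hwℓ : ∀ p : (geo9Y x).Site, 0 ≤ (geo9Y x).len p := fun p => (hlen p).le
  have hd₀F : ∀ (μ : Fin (d + 1)) (z : SiteY x.toKIdx), (geo9Y x).dist (blkC x.toKIdx ιB z) (blkC x.toKIdx ιB (shiftY x.toKIdx μ z)) ≤ d₀ :=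
    fun μ z => stencilF_blkC x.toKIdx ιB hι μ z
  have hd₀B : ∀ (μ : Fin (d + 1)) (z : SiteY x.toKIdx), (geo9Y x).dist (blkC x.toKIdx ιB z) (blkC x.toKIdx ιB ((shiftY x.toKIdx μ).symm z)) ≤ d₀ :=
    fun μ z => stencilB_blkC x.toKIdx ιB hι μ z
  have hρu : ∀ (μ : Fin (d + 1)) (z : SiteY x.toKIdx), ‖((UboxY x.toKIdx U μ z : 𝔸ˣ) : 𝔸)‖ ≤ 1 ∧ ‖(((UboxY x.toKIdx U μ z)⁻¹ : 𝔸ˣ) : 𝔸)‖ ≤ 1 :=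
    fun μ z => norm_le_one_and_inv_of_mem G hG1 (hU μ _ : UboxY x.toKIdx U μ z ∈ G)
  -- the transfer of the constant weight holds with any `Λ ≧ 1`
  have hT0 : ScaleTransfer (geo9Y x) δ₀ (1 / 12) Λ (fun _ => (1 : ℝ)) := fun y y' => by
    rw [mul_one, mul_one]
    have : Real.exp (-(1 / 12 * δ₀ * (geo9Y x).dist y y')) ≤ 1 := Real.exp_le_one_iff.2 (by nlinarith [hdnn y y', hδ₀.le])
    exact this.trans hΛ
  -- the letters
  set Gu : Module.End ℝ (SiteY x.toKIdx → 𝔸) := (η ^ 2) • (GpY x.toKIdx par U).restrictScalars ℝ with hGu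
  set D : Fin (d + 1) ⊕ Fin (d + 1) → Module.End ℝ (SiteY x.toKIdx → 𝔸) := fun k => diffLetter (shiftY x.toKIdx) (UboxY x.toKIdx U) (((η : ℂ))⁻¹) k
    with hD
  -- READ the record (print's patterns), rate δ₀, constant Bin
  have hK : ∀ (n : Fin 6) (p q : (geo9Y x).Site), (Real.sqrt (Fintype.card ι) * M₂ * ∑ j, ‖b j‖) * B₀ * B9.pref6 ((geo9Y x).len p) n *
      Real.exp (-(δ₀ * (geo9Y x).dist p q)) = Bin * B9.pref6 ((geo9Y x).len p) n * Real.exp (-(δ₀ * (geo9Y x).dist p q)) := fun n p q => by rw [hBin, hcL]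
  have r0 : HasL2Majorant (g := toB6 (geo9Y x) (0 : ℝ) True) (fun p : SiteY x.toKIdx × ι => blkC x.toKIdx ιB p.1) (conj b Gu)
      (fun p q => Bin * (geo9Y x).len p ^ 2 * Real.exp (-(δ₀ * (geo9Y x).dist p q))) := by
    have h := B9SectBL2ReadingsY.hasL2Majorant_conj_of_l2Block x ιB b hι hM₂ hrepr (0 : ℝ) True (bg9YC 𝔸 G P x) (fun U => U) (GpY x.toKIdx par) par hB₀ hL2
    exact hasL2Majorant_mono (g := toB6 (geo9Y x) (0 : ℝ) True) _ h fun p q => le_of_eq (by rw [hBin, hcL])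
  have rr := fun μ ν => hasL2Majorant_recordWords_of_l2Block x ιB b hι hM₂ hrepr (0 : ℝ) True (B := bg9YC 𝔸 G P x) (fun U => U) (GpY x.toKIdx par) par hB₀
    hL2 μ ν
  have r1 : ∀ μ, HasL2Majorant (g := toB6 (geo9Y x) (0 : ℝ) True) (fun p : SiteY x.toKIdx × ι => blkC x.toKIdx ιB p.1) (conj b (D (Sum.inl μ)) * conj b Gu)
      (fun p q => Bin * (geo9Y x).len p * Real.exp (-(δ₀ * (geo9Y x).dist p q))) := fun μ => by
    have h : HasL2Majorant (g := toB6 (geo9Y x) (0 : ℝ) True) (fun p : SiteY x.toKIdx × ι => blkC x.toKIdx ιB p.1) (conj b (D (Sum.inl μ) * Gu))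
        (fun a a' => (Real.sqrt (Fintype.card ι) * M₂ * ∑ j, ‖b j‖) * B₀ * B9.pref6 ((geo9Y x).len a) 1 * Real.exp (-(δ₀ * (geo9Y x).dist a a'))) :=
      (rr μ μ).1
    rw [B9Eq352DivFormLetters.conj_mul] at h
    exact hasL2Majorant_mono (g := toB6 (geo9Y x) (0 : ℝ) True) _ h fun p q => le_of_eq (by rw [hK]; rfl)
  have r2 : ∀ μ, HasL2Majorant (g := toB6 (geo9Y x) (0 : ℝ) True) (fun p : SiteY x.toKIdx × ι => blkC x.toKIdx ιB p.1) (conj b Gu * conj b (D (Sum.inr μ)))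
      (fun p q => Bin * (geo9Y x).len p * Real.exp (-(δ₀ * (geo9Y x).dist p q))) := fun μ => by
    have h : HasL2Majorant (g := toB6 (geo9Y x) (0 : ℝ) True) (fun p : SiteY x.toKIdx × ι => blkC x.toKIdx ιB p.1) (conj b (Gu * D (Sum.inr μ)))
        (fun a a' => (Real.sqrt (Fintype.card ι) * M₂ * ∑ j, ‖b j‖) * B₀ * B9.pref6 ((geo9Y x).len a) 2 * Real.exp (-(δ₀ * (geo9Y x).dist a a'))) :=
      (rr μ μ).2.1
    rw [B9Eq352DivFormLetters.conj_mul] at h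
    exact hasL2Majorant_mono (g := toB6 (geo9Y x) (0 : ℝ) True) _ h fun p q => le_of_eq (by rw [hK]; rfl)
  have r4 : ∀ μ ν, HasL2Majorant (g := toB6 (geo9Y x) (0 : ℝ) True) (fun p : SiteY x.toKIdx × ι => blkC x.toKIdx ιB p.1)
      (conj b (D (Sum.inl μ)) * conj b Gu * conj b (D (Sum.inr ν))) (fun p q => Bin * 1 * Real.exp (-(δ₀ * (geo9Y x).dist p q))) := fun μ ν => by
    have h : HasL2Majorant (g := toB6 (geo9Y x) (0 : ℝ) True) (fun p : SiteY x.toKIdx × ι => blkC x.toKIdx ιB p.1) (conj b (D (Sum.inl μ) * Gu * D (Sum.inr ν)))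
        (fun a a' => (Real.sqrt (Fintype.card ι) * M₂ * ∑ j, ‖b j‖) * B₀ * B9.pref6 ((geo9Y x).len a) 4 * Real.exp (-(δ₀ * (geo9Y x).dist a a'))) :=
      (rr μ ν).2.2.2.1
    rw [B9Eq352DivFormLetters.conj_mul, B9Eq352DivFormLetters.conj_mul] at h
    exact hasL2Majorant_mono (g := toB6 (geo9Y x) (0 : ℝ) True) _ h fun p q => le_of_eq (by rw [hK]; rfl)
  -- rates
  set ρ₁ : ℝ := 5 * δ₀ / 6 with hρ₁
  set ρ₂ : ℝ := 2 * δ₀ / 3 with hρ₂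
  have hρ₁0 : 0 ≤ ρ₁ := by rw [hρ₁]; positivity
  have hρ₂0 : 0 ≤ ρ₂ := by rw [hρ₂]; positivity
  have hr₁ : ρ₁ + (1 / 12 + 1 / 12) * δ₀ ≤ δ₀ := by rw [hρ₁]; linarith
  have hρ₁δ : ρ₁ ≤ δ₀ := by rw [hρ₁]; linarith
  have hr₂ : ρ₂ + (1 / 12 + 1 / 12) * δ₀ ≤ ρ₁ := by rw [hρ₁, hρ₂]; linarith
  have hρ₂₁ : ρ₂ ≤ ρ₁ := by rw [hρ₁, hρ₂]; linarith
  have hαδ : 0 ≤ 1 / 12 * δ₀ := by positivity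
  have hcS_eq : ∀ r : ℝ, (1 : ℝ) ^ 2 * M₂ * (∑ i, ‖b i‖) * Real.sqrt (Fintype.card ι) * Real.exp (r * d₀) ≤ cS ↔ Real.exp (r * d₀) ≤ Real.exp (δ₀ * d₀) ∨
      (1 : ℝ) ^ 2 * M₂ * (∑ i, ‖b i‖) * Real.sqrt (Fintype.card ι) * Real.exp (r * d₀) ≤ cS := fun r => by
    constructor
    · exact fun h => Or.inr h
    · rintro (h | h)
      · exact mul_le_mul_of_nonneg_left h (by positivity)
      · exact h
  have hcS_le : ∀ r : ℝ, r ≤ δ₀ → (1 : ℝ) ^ 2 * M₂ * (∑ i, ‖b i‖) * Real.sqrt (Fintype.card ι) * Real.exp (r * d₀) ≤ cS := fun r hr =>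
    (hcS_eq r).2 (Or.inl (Real.exp_le_exp.2 (mul_le_mul_of_nonneg_right hr (by rw [hd₀]; positivity))))
  -- the generic step constants are bounded by gX·(input constant)
  have hstep : ∀ (r Bc : ℝ), r ≤ δ₀ → 0 ≤ Bc →
      (1 : ℝ) ^ 2 * M₂ * (∑ i, ‖b i‖) * Real.sqrt (Fintype.card ι) * Real.exp (r * d₀) * Λ * B6.c1 dL δ₀ (1 / 12) * Bc ≤ gX * Bc := by
    intro r Bc hr hBc
    have h1 : (1 : ℝ) ^ 2 * M₂ * (∑ i, ‖b i‖) * Real.sqrt (Fintype.card ι) * Real.exp (r * d₀) * Λ * B6.c1 dL δ₀ (1 / 12) ≤ cS * Λ * c₁ :=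
      mul_le_mul_of_nonneg_right (mul_le_mul_of_nonneg_right (hcS_le r hr) hΛ0) hc₁0
    have h2 : cS * Λ * c₁ ≤ gX := by rw [hgX]; linarith
    exact mul_le_mul_of_nonneg_right (h1.trans h2) hBc
  -- the first-order cross conversions (one step, rate ρ₁)
  have x1 : ∀ μ, HasL2Majorant (g := toB6 (geo9Y x) (0 : ℝ) True) (fun p : SiteY x.toKIdx × ι => blkC x.toKIdx ιB p.1) (conj b (D (Sum.inr μ)) * conj b Gu)
      (fun p q => (gX * Bin) * (geo9Y x).len p * Real.exp (-(ρ₁ * (geo9Y x).dist p q))) := fun μ => by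
    have h := hasL2Majorant_cross_left b (shiftY x.toKIdx) (UboxY x.toKIdx U) (Rr := (0 : ℝ)) (H := True) (g := geo9Y x) (fun z => blkC x.toKIdx ιB z) dL
      (((η : ℂ))⁻¹) 1 d₀ M₂ δ₀ δ₀ (1 / 12) (1 / 12) ρ₁ Λ Bin (fun p => (geo9Y x).len p) hwℓ hδ₀.le hM₂ hBin0 hΛ0 hρ₁0 hr₁ hρ₁δ hrepr hdnn htri h261 hT1
      hρu hd₀B μ (Gp := conj b Gu) (r1 μ)
    exact hasL2Majorant_mono (g := toB6 (geo9Y x) (0 : ℝ) True) _ h fun p q =>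
      mul_le_mul_of_nonneg_right (mul_le_mul_of_nonneg_right (hstep δ₀ Bin le_rfl hBin0) (hwℓ p)) (Real.exp_nonneg _)
  have x2 : ∀ μ, HasL2Majorant (g := toB6 (geo9Y x) (0 : ℝ) True) (fun p : SiteY x.toKIdx × ι => blkC x.toKIdx ιB p.1) (conj b Gu * conj b (D (Sum.inl μ)))
      (fun p q => (gX * Bin) * (geo9Y x).len p * Real.exp (-(ρ₁ * (geo9Y x).dist p q))) := fun μ => by
    have h := hasL2Majorant_cross_right b (shiftY x.toKIdx) (UboxY x.toKIdx U) (Rr := (0 : ℝ)) (H := True) (g := geo9Y x) (fun z => blkC x.toKIdx ιB z) dL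
      (((η : ℂ))⁻¹) 1 d₀ M₂ δ₀ δ₀ (1 / 12) (1 / 12) ρ₁ Λ Bin (fun p => (geo9Y x).len p) hwℓ hM₂ hBin0 hΛ hρ₁0 hr₁ hαδ hrepr hdnn htri h261
      hρu hd₀F μ (Gp := conj b Gu) (r2 μ)
    exact hasL2Majorant_mono (g := toB6 (geo9Y x) (0 : ℝ) True) _ h fun p q =>
      mul_le_mul_of_nonneg_right (mul_le_mul_of_nonneg_right (hstep ρ₁ Bin hρ₁δ hBin0) (hwℓ p)) (Real.exp_nonneg _)
  -- the mixed words: (inl, inr) read; (inr, inr) by a left cross; (inl, inl) by a right cross; (inr, inl) by both (rate ρ₂)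
  have m_rr : ∀ μ ν, HasL2Majorant (g := toB6 (geo9Y x) (0 : ℝ) True) (fun p : SiteY x.toKIdx × ι => blkC x.toKIdx ιB p.1)
      (conj b (D (Sum.inr μ)) * (conj b Gu * conj b (D (Sum.inr ν)))) (fun p q => (gX * Bin) * 1 * Real.exp (-(ρ₁ * (geo9Y x).dist p q))) := fun μ ν => by
    have hin : HasL2Majorant (g := toB6 (geo9Y x) (0 : ℝ) True) (fun p : SiteY x.toKIdx × ι => blkC x.toKIdx ιB p.1)
        (conj b (D (Sum.inl μ)) * (conj b Gu * conj b (D (Sum.inr ν)))) (fun p q => Bin * 1 * Real.exp (-(δ₀ * (geo9Y x).dist p q))) := by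
      rw [← mul_assoc]; exact r4 μ ν
    have h := hasL2Majorant_cross_left b (shiftY x.toKIdx) (UboxY x.toKIdx U) (Rr := (0 : ℝ)) (H := True) (g := geo9Y x) (fun z => blkC x.toKIdx ιB z) dL
      (((η : ℂ))⁻¹) 1 d₀ M₂ δ₀ δ₀ (1 / 12) (1 / 12) ρ₁ Λ Bin (fun _ => (1 : ℝ)) (fun _ => zero_le_one) hδ₀.le hM₂ hBin0 hΛ0 hρ₁0 hr₁ hρ₁δ hrepr hdnn htri
      h261 hT0 hρu hd₀B μ (Gp := conj b Gu * conj b (D (Sum.inr ν))) hin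
    exact hasL2Majorant_mono (g := toB6 (geo9Y x) (0 : ℝ) True) _ h fun p q =>
      mul_le_mul_of_nonneg_right (mul_le_mul_of_nonneg_right (hstep δ₀ Bin le_rfl hBin0) zero_le_one) (Real.exp_nonneg _)
  have m_ll : ∀ μ ν, HasL2Majorant (g := toB6 (geo9Y x) (0 : ℝ) True) (fun p : SiteY x.toKIdx × ι => blkC x.toKIdx ιB p.1)
      (conj b (D (Sum.inl μ)) * conj b Gu * conj b (D (Sum.inl ν))) (fun p q => (gX * Bin) * 1 * Real.exp (-(ρ₁ * (geo9Y x).dist p q))) := fun μ ν => by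
    have h := hasL2Majorant_cross_right b (shiftY x.toKIdx) (UboxY x.toKIdx U) (Rr := (0 : ℝ)) (H := True) (g := geo9Y x) (fun z => blkC x.toKIdx ιB z) dL
      (((η : ℂ))⁻¹) 1 d₀ M₂ δ₀ δ₀ (1 / 12) (1 / 12) ρ₁ Λ Bin (fun _ => (1 : ℝ)) (fun _ => zero_le_one) hM₂ hBin0 hΛ hρ₁0 hr₁ hαδ hrepr hdnn htri h261
      hρu hd₀F ν (Gp := conj b (D (Sum.inl μ)) * conj b Gu) (r4 μ ν)
    exact hasL2Majorant_mono (g := toB6 (geo9Y x) (0 : ℝ) True) _ h fun p q =>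
      mul_le_mul_of_nonneg_right (mul_le_mul_of_nonneg_right (hstep ρ₁ Bin hρ₁δ hBin0) zero_le_one) (Real.exp_nonneg _)
  have m_rl : ∀ μ ν, HasL2Majorant (g := toB6 (geo9Y x) (0 : ℝ) True) (fun p : SiteY x.toKIdx × ι => blkC x.toKIdx ιB p.1)
      (conj b (D (Sum.inr μ)) * (conj b Gu * conj b (D (Sum.inl ν)))) (fun p q => (gX * (gX * Bin)) * 1 * Real.exp (-(ρ₂ * (geo9Y x).dist p q))) :=
    fun μ ν => by
    have hin : HasL2Majorant (g := toB6 (geo9Y x) (0 : ℝ) True) (fun p : SiteY x.toKIdx × ι => blkC x.toKIdx ιB p.1)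
        (conj b (D (Sum.inl μ)) * (conj b Gu * conj b (D (Sum.inl ν)))) (fun p q => (gX * Bin) * 1 * Real.exp (-(ρ₁ * (geo9Y x).dist p q))) := by
      rw [← mul_assoc]; exact m_ll μ ν
    have h := hasL2Majorant_cross_left b (shiftY x.toKIdx) (UboxY x.toKIdx U) (Rr := (0 : ℝ)) (H := True) (g := geo9Y x) (fun z => blkC x.toKIdx ιB z) dL
      (((η : ℂ))⁻¹) 1 d₀ M₂ δ₀ ρ₁ (1 / 12) (1 / 12) ρ₂ Λ (gX * Bin) (fun _ => (1 : ℝ)) (fun _ => zero_le_one) hρ₁0 hM₂ (mul_nonneg hgX0 hBin0) hΛ0 hρ₂0 hr₂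
      hρ₂₁ hrepr hdnn htri h261 hT0 hρu hd₀B μ (Gp := conj b Gu * conj b (D (Sum.inl ν))) hin
    exact hasL2Majorant_mono (g := toB6 (geo9Y x) (0 : ℝ) True) _ h fun p q =>
      mul_le_mul_of_nonneg_right (mul_le_mul_of_nonneg_right (hstep ρ₁ (gX * Bin) hρ₁δ (mul_nonneg hgX0 hBin0)) zero_le_one) (Real.exp_nonneg _)
  -- assemble: common constant `Bx = gX²·Bin`, common rate `δ₀/2`
  have hBx0 : 0 ≤ Bx := by rw [hBx]; positivity
  have hle1 : Bin ≤ Bx := by rw [hBx]; exact le_mul_of_one_le_left hBin0 (one_le_pow₀ hgX1)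
  have hle2 : gX * Bin ≤ Bx := by
    rw [hBx, pow_two, mul_assoc]; exact le_mul_of_one_le_left (mul_nonneg hgX0 hBin0) hgX1
  have hle3 : gX * (gX * Bin) ≤ Bx := by rw [hBx, pow_two, mul_assoc]
  have mono : ∀ {Tm : Module.End ℝ (SiteY x.toKIdx × ι → ℝ)} {Bc r : ℝ} (n : Fin 6) (w : (geo9Y x).Site → ℝ), (∀ p, 0 ≤ w p) → 0 ≤ Bc → Bc ≤ Bx →
      δ₀ / 2 ≤ r → (∀ p, w p = B9.pref6 ((geo9Y x).len p) n) →
      HasL2Majorant (g := toB6 (geo9Y x) (0 : ℝ) True) (fun p : SiteY x.toKIdx × ι => blkC x.toKIdx ιB p.1) Tm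
        (fun p q => Bc * w p * Real.exp (-(r * (geo9Y x).dist p q))) →
      HasL2Majorant (g := toB6 (geo9Y x) (0 : ℝ) True) (fun p : SiteY x.toKIdx × ι => blkC x.toKIdx ιB p.1) Tm
        (fun p q => Bx * B9.pref6 ((geo9Y x).len p) n * Real.exp (-(δ₀ / 2 * (geo9Y x).dist p q))) := by
    intro Tm Bc r n w hw hBc hBcx hr hwn h
    have h' := hasL2Majorant_rate_mono (R := (0 : ℝ)) (H := True) (g := geo9Y x) _ Bc w hBc hw hr hdnn h
    exact hasL2Majorant_mono (g := toB6 (geo9Y x) (0 : ℝ) True) _ h' fun p q => by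
      rw [← hwn p]; exact mul_le_mul_of_nonneg_right (mul_le_mul_of_nonneg_right hBcx (hw p)) (Real.exp_nonneg _)
  have h01 : δ₀ / 2 ≤ ρ₁ := by rw [hρ₁]; linarith
  have h02 : δ₀ / 2 ≤ ρ₂ := by rw [hρ₂]; linarith
  have h00 : δ₀ / 2 ≤ δ₀ := by linarith
  refine ⟨fun k l => ?_, fun k l => ?_, fun k l => ?_, fun k l => ?_⟩
  · -- word 0: the record's own entry
    exact mono 0 (fun p => (geo9Y x).len p ^ 2) (fun p => sq_nonneg _) hBin0 hle1 h00 (fun p => rfl) r0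
  · -- word 1: `D k * Gu`
    show HasL2Majorant (g := toB6 (geo9Y x) (0 : ℝ) True) (fun p : SiteY x.toKIdx × ι => blkC x.toKIdx ιB p.1) (conj b (D k * Gu)) _
    rw [B9Eq352DivFormLetters.conj_mul]
    cases k with
    | inl μ => exact mono 1 (fun p => (geo9Y x).len p) hwℓ hBin0 hle1 h00 (fun p => rfl) (r1 μ)
    | inr μ => exact mono 1 (fun p => (geo9Y x).len p) hwℓ (mul_nonneg hgX0 hBin0) hle2 h01 (fun p => rfl) (x1 μ)
  · -- word 2: `Gu * D k`
    show HasL2Majorant (g := toB6 (geo9Y x) (0 : ℝ) True) (fun p : SiteY x.toKIdx × ι => blkC x.toKIdx ιB p.1) (conj b (Gu * D k)) _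
    rw [B9Eq352DivFormLetters.conj_mul]
    cases k with
    | inl μ => exact mono 2 (fun p => (geo9Y x).len p) hwℓ (mul_nonneg hgX0 hBin0) hle2 h01 (fun p => rfl) (x2 μ)
    | inr μ => exact mono 2 (fun p => (geo9Y x).len p) hwℓ hBin0 hle1 h00 (fun p => rfl) (r2 μ)
  · -- word 4: `D k * Gu * D l`
    show HasL2Majorant (g := toB6 (geo9Y x) (0 : ℝ) True) (fun p : SiteY x.toKIdx × ι => blkC x.toKIdx ιB p.1) (conj b (D k * Gu * D l)) _
    rw [B9Eq352DivFormLetters.conj_mul, B9Eq352DivFormLetters.conj_mul]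
    cases k with
    | inl μ =>
      cases l with
      | inl ν => exact mono 4 (fun _ => (1 : ℝ)) (fun _ => zero_le_one) (mul_nonneg hgX0 hBin0) hle2 h01 (fun p => rfl) (m_ll μ ν)
      | inr ν => exact mono 4 (fun _ => (1 : ℝ)) (fun _ => zero_le_one) hBin0 hle1 h00 (fun p => rfl) (r4 μ ν)
    | inr μ =>
      cases l with
      | inl ν =>
        rw [mul_assoc]
        exact mono 4 (fun _ => (1 : ℝ)) (fun _ => zero_le_one) (mul_nonneg hgX0 (mul_nonneg hgX0 hBin0)) hle3 h02 (fun p => rfl) (m_rl μ ν)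
      | inr ν =>
        rw [mul_assoc]
        exact mono 4 (fun _ => (1 : ℝ)) (fun _ => zero_le_one) (mul_nonneg hgX0 hBin0) hle2 h01 (fun p => rfl) (m_rr μ ν)

end Cross

/-! ## §3 ★★ The augmented members 0, 1, 2, 4 of `KSC₃` at a base from the record's (3.46) block -/

section Members

variable (G : Subgroup 𝔸ˣ) (x : MemberY d ℓ hd hL b₀ b₁ Mstar) (par : SiteParY 𝔸 x.toKIdx) {ι : Type} [Fintype ι] [DecidableEq ι]
  (b : Module.Basis ι ℝ 𝔸) (ιB : BlkY x.toKIdx → IBondY x.toKIdx) [Fintype (geo9Y x).Site] [DecidableEq (geo9Y x).Site]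
  (C37 C38 : ℝ → CfgY 𝔸 x.toKIdx → AfldY 𝔸 x.toKIdx → Prop)

/-- ★★ **THE AUGMENTED (3.46) MEMBERS 0, 1, 2, 4 OF `KSC₃` AT A BASE FROM THE RECORD's BLOCK** — the plaquette-free part of `hin` for the `L²` member: at a
member with a section `ιB` of `β`, unit-norm structure group, (2.61) and the transfer of `ℓ` at `(δ₀, 1/12)` (constant `Λ ≧ 1`) given, a `G`-valued `U` with
the record's `L2Block … B₀ δ₀ U` (`B₀ ≧ 0`): members `n ∈ {0, 1, 2, 4}` of `KSC₃` at `base U` satisfy their (3.46) block with constant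
`c_L·crossConstL2 …` and rate `δ₀/2`.  (Members 3, 5 are NOT produced here — LOCATED, module header.)
[cite: Balaban1985BackgroundPropagators, Thm 3.1 (3.46) p.398, p.398 (first remark), Thm 3.4 p.400, p.403 l.1–9; Balaban1984PropagatorsII, Prop. 2.6 (2.140)–(2.141) p.247, Lemma 2.1 p.234] -/
theorem l2_KSC₃_base_of_record (hι : ∀ s : BlkY x.toKIdx, β x.toKIdx.hN x.toKIdx.D x.toKIdx.hk (ιB s) = s)
    (hG1 : ∀ u : 𝔸ˣ, u ∈ G → ‖(u : 𝔸)‖ ≤ 1) {M₂ : ℝ} (hM₂ : 0 ≤ M₂) (hrepr : ∀ (v : 𝔸) (j : ι), |b.repr v j| ≤ M₂ * ‖v‖)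
    {δ₀ : ℝ} (hδ₀ : 0 < δ₀) {dL : ℕ} (h261 : Ineq261 dL (toB6 (geo9Y x) (0 : ℝ) True) δ₀ (1 / 12)) {Λ : ℝ} (hΛ : 1 ≤ Λ)
    (hT1 : ScaleTransfer (geo9Y x) δ₀ (1 / 12) Λ (fun a => (geo9Y x).len a))
    {B₀ : ℝ} (hB₀ : 0 ≤ B₀) {U : CfgY 𝔸 x.toKIdx} (hU : GVal G x.toKIdx U)
    (hL2 : L2Block (kernelFamilyS x.toKIdx (bg9YC 𝔸 G P x) (fun U => U) (GpY x.toKIdx par) par) B₀ δ₀ U)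
    (n : Fin 6) (hn : n = 0 ∨ n = 1 ∨ n = 2 ∨ n = 4)
    (lam : (geo9Y x).Loc) (h : (geo9Y x).Cut) (y y' : IBondY x.toKIdx) (hcut : (geo9Y x).cutIn h y) (hsupp : (geo9Y x).suppIn lam y') :
    (KSC₃ P G x par C37 C38).l2 n (.base U) lam h ≤
      ((Real.sqrt (Fintype.card ι) * M₂ * ∑ j, ‖b j‖) * crossConstL2 M₂ (∑ j, ‖b j‖) (Real.sqrt (Fintype.card ι)) d dL δ₀ Λ B₀) *
        B9.pref6 ((geo9Y x).len y) n * (geo9Y x).cutSup h * Real.exp (-(δ₀ / 2 * (geo9Y x).dist y y')) * (geo9Y x).l2Norm lam := by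
  obtain ⟨h0, h1, h2, h4⟩ := hasL2Majorant_allPatterns_of_l2Block P G x par b ιB hι hG1 hM₂ hrepr hδ₀ h261 hΛ hT1 hB₀ hU hL2
  have hSb : 0 ≤ ∑ j, ‖b j‖ := Finset.sum_nonneg fun j _ => norm_nonneg _
  have hBx0 : 0 ≤ crossConstL2 M₂ (∑ j, ‖b j‖) (Real.sqrt (Fintype.card ι)) d dL δ₀ Λ B₀ :=
    crossConstL2_nonneg hM₂ hSb (Real.sqrt_nonneg _) d dL δ₀ Λ hB₀
  rw [KSC₃_l2]
  refine l2AugS_le_of_hasL2Majorant_wordL x ιB b hι hM₂ hrepr (0 : ℝ) True (B := (codingYx P G x C37 C38).bg) (fun c => c) (GpY x.toKIdx par) hBx0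
    (c := .base U) n (fun k l => ?_) lam h y y' hcut hsupp
  rcases hn with rfl | rfl | rfl | rfl
  · exact h0 k l
  · exact h1 k l
  · exact h2 k l
  · exact h4 k l

end Members

end Literature.MathematicalPhysics.QuantumFieldTheory.Balaban1983to89.B9SectBL2TransferInYR

end
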